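import Literature.Probability.Percolation.ExplorationCrossings
import Literature.Probability.Percolation.ExplorationPolygon
import Literature.Probability.Percolation.InterfaceScalingLimitProofs
import Literature.Probability.RandomPlanarGeometry.JordanDomainInterior
import Literature.Probability.Percolation.AnnulusCrossingBoundProofs
import HarnessLib

/-!
# Multiple shell crossings by the critical bond interface: discharge of
`bondExploration_traversalBound` and `isTightLaws_map_bondInterface`

Topic: Probability / Percolation. This file proves the named fact
`Literature.Probability.Percolation.bondExploration_traversalBound` (`InterfaceScalingLimitProofs.lean`) —
Aizenman–Burchard's hypothesis H1 (Duke Math. J. 99 (1999), eq. (1.3); Appendix A, Thm A.1: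
"in two dimensions H1 holds for bond percolation at `p = 1/2`: the `k` crossing segments cut
the annulus into sectors, each containing an open or a dual-open crossing; RSW and BK") for
the medial exploration path of critical bond percolation on `δℤ²` in a Jordan Dobrushin domain,
in the tree's formulation with a shell-dependent threshold — and with it the tightness
statement `Literature.Probability.Percolation.isTightLaws_map_bondInterface` (crit-perc.S26 for bond percolation;
AB99 Thm 1.2), as `isTightLaws_map_bondInterface_holds`, via the assembly
`isTightLaws_map_bondInterface_of_traversalBound` and the abstract criterion
`isTightMeasureSet_of_traversalBounds` (`CurveTightness.lean`, AB99 Thms 1.1–1.2) already in the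
tree. It is organised in three parts, each with its own synopsis below:

* **Part I. Side components of the perturbed exploration polygon in an annulus** (the
  deterministic planar core: free segments, side points, stretches as paths, the
  distinct-side-pairs lemma `sidePair_ne` by winding numbers, chains stay in side components);
* **Part II. The polygon and the boundary of the Jordan domain** (the polygon stays inside the
  domain, taint lemmas, counting boundary excursions across the annulus);
* **Part III. The probabilistic estimate** (tight crossings, many side components, few tainted
  ones, disjoint open/dual-open crossings, iterated BK–Reimer, the one-crossing bound
  `annulusOpenCrossing_half_le_holds`, self-duality), ending with
  `bondExploration_traversalBound_holds` and `isTightLaws_map_bondInterface_holds`.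

The definitions used (chosen corners `cv`/`cf`, shifted points `pS`/`pT`, `dartPiece`,
`connPiece`, `pertTrace`, `leftPt`/`rightPt`/`sideSeg`, `subPath`, `tIdx`) are in
`ExplorationPolygon.lean`; the lattice-unit geometry in `MedialPerturbation.lean`. Everything
here is proved; no new definitions.
-/

noncomputable section

/-!
## Part I. Side components of the exploration polygon in an annulus ("sectors")

Topic: Probability / Percolation (deterministic planar part of the multiple-crossing estimate
`Literature.Probability.Percolation.bondExploration_traversalBound`; Aizenman–Burchard, Duke Math. J. 99 (1999),
Appendix A: "the `k` crossing segments cut the annulus into sectors, each containing an open or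
a dual-open crossing"). For the medial exploration path `γ` of a bond configuration in a
discrete Dobrushin domain (`IsMedialExploration`, `MedialInterface.lean`) at mesh `δ` we use the
**perturbed polygon** of `MedialPerturbation.lean` (dart pieces `dartPiece i` and connectors
`connPiece i`, at mesh `δ`; union `pertTrace`) and prove:

* **Free segments** (from the lattice-unit facts of `MedialPerturbation.lean` and the turning
  dichotomy `IsMedialExploration.turn_dichotomy`): the trace meets the half-diagonal of a
  corner only along the dart of that corner (`mem_dartPiece_of_mem_halfDiag`), meets a lattice
  edge only if that edge is crossed by the path, hence closed in the completed configuration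
  (`edge_of_mem_edgeTrace`), meets the centre segment of two adjacent faces only if their
  common side is followed, hence open (`exists_mem_bc_of_mem_centerSeg`), and meets a closed
  face only if it is an inner face (`isInnerFace_of_mem_closedSq`).
* **Side points and side components.** For a dart index `m`, the left point
  `leftPt m = δ v_m` and the right point `rightPt m = δ (f_m + (1+i)/2)`, joined by the side
  segment `sideSeg m`; in the open annulus `𝔸` minus the trace, their components are the *side
  components* of the dart. Only the `m`-th dart piece meets `sideSeg m`, with nonzero crossing
  defect (`crossInc_dartPiece_ne_zero`).
* **Stretches as paths** (`subPath`, `crossInc_subPath_eq`, `exists_inout_path`) and the time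
  bookkeeping `tIdx` (index of the dart traversed at a given time).
* **Distinct side pairs** (`sidePair_ne`): if three dart indices `mₐ`, `m_b` and index ranges
  `I_b ∋ m_b`, `I_c` (with `mₐ ∉ I_b ∪ I_c`, `m_b ∉ I_c`) are such that the polygon pieces over
  `I_b` and over `I_c` join the inner disc to the outside of `𝔸`, then the unordered pair of
  side components of `mₐ` differs from that of `m_b`. Proof: close the two polygon stretches
  into a loop outside `𝔸`; its crossing defect (`Path.crossInc`, `ArgumentIncrement.lean`)
  relative to `[leftPt m_b, rightPt m_b]` is `±2πi` (one transversal crossing, by the dart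
  piece `m_b`) and relative to `[leftPt mₐ, rightPt mₐ]` is `0`; winding numbers are constant
  on components (`sidePairs_ne_of_wind`). No Jordan curve theorem is used.
* **Chains stay in side components** (`cv_mem_connectedComponentIn`,
  `cf_mem_connectedComponentIn`): along a stretch of darts whose neighbourhoods stay in `𝔸`,
  the left vertices lie in the left component and the right face centres in the right
  component of any dart of the stretch (consecutive ones are joined by an open edge, resp. a
  centre segment across a closed edge, both free of the trace).

Everything here is proved; probability enters only in Part III.
-/

section SideComponents

open Set Metric Complex
open scoped Pointwise

namespace Literature.Probability.Percolation

section IsMedialExploration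
open Literature.Probability.LatticeModels (IsMedialExploration)
open Literature.Probability.LatticeModels.IsMedialExploration

variable {D : LatticeModels.DiscreteDobrushin} {ω : BondConfig (LatticeModels.Site 2)} {a : LatticeModels.MedialVertex}
  {l : List LatticeModels.MedialVertex} (hexp : IsMedialExploration D ω (a :: l))

/-! ### The two kinds of connectors -/

/-- **The turn at the `i`-th medial vertex** (`1 ≤ i`), with the chosen corners: either a
vertex turn (same vertex, the two faces border the crossed edge `eᵢ`, whose dual edge is
dual-open) or a face turn (same face, the two vertices span the followed edge `eᵢ`, which is
open), in the completed configuration. (Smirnov 2001, §2.) [cite: Smirnov2001, §2] -/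
theorem _root_.Literature.Probability.LatticeModels.IsMedialExploration.turn_cases {i : ℕ} (hi1 : 1 ≤ i) (hi : i < ((a :: l).zip l).length) :
    (hexp.cv (i - 1) = hexp.cv i ∧ hexp.cf (i - 1) ≠ hexp.cf i ∧
        dualEdge (((a :: l).zip l)[i]).1 = s(hexp.cf (i - 1), hexp.cf i) ∧
        dualEdge (((a :: l).zip l)[i]).1 ∈ dualConfig (D.bcBondConfig ω)) ∨
      (hexp.cf (i - 1) = hexp.cf i ∧ hexp.cv (i - 1) ≠ hexp.cv i ∧
        (((a :: l).zip l)[i]).1 = s(hexp.cv (i - 1), hexp.cv i) ∧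
        (((a :: l).zip l)[i]).1 ∈ D.bcBondConfig ω) := by
  obtain ⟨j, rfl⟩ : ∃ j, i = j + 1 := ⟨i - 1, by omega⟩
  simp only [Nat.add_sub_cancel]
  obtain ⟨hc₁, -, hs₁, ht₁⟩ := hexp.corner_spec (i := j) (by omega)
  obtain ⟨hc₂, -, hs₂, ht₂⟩ := hexp.corner_spec hi
  have hfst := LatticeModels.getElem_zip_succ_fst a l j hi
  rw [hfst] at hs₂ ⊢
  exact hexp.turn_dichotomy (LatticeModels.infix_three_of_getElem_zip a l j hi) hc₁ hs₁ ht₁ hc₂ hs₂ ht₂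

/-- The crossed/followed edge at the `i`-th medial vertex is the target edge of dart `i - 1`
and the source edge of dart `i`. [folklore] -/
theorem _root_.Literature.Probability.LatticeModels.IsMedialExploration.cornerTarget_eq_cornerSource {i : ℕ} (hi1 : 1 ≤ i) (hi : i < ((a :: l).zip l).length) :
    LatticeModels.cornerTarget (hexp.cv (i - 1)) (hexp.cf (i - 1)) = LatticeModels.cornerSource (hexp.cv i) (hexp.cf i) := by
  obtain ⟨j, rfl⟩ : ∃ j, i = j + 1 := ⟨i - 1, by omega⟩
  simp only [Nat.add_sub_cancel]
  obtain ⟨-, -, -, ht₁⟩ := hexp.corner_spec (i := j) (by omega)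
  obtain ⟨-, -, hs₂, -⟩ := hexp.corner_spec hi
  rw [ht₁, hs₂, LatticeModels.getElem_zip_succ_fst a l j hi]

/-- **Shape of a connector.** A point of the `i`-th connector, read in lattice units, either
has the vertex-connector shape across the crossed edge `eᵢ` (vertex turn: column
`f_{i-1} I = fᵢ I`, line through `vᵢ`), or the face-connector shape along the followed edge
`eᵢ` inside the common face (face turn). [folklore] -/
theorem _root_.Literature.Probability.LatticeModels.IsMedialExploration.connPiece_cases {i : ℕ} (hi1 : 1 ≤ i) (hi : i < ((a :: l).zip l).length) (hδ : 0 < D.δ)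
    {z : ℂ} (hz : z ∈ hexp.connPiece i) :
    (∃ I J : Fin 2, J ≠ I ∧ hexp.cv (i - 1) = hexp.cv i ∧ hexp.cf (i - 1) ≠ hexp.cf i ∧
        hexp.cf (i - 1) I = hexp.cf i I ∧
        ((hexp.cf (i - 1) J + 1 = hexp.cv i J ∧ hexp.cf i J = hexp.cv i J) ∨
          (hexp.cf (i - 1) J = hexp.cv i J ∧ hexp.cf i J + 1 = hexp.cv i J)) ∧
        LatticeModels.cornerSource (hexp.cv i) (hexp.cf i) = LatticeModels.cornerEdge (hexp.cv i) (hexp.cf i) I ∧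
        LatticeModels.VConnShape I J (hexp.cf (i - 1) I) (hexp.cv i J) (D.δ⁻¹ • z)) ∨
      (∃ I J : Fin 2, J ≠ I ∧ hexp.cf (i - 1) = hexp.cf i ∧ hexp.cv (i - 1) ≠ hexp.cv i ∧
        hexp.cv (i - 1) I + hexp.cv i I = 2 * hexp.cf i I + 1 ∧ hexp.cv (i - 1) J = hexp.cv i J ∧
        LatticeModels.FConnShape I J (hexp.cf i I) (hexp.cf i J) (D.δ⁻¹ • z) ∧
        (coordVec (D.δ⁻¹ • z) J = hexp.cf i J + 1 / 8 → hexp.cv (i - 1) J = hexp.cf i J) ∧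
        (coordVec (D.δ⁻¹ • z) J = hexp.cf i J + 7 / 8 → hexp.cv (i - 1) J = hexp.cf i J + 1)) := by
  have he := hexp.cornerTarget_eq_cornerSource hi1 hi
  have hz' : D.δ⁻¹ • z ∈ segment ℝ (LatticeModels.dartPt (hexp.cv (i - 1)) (hexp.cf (i - 1))
      (LatticeModels.tgtDir (hexp.cv (i - 1)) (hexp.cf (i - 1))))
      (LatticeModels.dartPt (hexp.cv i) (hexp.cf i) (LatticeModels.srcDir (hexp.cv i) (hexp.cf i))) := by
    rw [← mem_segment_smul_iff hδ.ne']
    exact hz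
  rcases hexp.turn_cases hi1 hi with ⟨hv, hf, -, -⟩ | ⟨hf, hv, -, -⟩
  · left
    rw [hv] at he hz'
    obtain ⟨J, hJI⟩ := exists_ne (LatticeModels.tgtDir (hexp.cv i) (hexp.cf (i - 1)))
    obtain ⟨hdir, hcol, hside⟩ :=
      LatticeModels.vertexTurn_dirs (hv ▸ hexp.isCorner (i := i - 1) (by omega)) (hexp.isCorner hi) hf he
    rw [hdir] at hz'
    refine ⟨_, J, hJI, hv, hf, hcol, hside J hJI, ?_, ?_⟩
    · rw [LatticeModels.cornerSource_eq_cornerEdge, hdir]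
    · exact LatticeModels.vConn_shape hJI hcol (hside J hJI) hz'
  · right
    rw [hf] at he hz'
    obtain ⟨J, hJI⟩ := exists_ne (LatticeModels.tgtDir (hexp.cv (i - 1)) (hexp.cf i))
    obtain ⟨hdir, hsum, hoth⟩ := LatticeModels.faceTurn_dirs hv he
    rw [hdir] at hz'
    obtain ⟨hshape, h1, h2⟩ :=
      LatticeModels.fConn_shape (hf ▸ hexp.isCorner (i := i - 1) (by omega)) hJI hsum (hoth J hJI) hz'
    exact ⟨_, J, hJI, hf, hv, hsum, hoth J hJI, hshape, h1, h2⟩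

/-! ### Free segments at mesh `δ` -/

/-- **The trace meets the half-diagonal of a corner only along the dart of that corner.**
[folklore] -/
theorem _root_.Literature.Probability.LatticeModels.IsMedialExploration.mem_dartPiece_of_mem_halfDiag (hδ : 0 < D.δ) {v f : LatticeModels.Site 2} (hvf : LatticeModels.IsCorner v f) {z : ℂ}
    (hz : z ∈ hexp.pertTrace) (hz' : D.δ⁻¹ • z ∈ LatticeModels.halfDiag v f) :
    ∃ i, i < ((a :: l).zip l).length ∧ hexp.cv i = v ∧ hexp.cf i = f ∧ z ∈ hexp.dartPiece i := by
  rcases hexp.mem_pertTrace_iff.1 hz with ⟨i, hi, hzi⟩ | ⟨i, ⟨hi1, hi⟩, hzi⟩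
  · refine ⟨i, hi, ?_⟩
    have hzi' : D.δ⁻¹ • z ∈ LatticeModels.dartSeg (hexp.cv i) (hexp.cf i) := by
      rw [hexp.dartPiece_eq, Set.mem_smul_set_iff_inv_smul_mem₀ hδ.ne'] at hzi
      exact hzi
    obtain ⟨h1, h2⟩ := LatticeModels.eq_of_dartSeg_inter_halfDiag hvf (hexp.isCorner hi) ⟨_, hzi', hz'⟩
    exact ⟨h1, h2, hzi⟩
  · exfalso
    rcases hexp.connPiece_cases hi1 hi hδ hzi with
      ⟨I, J, -, -, -, -, -, -, hshape⟩ | ⟨I, J, -, -, -, -, -, hshape, -, -⟩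
    · exact hshape.not_mem_halfDiag hvf hz'
    · exact hshape.not_mem_halfDiag hvf hz'

/-- The crossed edge of a vertex turn, in coordinates: the lattice edge on the line through
`v` across `I`, occupying the column of the faces. [folklore] -/
theorem _root_.Literature.Probability.LatticeModels.IsMedialExploration.cornerEdge_eq_of_coords {v f : LatticeModels.Site 2} (hv : LatticeModels.IsCorner v f) {I J : Fin 2} (hJI : J ≠ I)
    {u w : LatticeModels.Site 2} (huj : u J = v J) (hwj : w J = v J)
    (hi : (u I = f I ∧ w I = f I + 1) ∨ (u I = f I + 1 ∧ w I = f I)) :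
    s(u, w) = LatticeModels.cornerEdge v f I := by
  rw [LatticeModels.cornerEdge]
  have hnb : ∀ k, LatticeModels.cornerNeighbor v f I k = if k = I then 2 * f I + 1 - v I else v k := by
    intro k
    by_cases hk : k = I
    · subst hk; simp [LatticeModels.cornerNeighbor]
    · rw [if_neg hk, LatticeModels.cornerNeighbor_apply_of_ne hk]
  have key : ∀ x : LatticeModels.Site 2, (x = v ∨ x = LatticeModels.cornerNeighbor v f I) ↔
      (x J = v J ∧ (x I = v I ∨ x I = 2 * f I + 1 - v I)) := by
    intro x
    constructor
    · rintro (rfl | rfl)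
      · exact ⟨rfl, Or.inl rfl⟩
      · rw [hnb J, if_neg hJI, hnb I, if_pos rfl]; exact ⟨rfl, Or.inr rfl⟩
    · rintro ⟨hxj, hxi | hxi⟩
      · left; funext k
        rcases LatticeModels.fin_two_cases_of_ne hJI k with rfl | rfl
        · exact hxi
        · exact hxj
      · right; funext k
        rw [hnb k]
        rcases LatticeModels.fin_two_cases_of_ne hJI k with rfl | rfl
        · rw [if_pos rfl]; exact hxi
        · rw [if_neg hJI]; exact hxj
  have hvI := hv I
  rw [Sym2.eq_iff]
  rcases hi with ⟨hui, hwi⟩ | ⟨hui, hwi⟩ <;> rcases hvI with hvI | hvI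
  · left
    exact ⟨((key u).2 ⟨huj, Or.inl (by omega)⟩).resolve_right (fun h => by
        have := congrFun h I; rw [hnb I, if_pos rfl] at this; omega),
      ((key w).2 ⟨hwj, Or.inr (by omega)⟩).resolve_left (fun h => by
        have := congrFun h I; omega)⟩
  · right
    exact ⟨((key u).2 ⟨huj, Or.inr (by omega)⟩).resolve_left (fun h => by
        have := congrFun h I; omega),
      ((key w).2 ⟨hwj, Or.inl (by omega)⟩).resolve_right (fun h => by
        have := congrFun h I; rw [hnb I, if_pos rfl] at this; omega)⟩
  · right
    exact ⟨((key u).2 ⟨huj, Or.inr (by omega)⟩).resolve_left (fun h => by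
        have := congrFun h I; omega),
      ((key w).2 ⟨hwj, Or.inl (by omega)⟩).resolve_right (fun h => by
        have := congrFun h I; rw [hnb I, if_pos rfl] at this; omega)⟩
  · left
    exact ⟨((key u).2 ⟨huj, Or.inl (by omega)⟩).resolve_right (fun h => by
        have := congrFun h I; rw [hnb I, if_pos rfl] at this; omega),
      ((key w).2 ⟨hwj, Or.inr (by omega)⟩).resolve_left (fun h => by
        have := congrFun h I; omega)⟩

/-- **The trace meets a lattice edge only if the path crosses it**: then the edge is the
source edge `eᵢ` of some dart `i ≥ 1` reached by a vertex turn, so it is a side of an inner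
face and is *closed* in the completed configuration. [folklore] -/
theorem _root_.Literature.Probability.LatticeModels.IsMedialExploration.edge_of_mem_edgeTrace (hδ : 0 < D.δ) {u w : LatticeModels.Site 2} (huw : (LatticeModels.zdGraph 2).Adj u w) {z : ℂ}
    (hz : z ∈ hexp.pertTrace) (hz' : D.δ⁻¹ • z ∈ edgeTrace s(u, w)) :
    ∃ (i : ℕ) (hi : 1 ≤ i ∧ i < ((a :: l).zip l).length), s(u, w) = (((a :: l).zip l)[i]'hi.2).1 ∧
      s(u, w) = LatticeModels.cornerSource (hexp.cv i) (hexp.cf i) ∧ s(u, w) ∉ D.bcBondConfig ω := by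
  rcases hexp.mem_pertTrace_iff.1 hz with ⟨i, hi, hzi⟩ | ⟨i, ⟨hi1, hi⟩, hzi⟩
  · exfalso
    rw [hexp.dartPiece_eq, Set.mem_smul_set_iff_inv_smul_mem₀ hδ.ne'] at hzi
    exact LatticeModels.dartSeg_inter_edgeTrace (hexp.isCorner hi) huw hzi hz'
  · rcases hexp.connPiece_cases hi1 hi hδ hzi with
      ⟨I, J, hJI, -, hfne, hcol, -, hsrc, hshape⟩ | ⟨I, J, -, -, -, -, -, hshape, -, -⟩
    · obtain ⟨huj, hwj, hui⟩ := hshape.edge_eq huw hz'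
      rw [hcol] at hui
      have hedge : s(u, w) = LatticeModels.cornerEdge (hexp.cv i) (hexp.cf i) I :=
        cornerEdge_eq_of_coords (hexp.isCorner hi) hJI huj hwj hui
      have hsrc' : s(u, w) = LatticeModels.cornerSource (hexp.cv i) (hexp.cf i) := by rw [hsrc, hedge]
      have hzip : s(u, w) = (((a :: l).zip l)[i]).1 := by
        rw [hsrc', (hexp.corner_spec hi).2.2.1]
      refine ⟨i, ⟨hi1, hi⟩, hzip, hsrc', ?_⟩
      -- the crossed edge is closed: its dual edge is dual-open
      rcases hexp.turn_cases hi1 hi with ⟨-, -, -, hdual⟩ | ⟨hf, -, -, -⟩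
      · rw [← hzip] at hdual
        rw [mem_dualConfig_iff] at hdual
        exact fun hmem => hdual.2 _ hmem rfl
      · exact absurd hf hfne
    · exact absurd hz' (hshape.not_mem_edgeTrace huw)

/-- **The dual edge of a lattice edge, in coordinates.** The edge `{u, w}` on the line
`{x_J = u J}` occupying the column `u I … u I + 1` separates the two faces of that column on
either side of the line: its dual edge is `{f', g'}`. [folklore] -/
theorem _root_.Literature.Probability.LatticeModels.IsMedialExploration.dualEdge_eq_of_coords {I J : Fin 2} (hJI : J ≠ I) {u w f' g' : LatticeModels.Site 2} (hwj : w J = u J)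
    (hwi : w I = u I + 1) (hf'I : f' I = u I) (hg'I : g' I = u I)
    (hfg : (f' J + 1 = u J ∧ g' J = u J) ∨ (g' J + 1 = u J ∧ f' J = u J)) :
    dualEdge s(u, w) = s(f', g') := by
  have hw : w = u + Pi.single I 1 := by
    funext k
    rcases LatticeModels.fin_two_cases_of_ne hJI k with rfl | rfl
    · simp [hwi]
    · rw [Pi.add_apply, Pi.single_eq_of_ne hJI, add_zero, hwj]
  rw [hw]
  rcases LatticeModels.fin_two_eq_other hJI with ⟨rfl, rfl⟩ | ⟨rfl, rfl⟩
  · rw [dualEdge_horizontal, Sym2.eq_iff]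
    rcases hfg with ⟨h1, h2⟩ | ⟨h1, h2⟩
    · left; constructor
      · funext k; rcases LatticeModels.fin_two_eq_zero_or_one k with rfl | rfl
        · simp [hf'I]
        · simp; omega
      · funext k; rcases LatticeModels.fin_two_eq_zero_or_one k with rfl | rfl
        · exact hg'I.symm
        · exact h2.symm
    · right; constructor
      · funext k; rcases LatticeModels.fin_two_eq_zero_or_one k with rfl | rfl
        · simp [hg'I]
        · simp; omega
      · funext k; rcases LatticeModels.fin_two_eq_zero_or_one k with rfl | rfl
        · exact hf'I.symm
        · exact h2.symm
  · rw [dualEdge_vertical, Sym2.eq_iff]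
    rcases hfg with ⟨h1, h2⟩ | ⟨h1, h2⟩
    · left; constructor
      · funext k; rcases LatticeModels.fin_two_eq_zero_or_one k with rfl | rfl
        · simp; omega
        · simp [hf'I]
      · funext k; rcases LatticeModels.fin_two_eq_zero_or_one k with rfl | rfl
        · exact h2.symm
        · exact hg'I.symm
    · right; constructor
      · funext k; rcases LatticeModels.fin_two_eq_zero_or_one k with rfl | rfl
        · simp; omega
        · simp [hg'I]
      · funext k; rcases LatticeModels.fin_two_eq_zero_or_one k with rfl | rfl
        · exact h2.symm
        · exact hf'I.symm

/-- **The trace meets the centre segment of two adjacent faces only along a followed edge**,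
which then separates the two faces and is *open* in the completed configuration. [folklore] -/
theorem _root_.Literature.Probability.LatticeModels.IsMedialExploration.exists_mem_bc_of_mem_centerSeg (hδ : 0 < D.δ) {f g : LatticeModels.Site 2} (hfg : (LatticeModels.zdGraph 2).Adj f g)
    {z : ℂ} (hz : z ∈ hexp.pertTrace) (hz' : D.δ⁻¹ • z ∈ LatticeModels.centerSeg f g) :
    ∃ e ∈ D.bcBondConfig ω, dualEdge e = s(f, g) := by
  rcases hexp.mem_pertTrace_iff.1 hz with ⟨i, hi, hzi⟩ | ⟨i, ⟨hi1, hi⟩, hzi⟩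
  · exfalso
    rw [hexp.dartPiece_eq, Set.mem_smul_set_iff_inv_smul_mem₀ hδ.ne'] at hzi
    exact LatticeModels.dartSeg_inter_centerSeg (hexp.isCorner hi) hfg hzi hz'
  · rcases hexp.connPiece_cases hi1 hi hδ hzi with
      ⟨I, J, -, -, -, -, -, -, hshape⟩ | ⟨I, J, hJI, hf, hv, hsum, hoth, hshape, h1, h2⟩
    · exact absurd hz' (hshape.not_mem_centerSeg hfg)
    · -- the followed edge `eᵢ = {v_{i-1}, vᵢ}` is open
      rcases hexp.turn_cases hi1 hi with ⟨hv', -, -, -⟩ | ⟨-, -, he, hopen⟩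
      · exact absurd hv' hv
      · refine ⟨_, hopen, ?_⟩
        rw [he]
        obtain ⟨hfI, hgI, hfgJ⟩ := hshape.centerSeg_faces (L := hexp.cv (i - 1) J) h1 h2 hfg hz'
        -- order the two endpoints so that the second is the first plus `e_I`
        have hvI := (hf ▸ hexp.isCorner (i := i - 1) (by omega)) I
        rcases hvI with hvI | hvI
        · -- `v_{i-1} I = fᵢ I`, `vᵢ I = fᵢ I + 1`
          refine dualEdge_eq_of_coords hJI (hoth.symm) (by omega) (by omega) (by omega) ?_
          rcases hfgJ with ⟨h3, h4⟩ | ⟨h3, h4⟩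
          · exact Or.inl ⟨by omega, by omega⟩
          · exact Or.inr ⟨by omega, by omega⟩
        · -- `v_{i-1} I = fᵢ I + 1`, `vᵢ I = fᵢ I`: swap
          rw [Sym2.eq_swap]
          refine dualEdge_eq_of_coords hJI hoth (by omega) (by omega) (by omega) ?_
          rcases hfgJ with ⟨h3, h4⟩ | ⟨h3, h4⟩
          · exact Or.inl ⟨by omega, by omega⟩
          · exact Or.inr ⟨by omega, by omega⟩

/-- **The trace meets a closed face only if it is inner.** [folklore] -/
theorem _root_.Literature.Probability.LatticeModels.IsMedialExploration.isInnerFace_of_mem_closedSq (hδ : 0 < D.δ) {g : LatticeModels.Site 2} {z : ℂ} (hz : z ∈ hexp.pertTrace)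
    (hz' : D.δ⁻¹ • z ∈ LatticeModels.closedSq g) : D.IsInnerFace g := by
  rcases hexp.mem_pertTrace_iff.1 hz with ⟨i, hi, hzi⟩ | ⟨i, ⟨hi1, hi⟩, hzi⟩
  · rw [hexp.dartPiece_eq, Set.mem_smul_set_iff_inv_smul_mem₀ hδ.ne'] at hzi
    rw [LatticeModels.eq_of_dartSeg_inter_closedSq (hexp.isCorner hi) hzi hz']
    exact hexp.isInnerFace hi
  · rcases hexp.connPiece_cases hi1 hi hδ hzi with
      ⟨I, J, hJI, -, -, hcol, hside, -, hshape⟩ | ⟨I, J, hJI, hf, -, -, -, hshape, -, -⟩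
    · obtain ⟨hgI, hgJ⟩ := hshape.closedSq_faces hz'
      have : g = hexp.cf (i - 1) ∨ g = hexp.cf i := by
        rcases hgJ with hgJ | hgJ <;> rcases hside with ⟨h1, h2⟩ | ⟨h1, h2⟩
        · right; funext k; rcases LatticeModels.fin_two_cases_of_ne hJI k with rfl | rfl <;> omega
        · left; funext k; rcases LatticeModels.fin_two_cases_of_ne hJI k with rfl | rfl <;> omega
        · left; funext k; rcases LatticeModels.fin_two_cases_of_ne hJI k with rfl | rfl <;> omega
        · right; funext k; rcases LatticeModels.fin_two_cases_of_ne hJI k with rfl | rfl <;> omega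
      rcases this with rfl | rfl
      · exact hexp.isInnerFace (by omega)
      · exact hexp.isInnerFace hi
    · obtain ⟨hgI, hgJ⟩ := hshape.closedSq_face hz'
      have : g = hexp.cf i := by
        funext k; rcases LatticeModels.fin_two_cases_of_ne hJI k with rfl | rfl
        · exact hgI
        · exact hgJ
      rw [this]
      exact hexp.isInnerFace hi

/-! ### Distances: pieces stay near their dart -/

/-- The shifted points are within `2δ` of the dart vertex. [folklore] -/
theorem _root_.Literature.Probability.LatticeModels.IsMedialExploration.dist_pS_le (hδ : 0 < D.δ) {i : ℕ} (hi : i < ((a :: l).zip l).length) :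
    dist (hexp.pS i) (LatticeModels.meshPoint D.δ (hexp.cv i)) ≤ 2 * D.δ ∧
      dist (hexp.pT i) (LatticeModels.meshPoint D.δ (hexp.cv i)) ≤ 2 * D.δ := by
  rw [pS, pT, meshPoint_eq_smul, dist_smul₀, dist_smul₀, Real.norm_eq_abs, abs_of_pos hδ]
  constructor <;> nlinarith [LatticeModels.dist_dartPt_toComplex_le (hexp.isCorner hi) (LatticeModels.srcDir (hexp.cv i) (hexp.cf i)),
    LatticeModels.dist_dartPt_toComplex_le (hexp.isCorner hi) (LatticeModels.tgtDir (hexp.cv i) (hexp.cf i))]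

/-- A dart piece stays within `2δ` of its vertex. [folklore] -/
theorem _root_.Literature.Probability.LatticeModels.IsMedialExploration.dartPiece_subset_closedBall (hδ : 0 < D.δ) {i : ℕ} (hi : i < ((a :: l).zip l).length) :
    hexp.dartPiece i ⊆ closedBall (LatticeModels.meshPoint D.δ (hexp.cv i)) (2 * D.δ) :=
  (convex_closedBall _ _).segment_subset (mem_closedBall.2 (hexp.dist_pS_le hδ hi).1) (mem_closedBall.2 (hexp.dist_pS_le hδ hi).2)

/-- Consecutive dart vertices are equal or nearest neighbours. [folklore] -/
theorem _root_.Literature.Probability.LatticeModels.IsMedialExploration.dist_cv_cv_le (hδ : 0 < D.δ) {i : ℕ} (hi1 : 1 ≤ i) (hi : i < ((a :: l).zip l).length) :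
    dist (LatticeModels.meshPoint D.δ (hexp.cv (i - 1))) (LatticeModels.meshPoint D.δ (hexp.cv i)) ≤ D.δ := by
  rcases hexp.turn_cases hi1 hi with ⟨hv, -⟩ | ⟨-, -, he, hopen⟩
  · rw [hv, dist_self]; exact hδ.le
  · have hadj : (LatticeModels.zdGraph 2).Adj (hexp.cv (i - 1)) (hexp.cv i) :=
      LatticeModels.meshGraph_le_zdGraph _ _ (LatticeModels.discreteDomainGraph_le_meshGraph _ _ (adj_of_turn_face he hopen))
    rw [Literature.Probability.Percolation.dist_meshPoint_of_adj hadj, abs_of_pos hδ]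

/-- A connector stays within `3δ` of the vertices of both darts it joins. [folklore] -/
theorem _root_.Literature.Probability.LatticeModels.IsMedialExploration.connPiece_subset_closedBall (hδ : 0 < D.δ) {i : ℕ} (hi1 : 1 ≤ i)
    (hi : i < ((a :: l).zip l).length) :
    hexp.connPiece i ⊆ closedBall (LatticeModels.meshPoint D.δ (hexp.cv i)) (3 * D.δ) ∩
      closedBall (LatticeModels.meshPoint D.δ (hexp.cv (i - 1))) (3 * D.δ) := by
  have h1 := hexp.dist_pS_le hδ (i := i - 1) (by omega)
  have h2 := hexp.dist_pS_le hδ hi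
  have h3 := hexp.dist_cv_cv_le hδ hi1 hi
  refine subset_inter ((convex_closedBall _ _).segment_subset (mem_closedBall.2 ?_) (mem_closedBall.2 ?_))
    ((convex_closedBall _ _).segment_subset (mem_closedBall.2 ?_) (mem_closedBall.2 ?_))
  · linarith [dist_triangle (hexp.pT (i - 1)) (LatticeModels.meshPoint D.δ (hexp.cv (i - 1))) (LatticeModels.meshPoint D.δ (hexp.cv i))]
  · linarith [h2.1]
  · linarith [h1.2]
  · linarith [dist_triangle (hexp.pS i) (LatticeModels.meshPoint D.δ (hexp.cv i)) (LatticeModels.meshPoint D.δ (hexp.cv (i - 1))),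
      dist_comm (LatticeModels.meshPoint D.δ (hexp.cv (i - 1))) (LatticeModels.meshPoint D.δ (hexp.cv i))]

/-- Membership in the side segment, in lattice units. [folklore] -/
theorem _root_.Literature.Probability.LatticeModels.IsMedialExploration.mem_sideSeg_iff (hδ : 0 < D.δ) {m : ℕ} {z : ℂ} :
    z ∈ hexp.sideSeg m ↔ D.δ⁻¹ • z ∈ LatticeModels.halfDiag (hexp.cv m) (hexp.cf m) := by
  rw [sideSeg, leftPt, rightPt, meshPoint_eq_smul, mem_segment_smul_iff hδ.ne']
  rfl

/-- **Only the `m`-th dart piece meets the `m`-th side segment**: other dart pieces miss it.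
[folklore] -/
theorem _root_.Literature.Probability.LatticeModels.IsMedialExploration.dartPiece_disjoint_sideSeg (hδ : 0 < D.δ) {i m : ℕ} (hi : i < ((a :: l).zip l).length)
    (hm : m < ((a :: l).zip l).length) (him : i ≠ m) {z : ℂ} (hz : z ∈ hexp.dartPiece i) :
    z ∉ hexp.sideSeg m := by
  intro hz'
  rw [hexp.mem_sideSeg_iff hδ] at hz'
  rw [hexp.dartPiece_eq, Set.mem_smul_set_iff_inv_smul_mem₀ hδ.ne'] at hz
  obtain ⟨hv, hf⟩ := LatticeModels.eq_of_dartSeg_inter_halfDiag (hexp.isCorner hm) (hexp.isCorner hi) ⟨_, hz, hz'⟩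
  exact him (hexp.corner_injective hi hm hv hf)

/-- Connectors miss every side segment. [folklore] -/
theorem _root_.Literature.Probability.LatticeModels.IsMedialExploration.connPiece_disjoint_sideSeg (hδ : 0 < D.δ) {i m : ℕ} (hi1 : 1 ≤ i)
    (hi : i < ((a :: l).zip l).length) (hm : m < ((a :: l).zip l).length) {z : ℂ}
    (hz : z ∈ hexp.connPiece i) : z ∉ hexp.sideSeg m := by
  intro hz'
  rw [hexp.mem_sideSeg_iff hδ] at hz'
  rcases hexp.connPiece_cases hi1 hi hδ hz with
    ⟨I, J, -, -, -, -, -, -, hshape⟩ | ⟨I, J, -, -, -, -, -, hshape, -, -⟩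
  · exact hshape.not_mem_halfDiag (hexp.isCorner hm) hz'
  · exact hshape.not_mem_halfDiag (hexp.isCorner hm) hz'

/-- The trace meets the `m`-th side segment only inside the `m`-th dart piece. [folklore] -/
theorem _root_.Literature.Probability.LatticeModels.IsMedialExploration.mem_dartPiece_of_mem_sideSeg (hδ : 0 < D.δ) {m : ℕ} (hm : m < ((a :: l).zip l).length)
    {z : ℂ} (hz : z ∈ hexp.pertTrace) (hz' : z ∈ hexp.sideSeg m) : z ∈ hexp.dartPiece m := by
  rcases hexp.mem_pertTrace_iff.1 hz with ⟨i, hi, hzi⟩ | ⟨i, ⟨hi1, hi⟩, hzi⟩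
  · by_cases him : i = m
    · exact him ▸ hzi
    · exact absurd hz' (hexp.dartPiece_disjoint_sideSeg hδ hi hm him hzi)
  · exact absurd hz' (hexp.connPiece_disjoint_sideSeg hδ hi1 hi hm hzi)

/-- The left point is off the trace. [folklore] -/
theorem _root_.Literature.Probability.LatticeModels.IsMedialExploration.leftPt_not_mem_pertTrace (hδ : 0 < D.δ) {m : ℕ} (hm : m < ((a :: l).zip l).length) :
    hexp.leftPt m ∉ hexp.pertTrace := by
  intro h
  have h' := hexp.mem_dartPiece_of_mem_sideSeg hδ hm h (left_mem_segment _ _ _)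
  rw [hexp.dartPiece_eq, Set.mem_smul_set_iff_inv_smul_mem₀ hδ.ne', leftPt, meshPoint_eq_smul,
    inv_smul_smul₀ hδ.ne'] at h'
  exact LatticeModels.toComplex_not_mem_dartSeg (hexp.isCorner hm) h'

/-- The right point is off the trace. [folklore] -/
theorem _root_.Literature.Probability.LatticeModels.IsMedialExploration.rightPt_not_mem_pertTrace (hδ : 0 < D.δ) {m : ℕ} (hm : m < ((a :: l).zip l).length) :
    hexp.rightPt m ∉ hexp.pertTrace := by
  intro h
  have h' := hexp.mem_dartPiece_of_mem_sideSeg hδ hm h (right_mem_segment _ _ _)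
  rw [hexp.dartPiece_eq, Set.mem_smul_set_iff_inv_smul_mem₀ hδ.ne', rightPt,
    inv_smul_smul₀ hδ.ne'] at h'
  exact LatticeModels.faceCenter_not_mem_dartSeg (hexp.isCorner hm) h'

/-- The side segment stays within `δ` of the left point. [folklore] -/
theorem _root_.Literature.Probability.LatticeModels.IsMedialExploration.sideSeg_subset_closedBall (hδ : 0 < D.δ) {m : ℕ} (hm : m < ((a :: l).zip l).length) :
    hexp.sideSeg m ⊆ closedBall (hexp.leftPt m) D.δ := by
  refine (convex_closedBall _ _).segment_subset (mem_closedBall.2 (by rw [dist_self]; exact hδ.le)) (mem_closedBall.2 ?_)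
  rw [rightPt, leftPt, meshPoint_eq_smul, dist_smul₀, Real.norm_eq_abs, abs_of_pos hδ]
  nlinarith [LatticeModels.dist_faceCenter_toComplex_le (hexp.isCorner hm)]

/-- **The `m`-th dart piece crosses the `m`-th side segment with nonzero crossing defect**
(`±2πi`). [folklore] -/
theorem _root_.Literature.Probability.LatticeModels.IsMedialExploration.crossInc_dartPiece_ne_zero (hδ : 0 < D.δ) {m : ℕ} (hm : m < ((a :: l).zip l).length) :
    (Path.segment (hexp.pS m) (hexp.pT m)).crossInc (hexp.leftPt m) (hexp.rightPt m) ≠ 0 := by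
  have key := LatticeModels.crossInc_smul_dartSeg_ne_zero (hexp.isCorner hm) hδ
  have congr : ∀ {A A' B B' : ℂ}, A = A' → B = B' → ∀ ℓ r : ℂ,
      (Path.segment A B).crossInc ℓ r = (Path.segment A' B').crossInc ℓ r := by
    intro A A' B B' hA hB ℓ r; subst hA hB; rfl
  rw [leftPt, rightPt, meshPoint_eq_smul]
  by_cases h : hexp.cv m 0 - hexp.cf m 0 = hexp.cv m 1 - hexp.cf m 1
  · have e1 : hexp.pS m = D.δ • LatticeModels.dartPt (hexp.cv m) (hexp.cf m) 0 := by rw [pS, LatticeModels.srcDir, if_pos h]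
    have e2 : hexp.pT m = D.δ • LatticeModels.dartPt (hexp.cv m) (hexp.cf m) 1 := by rw [pT, LatticeModels.tgtDir, if_pos h]
    rw [congr e1 e2]
    exact key
  · have e1 : hexp.pS m = D.δ • LatticeModels.dartPt (hexp.cv m) (hexp.cf m) 1 := by rw [pS, LatticeModels.srcDir, if_neg h]
    have e2 : hexp.pT m = D.δ • LatticeModels.dartPt (hexp.cv m) (hexp.cf m) 0 := by rw [pT, LatticeModels.tgtDir, if_neg h]
    rw [congr e1 e2, ← Path.segment_symm, Path.crossInc_symm]
    · exact neg_ne_zero.2 key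
    · rw [Path.range_segment, ← smul_segment_eq, Set.smul_mem_smul_set_iff₀ hδ.ne']
      exact LatticeModels.toComplex_not_mem_dartSeg (hexp.isCorner hm)
    · rw [Path.range_segment, ← smul_segment_eq, Set.smul_mem_smul_set_iff₀ hδ.ne']
      exact LatticeModels.faceCenter_not_mem_dartSeg (hexp.isCorner hm)

/-! ### Left vertices and right face centres move within side components -/

/-- **Consecutive left vertices are joined in the complement of the trace**: the segment
between the mesh points of `v_{i-1}` and `vᵢ` (a point, or an open lattice edge) misses the
trace. [folklore] -/
theorem _root_.Literature.Probability.LatticeModels.IsMedialExploration.segment_cv_disjoint_pertTrace (hδ : 0 < D.δ) {i : ℕ} (hi1 : 1 ≤ i)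
    (hi : i < ((a :: l).zip l).length) {z : ℂ}
    (hz : z ∈ segment ℝ (LatticeModels.meshPoint D.δ (hexp.cv (i - 1))) (LatticeModels.meshPoint D.δ (hexp.cv i))) :
    z ∉ hexp.pertTrace := by
  intro hz'
  rcases hexp.turn_cases hi1 hi with ⟨hv, -⟩ | ⟨-, -, he, hopen⟩
  · rw [hv, segment_same] at hz
    rw [mem_singleton_iff.1 hz] at hz'
    exact hexp.leftPt_not_mem_pertTrace hδ hi hz'
  · have hadj : (LatticeModels.zdGraph 2).Adj (hexp.cv (i - 1)) (hexp.cv i) :=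
      LatticeModels.meshGraph_le_zdGraph _ _ (LatticeModels.discreteDomainGraph_le_meshGraph _ _ (adj_of_turn_face he hopen))
    rw [meshPoint_eq_smul, meshPoint_eq_smul, mem_segment_smul_iff hδ.ne'] at hz
    obtain ⟨j, -, -, -, hclosed⟩ := hexp.edge_of_mem_edgeTrace hδ hadj hz' hz
    rw [he] at hopen
    exact hclosed hopen

/-- **Consecutive right face centres are joined in the complement of the trace**: the segment
between the centres of `f_{i-1}` and `fᵢ` (a point, or the dual edge of a closed edge) misses
the trace. [folklore] -/
theorem _root_.Literature.Probability.LatticeModels.IsMedialExploration.segment_cf_disjoint_pertTrace (hδ : 0 < D.δ) {i : ℕ} (hi1 : 1 ≤ i)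
    (hi : i < ((a :: l).zip l).length) {z : ℂ}
    (hz : z ∈ segment ℝ (D.δ • LatticeModels.faceCenter (hexp.cf (i - 1))) (D.δ • LatticeModels.faceCenter (hexp.cf i))) :
    z ∉ hexp.pertTrace := by
  intro hz'
  rcases hexp.turn_cases hi1 hi with ⟨-, -, he, hdual⟩ | ⟨hf, -⟩
  · have hadj : (LatticeModels.zdGraph 2).Adj (hexp.cf (i - 1)) (hexp.cf i) := adj_of_turn_vertex he hdual
    rw [mem_segment_smul_iff hδ.ne'] at hz
    obtain ⟨e, he', hde⟩ := hexp.exists_mem_bc_of_mem_centerSeg hδ hadj hz' hz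
    rw [mem_dualConfig_iff] at hdual
    exact hdual.2 e he' (hde.trans he.symm)
  · rw [hf, segment_same] at hz
    rw [mem_singleton_iff.1 hz] at hz'
    exact hexp.rightPt_not_mem_pertTrace hδ hi hz'

/-- **Left vertices of a stretch lie in one component.** If the `δ`-neighbourhoods of the
vertices of the darts `i₀, …, i₁` lie in the open set `A`, then in `A` minus the trace all
their mesh points lie in the component of any one of them. [folklore] -/
theorem _root_.Literature.Probability.LatticeModels.IsMedialExploration.cv_mem_connectedComponentIn (hδ : 0 < D.δ) {A : Set ℂ} {i₀ i₁ : ℕ}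
    (hi₁ : i₁ < ((a :: l).zip l).length)
    (hball : ∀ i, i₀ ≤ i → i ≤ i₁ → closedBall (LatticeModels.meshPoint D.δ (hexp.cv i)) D.δ ⊆ A)
    {i m : ℕ} (hi₀ : i₀ ≤ i) (hi : i ≤ i₁) (hm₀ : i₀ ≤ m) (hm : m ≤ i₁) :
    LatticeModels.meshPoint D.δ (hexp.cv i) ∈ connectedComponentIn (A \ hexp.pertTrace) (LatticeModels.meshPoint D.δ (hexp.cv m)) := by
  -- every vertex is in the component of `v_{i₀}`
  have key : ∀ k, i₀ + k ≤ i₁ → connectedComponentIn (A \ hexp.pertTrace) (LatticeModels.meshPoint D.δ (hexp.cv (i₀ + k))) =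
      connectedComponentIn (A \ hexp.pertTrace) (LatticeModels.meshPoint D.δ (hexp.cv i₀)) := by
    intro k
    induction k with
    | zero => intro; rfl
    | succ k ih =>
      intro hk
      rw [← ih (by omega), show i₀ + (k + 1) = i₀ + k + 1 by omega]
      refine connectedComponentIn_eq ?_
      -- the segment from `v_{i₀+k}` to `v_{i₀+k+1}` lies in `A` minus the trace
      have hseg : segment ℝ (LatticeModels.meshPoint D.δ (hexp.cv (i₀ + k))) (LatticeModels.meshPoint D.δ (hexp.cv (i₀ + k + 1))) ⊆
          A \ hexp.pertTrace := by
        intro z hz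
        refine ⟨hball (i₀ + k) (by omega) (by omega) ?_, ?_⟩
        · have h := hexp.dist_cv_cv_le hδ (i := i₀ + k + 1) (by omega) (by omega)
          simp only [Nat.add_sub_cancel] at h
          exact (convex_closedBall _ _).segment_subset (mem_closedBall.2 (by rw [dist_self]; exact hδ.le)) (mem_closedBall.2 (by rw [dist_comm]; exact h)) hz
        · exact hexp.segment_cv_disjoint_pertTrace hδ (i := i₀ + k + 1) (by omega) (by omega)
            (by simpa only [Nat.add_sub_cancel] using hz)
      have hconn : IsPreconnected (segment ℝ (LatticeModels.meshPoint D.δ (hexp.cv (i₀ + k)))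
          (LatticeModels.meshPoint D.δ (hexp.cv (i₀ + k + 1)))) := (convex_segment _ _).isPreconnected
      have := hconn.subset_connectedComponentIn (right_mem_segment _ _ _) hseg
      exact this (left_mem_segment _ _ _)
  obtain ⟨k, rfl⟩ : ∃ k, i = i₀ + k := ⟨i - i₀, by omega⟩
  obtain ⟨k', rfl⟩ : ∃ k', m = i₀ + k' := ⟨m - i₀, by omega⟩
  have h1 := key k (by omega)
  have h2 := key k' (by omega)
  have hmem : LatticeModels.meshPoint D.δ (hexp.cv (i₀ + k)) ∈
      connectedComponentIn (A \ hexp.pertTrace) (LatticeModels.meshPoint D.δ (hexp.cv (i₀ + k))) := by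
    refine mem_connectedComponentIn ⟨hball (i₀ + k) (by omega) (by omega) (mem_closedBall_self hδ.le), ?_⟩
    exact hexp.leftPt_not_mem_pertTrace hδ (m := i₀ + k) (by omega)
  rw [h1, ← h2] at hmem
  exact hmem

/-- **Right face centres of a stretch lie in one component** (same statement for the
centres `δ (fᵢ + (1+i)/2)`). [folklore] -/
theorem _root_.Literature.Probability.LatticeModels.IsMedialExploration.cf_mem_connectedComponentIn (hδ : 0 < D.δ) {A : Set ℂ} {i₀ i₁ : ℕ}
    (hi₁ : i₁ < ((a :: l).zip l).length)
    (hball : ∀ i, i₀ ≤ i → i ≤ i₁ → closedBall (LatticeModels.meshPoint D.δ (hexp.cv i)) D.δ ⊆ A)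
    {i m : ℕ} (hi₀ : i₀ ≤ i) (hi : i ≤ i₁) (hm₀ : i₀ ≤ m) (hm : m ≤ i₁) :
    D.δ • LatticeModels.faceCenter (hexp.cf i) ∈
      connectedComponentIn (A \ hexp.pertTrace) (D.δ • LatticeModels.faceCenter (hexp.cf m)) := by
  have hfc : ∀ j, j < ((a :: l).zip l).length →
      dist (D.δ • LatticeModels.faceCenter (hexp.cf j)) (LatticeModels.meshPoint D.δ (hexp.cv j)) ≤ D.δ := by
    intro j hj
    rw [meshPoint_eq_smul, dist_smul₀, Real.norm_eq_abs, abs_of_pos hδ]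
    nlinarith [LatticeModels.dist_faceCenter_toComplex_le (hexp.isCorner hj)]
  have key : ∀ k, i₀ + k ≤ i₁ → connectedComponentIn (A \ hexp.pertTrace) (D.δ • LatticeModels.faceCenter (hexp.cf (i₀ + k))) =
      connectedComponentIn (A \ hexp.pertTrace) (D.δ • LatticeModels.faceCenter (hexp.cf i₀)) := by
    intro k
    induction k with
    | zero => intro; rfl
    | succ k ih =>
      intro hk
      rw [← ih (by omega), show i₀ + (k + 1) = i₀ + k + 1 by omega]
      refine connectedComponentIn_eq ?_
      have hseg : segment ℝ (D.δ • LatticeModels.faceCenter (hexp.cf (i₀ + k))) (D.δ • LatticeModels.faceCenter (hexp.cf (i₀ + k + 1))) ⊆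
          A \ hexp.pertTrace := by
        intro z hz
        refine ⟨hball (i₀ + k) (by omega) (by omega) ?_, ?_⟩
        · refine (convex_closedBall _ _).segment_subset (mem_closedBall.2 (hfc (i₀ + k) (by omega))) (mem_closedBall.2 ?_) hz
          -- the second centre: within `δ` of `v_{i₀+k+1}`, which is `v_{i₀+k}` in a vertex turn,
          -- while in a face turn the two centres coincide
          rcases hexp.turn_cases (i := i₀ + k + 1) (by omega) (by omega) with ⟨hv, -⟩ | ⟨hf, -⟩
          · simp only [Nat.add_sub_cancel] at hv
            rw [hv]
            exact hfc (i₀ + k + 1) (by omega)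
          · simp only [Nat.add_sub_cancel] at hf
            rw [← hf]
            exact hfc (i₀ + k) (by omega)
        · exact hexp.segment_cf_disjoint_pertTrace hδ (i := i₀ + k + 1) (by omega) (by omega)
            (by simpa only [Nat.add_sub_cancel] using hz)
      have hconn : IsPreconnected (segment ℝ (D.δ • LatticeModels.faceCenter (hexp.cf (i₀ + k)))
          (D.δ • LatticeModels.faceCenter (hexp.cf (i₀ + k + 1)))) := (convex_segment _ _).isPreconnected
      have := hconn.subset_connectedComponentIn (right_mem_segment _ _ _) hseg
      exact this (left_mem_segment _ _ _)
  obtain ⟨k, rfl⟩ : ∃ k, i = i₀ + k := ⟨i - i₀, by omega⟩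
  obtain ⟨k', rfl⟩ : ∃ k', m = i₀ + k' := ⟨m - i₀, by omega⟩
  have h1 := key k (by omega)
  have h2 := key k' (by omega)
  have hmem : D.δ • LatticeModels.faceCenter (hexp.cf (i₀ + k)) ∈
      connectedComponentIn (A \ hexp.pertTrace) (D.δ • LatticeModels.faceCenter (hexp.cf (i₀ + k))) := by
    refine mem_connectedComponentIn ⟨hball (i₀ + k) (by omega) (by omega) ?_, ?_⟩
    · exact mem_closedBall.2 (hfc (i₀ + k) (by omega))
    · exact hexp.rightPt_not_mem_pertTrace hδ (m := i₀ + k) (by omega)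
  rw [h1, ← h2] at hmem
  exact hmem

/-! ### Stretches of the perturbed polygon as paths -/

/-- The connector after dart `i₀ + k` is `connPiece (i₀ + k + 1)`. [folklore] -/
theorem _root_.Literature.Probability.LatticeModels.IsMedialExploration.segment_pT_pS_eq (i₀ k : ℕ) :
    segment ℝ (hexp.pT (i₀ + k)) (hexp.pS (i₀ + k + 1)) = hexp.connPiece (i₀ + k + 1) := by
  rw [connPiece, Nat.add_sub_cancel]

/-- **The range of a stretch** is the union of its dart pieces and connectors. [folklore] -/
theorem _root_.Literature.Probability.LatticeModels.IsMedialExploration.range_subPath_subset (i₀ : ℕ) : ∀ k : ℕ, range (hexp.subPath i₀ k) ⊆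
    (⋃ (j : ℕ) (_ : j ≤ k), hexp.dartPiece (i₀ + j)) ∪
      ⋃ (j : ℕ) (_ : 1 ≤ j ∧ j ≤ k), hexp.connPiece (i₀ + j)
  | 0 => by
    intro z hz
    rw [subPath, Path.range_segment] at hz
    exact Or.inl (mem_iUnion₂.2 ⟨0, le_rfl, hz⟩)
  | k + 1 => by
    intro z hz
    rw [subPath, Path.trans_range, Path.trans_range, Path.range_segment, Path.range_segment] at hz
    rcases hz with hz | hz | hz
    · rcases range_subPath_subset i₀ k hz with h | h
      · obtain ⟨j, hj, h⟩ := mem_iUnion₂.1 h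
        exact Or.inl (mem_iUnion₂.2 ⟨j, by omega, h⟩)
      · obtain ⟨j, hj, h⟩ := mem_iUnion₂.1 h
        exact Or.inr (mem_iUnion₂.2 ⟨j, ⟨hj.1, by omega⟩, h⟩)
    · rw [hexp.segment_pT_pS_eq] at hz
      exact Or.inr (mem_iUnion₂.2 ⟨k + 1, ⟨by omega, le_rfl⟩, hz⟩)
    · exact Or.inl (mem_iUnion₂.2 ⟨k + 1, le_rfl, hz⟩)

/-- The range of a stretch lies in the trace. [folklore] -/
theorem _root_.Literature.Probability.LatticeModels.IsMedialExploration.range_subPath_subset_pertTrace {i₀ k : ℕ} (hk : i₀ + k < ((a :: l).zip l).length) :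
    range (hexp.subPath i₀ k) ⊆ hexp.pertTrace := by
  intro z hz
  rcases hexp.range_subPath_subset i₀ k hz with h | h
  · obtain ⟨j, hj, h⟩ := mem_iUnion₂.1 h
    exact hexp.dartPiece_subset (by omega) h
  · obtain ⟨j, hj, h⟩ := mem_iUnion₂.1 h
    exact hexp.connPiece_subset (by omega) (by omega) h

/-- **A stretch all of whose pieces miss the segment `[ℓ, r]` has zero crossing defect.**
[folklore] -/
theorem _root_.Literature.Probability.LatticeModels.IsMedialExploration.crossInc_subPath_eq_zero {ℓ r : ℂ} (i₀ : ℕ) : ∀ k : ℕ,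
    (∀ j, j ≤ k → ∀ z ∈ hexp.dartPiece (i₀ + j), z ∉ segment ℝ ℓ r) →
    (∀ j, 1 ≤ j → j ≤ k → ∀ z ∈ hexp.connPiece (i₀ + j), z ∉ segment ℝ ℓ r) →
      (hexp.subPath i₀ k).crossInc ℓ r = 0
  | 0 => by
    intro hd _
    rw [subPath]
    refine Path.crossInc_eq_zero _ fun t => hd 0 le_rfl _ ?_
    have : (Path.segment (hexp.pS i₀) (hexp.pT i₀)) t ∈ range (Path.segment (hexp.pS i₀) (hexp.pT i₀)) :=
      ⟨t, rfl⟩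
    rwa [Path.range_segment] at this
  | k + 1 => by
    intro hd hc
    have ih := crossInc_subPath_eq_zero i₀ k (fun j hj => hd j (by omega))
      (fun j hj1 hj => hc j hj1 (by omega))
    -- endpoints of `[ℓ, r]` are off all ranges
    have hoff : ∀ q, q ∈ segment ℝ ℓ r → q ∉ range (hexp.subPath i₀ k) ∧
        q ∉ range (Path.segment (hexp.pT (i₀ + k)) (hexp.pS (i₀ + k + 1))) ∧
        q ∉ range (Path.segment (hexp.pS (i₀ + k + 1)) (hexp.pT (i₀ + k + 1))) := by
      intro q hq
      refine ⟨fun h => ?_, fun h => ?_, fun h => ?_⟩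
      · rcases hexp.range_subPath_subset i₀ k h with h | h
        · obtain ⟨j, hj, h⟩ := mem_iUnion₂.1 h
          exact hd j (by omega) q h hq
        · obtain ⟨j, hj, h⟩ := mem_iUnion₂.1 h
          exact hc j hj.1 (by omega) q h hq
      · rw [Path.range_segment, hexp.segment_pT_pS_eq] at h
        exact hc (k + 1) (by omega) le_rfl q h hq
      · rw [Path.range_segment] at h
        exact hd (k + 1) le_rfl q h hq
    obtain ⟨hl1, hl2, hl3⟩ := hoff ℓ (left_mem_segment _ _ _)
    obtain ⟨hr1, hr2, hr3⟩ := hoff r (right_mem_segment _ _ _)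
    rw [subPath, Path.crossInc_trans _ _ hl1 (by rw [Path.trans_range]; rintro (h | h); exacts [hl2 h, hl3 h])
      hr1 (by rw [Path.trans_range]; rintro (h | h); exacts [hr2 h, hr3 h]),
      Path.crossInc_trans _ _ hl2 hl3 hr2 hr3, ih]
    rw [Path.crossInc_eq_zero, Path.crossInc_eq_zero]
    · ring
    · intro t ht
      exact hd (k + 1) le_rfl _ (by
        have : (Path.segment (hexp.pS (i₀ + k + 1)) (hexp.pT (i₀ + k + 1))) t ∈
          range (Path.segment (hexp.pS (i₀ + k + 1)) (hexp.pT (i₀ + k + 1))) := ⟨t, rfl⟩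
        rwa [Path.range_segment] at this) ht
    · intro t ht
      exact hc (k + 1) (by omega) le_rfl _ (by
        have : (Path.segment (hexp.pT (i₀ + k)) (hexp.pS (i₀ + k + 1))) t ∈
          range (Path.segment (hexp.pT (i₀ + k)) (hexp.pS (i₀ + k + 1))) := ⟨t, rfl⟩
        rwa [Path.range_segment, hexp.segment_pT_pS_eq] at this) ht

/-- **A stretch whose pieces miss `[ℓ, r]` except for one dart piece has the crossing defect
of that dart piece.** [folklore] -/
theorem _root_.Literature.Probability.LatticeModels.IsMedialExploration.crossInc_subPath_eq {ℓ r : ℂ} (i₀ j₀ : ℕ) : ∀ k : ℕ, j₀ ≤ k →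
    (∀ j, j ≤ k → j ≠ j₀ → ∀ z ∈ hexp.dartPiece (i₀ + j), z ∉ segment ℝ ℓ r) →
    (∀ j, 1 ≤ j → j ≤ k → ∀ z ∈ hexp.connPiece (i₀ + j), z ∉ segment ℝ ℓ r) →
    ℓ ∉ hexp.dartPiece (i₀ + j₀) → r ∉ hexp.dartPiece (i₀ + j₀) →
      (hexp.subPath i₀ k).crossInc ℓ r =
        (Path.segment (hexp.pS (i₀ + j₀)) (hexp.pT (i₀ + j₀))).crossInc ℓ r
  | 0 => by
    intro hj₀ _ _ _ _
    obtain rfl : j₀ = 0 := by omega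
    rfl
  | k + 1 => by
    intro hj₀ hd hc hℓ hr
    -- endpoints are off all ranges
    have hoff : ∀ q, q ∈ segment ℝ ℓ r → q ∉ hexp.dartPiece (i₀ + j₀) →
        q ∉ range (hexp.subPath i₀ k) ∧
        q ∉ range (Path.segment (hexp.pT (i₀ + k)) (hexp.pS (i₀ + k + 1))) ∧
        q ∉ range (Path.segment (hexp.pS (i₀ + k + 1)) (hexp.pT (i₀ + k + 1))) := by
      intro q hq hq'
      refine ⟨fun h => ?_, fun h => ?_, fun h => ?_⟩
      · rcases hexp.range_subPath_subset i₀ k h with h | h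
        · obtain ⟨j, hj, h⟩ := mem_iUnion₂.1 h
          by_cases hjj : j = j₀
          · subst hjj; exact hq' h
          · exact hd j (by omega) hjj q h hq
        · obtain ⟨j, hj, h⟩ := mem_iUnion₂.1 h
          exact hc j hj.1 (by omega) q h hq
      · rw [Path.range_segment, hexp.segment_pT_pS_eq] at h
        exact hc (k + 1) (by omega) le_rfl q h hq
      · rw [Path.range_segment] at h
        by_cases hjk : k + 1 = j₀
        · rw [show i₀ + k + 1 = i₀ + j₀ by omega] at h; exact hq' h
        · exact hd (k + 1) le_rfl hjk q h hq
    obtain ⟨hl1, hl2, hl3⟩ := hoff ℓ (left_mem_segment _ _ _) hℓ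
    obtain ⟨hr1, hr2, hr3⟩ := hoff r (right_mem_segment _ _ _) hr
    rw [subPath, Path.crossInc_trans _ _ hl1 (by rw [Path.trans_range]; rintro (h | h); exacts [hl2 h, hl3 h])
      hr1 (by rw [Path.trans_range]; rintro (h | h); exacts [hr2 h, hr3 h]),
      Path.crossInc_trans _ _ hl2 hl3 hr2 hr3]
    have hconn : (Path.segment (hexp.pT (i₀ + k)) (hexp.pS (i₀ + k + 1))).crossInc ℓ r = 0 := by
      refine Path.crossInc_eq_zero _ fun t ht => ?_
      exact hc (k + 1) (by omega) le_rfl _ (by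
        have : (Path.segment (hexp.pT (i₀ + k)) (hexp.pS (i₀ + k + 1))) t ∈
          range (Path.segment (hexp.pT (i₀ + k)) (hexp.pS (i₀ + k + 1))) := ⟨t, rfl⟩
        rwa [Path.range_segment, hexp.segment_pT_pS_eq] at this) ht
    rw [hconn, zero_add]
    by_cases hjk : j₀ ≤ k
    · rw [crossInc_subPath_eq i₀ j₀ k hjk (fun j hj => hd j (by omega)) (fun j hj1 hj => hc j hj1 (by omega)) hℓ hr,
        Path.crossInc_eq_zero (Path.segment (hexp.pS (i₀ + k + 1)) (hexp.pT (i₀ + k + 1))), add_zero]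
      intro t ht
      exact hd (k + 1) le_rfl (by omega) _ (by
        have : (Path.segment (hexp.pS (i₀ + k + 1)) (hexp.pT (i₀ + k + 1))) t ∈
          range (Path.segment (hexp.pS (i₀ + k + 1)) (hexp.pT (i₀ + k + 1))) := ⟨t, rfl⟩
        rwa [Path.range_segment] at this) ht
    · obtain rfl : j₀ = k + 1 := by omega
      show (hexp.subPath i₀ k).crossInc ℓ r +
          (Path.segment (hexp.pS (i₀ + k + 1)) (hexp.pT (i₀ + k + 1))).crossInc ℓ r =
        (Path.segment (hexp.pS (i₀ + k + 1)) (hexp.pT (i₀ + k + 1))).crossInc ℓ r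
      rw [hexp.crossInc_subPath_eq_zero i₀ k (fun j hj => hd j (by omega) (by omega))
        (fun j hj1 hj => hc j hj1 (by omega)), zero_add]

/-! ### Connecting paths outside and inside the annulus -/

/-- **A path outside the disc of radius `r₂`** joining two points at distance `≥ r₂` from `x`:
radially out to the larger of the two distances, along the circle, radially in. [folklore] -/
theorem _root_.Literature.Probability.LatticeModels.IsMedialExploration.exists_path_outside {x P Q : ℂ} {r₂ : ℝ} (hr₂ : 0 < r₂) (hP : r₂ ≤ dist P x)
    (hQ : r₂ ≤ dist Q x) : ∃ γ : Path P Q, ∀ t, r₂ ≤ dist (γ t) x := by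
  set u := P - x with hu
  set w := Q - x with hw
  have hu0 : 0 < ‖u‖ := by rw [hu, ← Complex.dist_eq]; linarith
  have hw0 : 0 < ‖w‖ := by rw [hw, ← Complex.dist_eq]; linarith
  set R := max ‖u‖ ‖w‖ with hR
  have hRu : ‖u‖ ≤ R := le_max_left _ _
  have hRw : ‖w‖ ≤ R := le_max_right _ _
  have hRr : r₂ ≤ R := by rw [Complex.dist_eq, ← hu] at hP; exact hP.trans hRu
  set P' := x + (R / ‖u‖) • u with hP'
  set Q' := x + (R / ‖w‖) • w with hQ'
  -- radial segments stay outside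
  have hrad : ∀ {v : ℂ}, 0 < ‖v‖ → ‖v‖ ≤ R → r₂ ≤ ‖v‖ →
      ∀ z ∈ segment ℝ (x + v) (x + (R / ‖v‖) • v), r₂ ≤ dist z x := by
    intro v hv hvR hv2 z hz
    rw [segment_eq_image'] at hz
    obtain ⟨t, ⟨ht0, ht1⟩, rfl⟩ := hz
    have e : x + v + t • (x + (R / ‖v‖) • v - (x + v)) - x = (1 + t * (R / ‖v‖ - 1)) • v := by
      have h1 : x + (R / ‖v‖) • v - (x + v) = (R / ‖v‖ - 1) • v := by rw [sub_smul, one_smul]; abel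
      rw [h1, smul_smul, add_smul, one_smul]; abel
    rw [Complex.dist_eq, e, norm_smul, Real.norm_eq_abs]
    have h1 : 1 ≤ R / ‖v‖ := (one_le_div hv).2 hvR
    have h2 : 1 ≤ 1 + t * (R / ‖v‖ - 1) := by nlinarith
    rw [abs_of_pos (by linarith)]
    nlinarith
  -- the arc
  have hcirc : Continuous (circleMap x R) := by unfold circleMap; fun_prop
  have harg : ∀ {v : ℂ}, 0 < ‖v‖ → circleMap x R (arg v) = x + (R / ‖v‖) • v := by
    intro v hv
    rw [circleMap, Complex.real_smul]
    congr 1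
    have := Complex.norm_mul_exp_arg_mul_I v
    have hv' : (‖v‖ : ℂ) ≠ 0 := by exact_mod_cast hv.ne'
    calc (R : ℂ) * exp (↑(arg v) * I) = (R / ‖v‖ : ℂ) * (‖v‖ * exp (arg v * I)) := by
          field_simp
      _ = ((R / ‖v‖ : ℝ) : ℂ) * v := by rw [this]; push_cast; ring
  set arc : Path P' Q' := ((Path.segment (arg u) (arg w)).map hcirc).cast (harg hu0).symm (harg hw0).symm
    with harc
  have harc_dist : ∀ t, dist (arc t) x = R := by
    intro t
    rw [harc, Path.cast_coe, Path.map_coe, Function.comp_apply, Complex.dist_eq, circleMap_sub_center,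
      norm_circleMap_zero, abs_of_pos (lt_of_lt_of_le hr₂ hRr)]
  have hPx : x + u = P := by rw [hu]; abel
  have hQx : x + w = Q := by rw [hw]; abel
  refine ⟨((Path.segment P P').trans (arc.trans (Path.segment Q' Q))), fun t => ?_⟩
  have hmem : ((Path.segment P P').trans (arc.trans (Path.segment Q' Q))) t ∈
      range ((Path.segment P P').trans (arc.trans (Path.segment Q' Q))) := ⟨t, rfl⟩
  rw [Path.trans_range, Path.trans_range, Path.range_segment, Path.range_segment] at hmem
  rcases hmem with h | ⟨t', ht'⟩ | h
  · exact hrad hu0 hRu (by rw [hu, ← Complex.dist_eq]; exact hP) _ (by rw [hPx]; exact h)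
  · rw [← ht', harc_dist]; exact hRr
  · exact hrad hw0 hRw (by rw [hw, ← Complex.dist_eq]; exact hQ) _ (by rw [hQx, segment_symm]; exact h)

/-- **A path inside the disc of radius `r₁`** joining two of its points: through the centre.
[folklore] -/
theorem _root_.Literature.Probability.LatticeModels.IsMedialExploration.exists_path_inside {x P Q : ℂ} {r₁ : ℝ} (hP : dist P x ≤ r₁) (hQ : dist Q x ≤ r₁) :
    ∃ γ : Path P Q, ∀ t, dist (γ t) x ≤ r₁ := by
  refine ⟨(Path.segment P x).trans (Path.segment x Q), fun t => ?_⟩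
  have hmem : ((Path.segment P x).trans (Path.segment x Q)) t ∈
      range ((Path.segment P x).trans (Path.segment x Q)) := ⟨t, rfl⟩
  rw [Path.trans_range, Path.range_segment, Path.range_segment] at hmem
  have hx : dist x x ≤ r₁ := by rw [dist_self]; exact dist_nonneg.trans hP
  rcases hmem with h | h
  · exact (convex_closedBall _ _).segment_subset (mem_closedBall.2 hP) (mem_closedBall.2 hx) h
  · exact (convex_closedBall _ _).segment_subset (mem_closedBall.2 hx) (mem_closedBall.2 hQ) h

/-! ### Distinct side pairs -/

/-- **A stretch joining the inner disc to the outside of the annulus, read as an in-to-out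
path**, together with its crossing defects: nonzero relative to the side segment of a dart of
the stretch, zero relative to the side segment of a dart outside the stretch. [folklore] -/
theorem _root_.Literature.Probability.LatticeModels.IsMedialExploration.exists_inout_path (hδ : 0 < D.δ) {x : ℂ} {r₁ r₂ : ℝ} {i₀ k : ℕ}
    (hk : i₀ + k < ((a :: l).zip l).length)
    (hends : (dist (hexp.pS i₀) x ≤ r₁ ∧ r₂ ≤ dist (hexp.pT (i₀ + k)) x) ∨
      (r₂ ≤ dist (hexp.pS i₀) x ∧ dist (hexp.pT (i₀ + k)) x ≤ r₁)) :
    ∃ (Pin Pout : ℂ) (κ : Path Pin Pout), dist Pin x ≤ r₁ ∧ r₂ ≤ dist Pout x ∧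
      range κ ⊆ hexp.pertTrace ∧
      (∀ m, i₀ ≤ m → m ≤ i₀ + k → κ.crossInc (hexp.leftPt m) (hexp.rightPt m) ≠ 0) ∧
      (∀ m, m < ((a :: l).zip l).length → (m < i₀ ∨ i₀ + k < m) →
        κ.crossInc (hexp.leftPt m) (hexp.rightPt m) = 0) := by
  -- crossing defects of the stretch itself
  have hne : ∀ m, i₀ ≤ m → m ≤ i₀ + k →
      (hexp.subPath i₀ k).crossInc (hexp.leftPt m) (hexp.rightPt m) ≠ 0 := by
    intro m hm1 hm2
    have hm : m < ((a :: l).zip l).length := by omega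
    rw [hexp.crossInc_subPath_eq i₀ (m - i₀) k (by omega)
      (fun j hj hjm z hz => hexp.dartPiece_disjoint_sideSeg hδ (by omega) hm (by omega) hz)
      (fun j hj1 hj z hz => hexp.connPiece_disjoint_sideSeg hδ (by omega) (by omega) hm hz)
      (fun h => hexp.leftPt_not_mem_pertTrace hδ hm (hexp.dartPiece_subset (by omega) h))
      (fun h => hexp.rightPt_not_mem_pertTrace hδ hm (hexp.dartPiece_subset (by omega) h))]
    rw [show i₀ + (m - i₀) = m by omega]
    exact hexp.crossInc_dartPiece_ne_zero hδ hm
  have hze : ∀ m, m < ((a :: l).zip l).length → (m < i₀ ∨ i₀ + k < m) →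
      (hexp.subPath i₀ k).crossInc (hexp.leftPt m) (hexp.rightPt m) = 0 := by
    intro m hm hm'
    exact hexp.crossInc_subPath_eq_zero i₀ k
      (fun j hj z hz => hexp.dartPiece_disjoint_sideSeg hδ (by omega) hm (by omega) hz)
      (fun j hj1 hj z hz => hexp.connPiece_disjoint_sideSeg hδ (by omega) (by omega) hm hz)
  have hrange := hexp.range_subPath_subset_pertTrace hk
  have hoff : ∀ m, m < ((a :: l).zip l).length →
      hexp.leftPt m ∉ range (hexp.subPath i₀ k) ∧ hexp.rightPt m ∉ range (hexp.subPath i₀ k) :=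
    fun m hm => ⟨fun h => hexp.leftPt_not_mem_pertTrace hδ hm (hrange h),
      fun h => hexp.rightPt_not_mem_pertTrace hδ hm (hrange h)⟩
  rcases hends with ⟨h1, h2⟩ | ⟨h1, h2⟩
  · exact ⟨_, _, hexp.subPath i₀ k, h1, h2, hrange, hne, hze⟩
  · refine ⟨_, _, (hexp.subPath i₀ k).symm, h2, h1, by rw [Path.symm_range]; exact hrange,
      fun m hm1 hm2 => ?_, fun m hm hm' => ?_⟩
    · rw [Path.crossInc_symm _ (hoff m (by omega)).1 (hoff m (by omega)).2]
      exact neg_ne_zero.2 (hne m hm1 hm2)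
    · rw [Path.crossInc_symm _ (hoff m hm).1 (hoff m hm).2, hze m hm hm', neg_zero]

/-- **Distinct side pairs.** In the open annulus `𝔸 = B(x, r₂) ∖ B̄(x, r₁)` minus the trace,
consider the components of the left and right points of two darts `mₐ`, `m_b` whose side
segments lie in `𝔸`. If there are two stretches of the path, over `I_b = [i_b, i_b + k_b] ∋ m_b`
and over `I_c = [i_c, i_c + k_c]`, each joining the inner disc to the outside of `𝔸`, with
`mₐ ∉ I_b ∪ I_c` and `m_b ∉ I_c`, then the unordered pairs of side components of `mₐ` and of
`m_b` differ. Proof: close the two stretches into a loop through the inside and the outside;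
its crossing defect relative to the side segment of `m_b` is `±2πi`, relative to that of `mₐ`
it is `0`; conclude with `sidePairs_ne_of_wind` (winding numbers are constant on
components). (Aizenman–Burchard 1999, App. A, "sectors" — here by crossing parity, without
the Jordan curve theorem.) [cite: AizenmanBurchardDuke1999, Appendix A] -/
theorem _root_.Literature.Probability.LatticeModels.IsMedialExploration.sidePair_ne (hδ : 0 < D.δ) {x : ℂ} {r₁ r₂ : ℝ} (hr₁ : 0 < r₁) (hr₁₂ : r₁ < r₂)
    {ma mb ib kb ic kc : ℕ} (hma : ma < ((a :: l).zip l).length)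
    (hb : ib + kb < ((a :: l).zip l).length) (hc : ic + kc < ((a :: l).zip l).length)
    (hmb : ib ≤ mb ∧ mb ≤ ib + kb) (hma_b : ma < ib ∨ ib + kb < ma) (hma_c : ma < ic ∨ ic + kc < ma)
    (hmb_c : mb < ic ∨ ic + kc < mb)
    (hSa : hexp.sideSeg ma ⊆ ball x r₂ \ closedBall x r₁)
    (hSb : hexp.sideSeg mb ⊆ ball x r₂ \ closedBall x r₁)
    (hb_ends : (dist (hexp.pS ib) x ≤ r₁ ∧ r₂ ≤ dist (hexp.pT (ib + kb)) x) ∨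
      (r₂ ≤ dist (hexp.pS ib) x ∧ dist (hexp.pT (ib + kb)) x ≤ r₁))
    (hc_ends : (dist (hexp.pS ic) x ≤ r₁ ∧ r₂ ≤ dist (hexp.pT (ic + kc)) x) ∨
      (r₂ ≤ dist (hexp.pS ic) x ∧ dist (hexp.pT (ic + kc)) x ≤ r₁)) :
    s(connectedComponentIn ((ball x r₂ \ closedBall x r₁) \ hexp.pertTrace) (hexp.leftPt ma),
        connectedComponentIn ((ball x r₂ \ closedBall x r₁) \ hexp.pertTrace) (hexp.rightPt ma)) ≠
      s(connectedComponentIn ((ball x r₂ \ closedBall x r₁) \ hexp.pertTrace) (hexp.leftPt mb),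
        connectedComponentIn ((ball x r₂ \ closedBall x r₁) \ hexp.pertTrace) (hexp.rightPt mb)) := by
  have hr₂ : 0 < r₂ := hr₁.trans hr₁₂
  have hmb' : mb < ((a :: l).zip l).length := by omega
  set X := (ball x r₂ \ closedBall x r₁) \ hexp.pertTrace with hX
  -- the two stretches
  obtain ⟨Pin, Pout, κ, hPin, hPout, hκ, hκne, hκze⟩ := hexp.exists_inout_path hδ hb hb_ends
  obtain ⟨Pin', Pout', κ', hPin', hPout', hκ', -, hκze'⟩ := hexp.exists_inout_path hδ hc hc_ends
  -- the connectors
  obtain ⟨γo, hγo⟩ := exists_path_outside hr₂ hPout hPout'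
  obtain ⟨γi, hγi⟩ := exists_path_inside hPin' hPin
  set loop : Path Pin Pin := κ.trans (γo.trans (κ'.symm.trans γi)) with hloop
  -- points of the side segments: in the annulus, off the trace, off the connectors
  have hside : ∀ {m}, hexp.sideSeg m ⊆ ball x r₂ \ closedBall x r₁ → ∀ q ∈ hexp.sideSeg m,
      (∀ t, γo t ≠ q) ∧ (∀ t, γi t ≠ q) := by
    intro m hS q hq
    obtain ⟨hq1, hq2⟩ := hS hq
    rw [mem_ball] at hq1
    rw [mem_closedBall, not_le] at hq2
    exact ⟨fun t h => by have := hγo t; rw [h] at this; linarith,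
      fun t h => by have := hγi t; rw [h] at this; linarith⟩
  -- crossing defect of the loop relative to a side segment in the annulus
  have hcross : ∀ {m}, m < ((a :: l).zip l).length → hexp.sideSeg m ⊆ ball x r₂ \ closedBall x r₁ →
      loop.crossInc (hexp.leftPt m) (hexp.rightPt m) =
        κ.crossInc (hexp.leftPt m) (hexp.rightPt m) - κ'.crossInc (hexp.leftPt m) (hexp.rightPt m) := by
    intro m hm hS
    have hL : hexp.leftPt m ∈ hexp.sideSeg m := left_mem_segment _ _ _
    have hR : hexp.rightPt m ∈ hexp.sideSeg m := right_mem_segment _ _ _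
    have hLt := hexp.leftPt_not_mem_pertTrace hδ hm
    have hRt := hexp.rightPt_not_mem_pertTrace hδ hm
    obtain ⟨hLo, hLi⟩ := hside hS _ hL
    obtain ⟨hRo, hRi⟩ := hside hS _ hR
    have hLκ : hexp.leftPt m ∉ range κ := fun h => hLt (hκ h)
    have hRκ : hexp.rightPt m ∉ range κ := fun h => hRt (hκ h)
    have hLκ' : hexp.leftPt m ∉ range κ'.symm := fun h => hLt (hκ' (by rwa [Path.symm_range] at h))
    have hRκ' : hexp.rightPt m ∉ range κ'.symm := fun h => hRt (hκ' (by rwa [Path.symm_range] at h))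
    have hLo' : hexp.leftPt m ∉ range γo := by rintro ⟨t, ht⟩; exact hLo t ht
    have hRo' : hexp.rightPt m ∉ range γo := by rintro ⟨t, ht⟩; exact hRo t ht
    have hLi' : hexp.leftPt m ∉ range γi := by rintro ⟨t, ht⟩; exact hLi t ht
    have hRi' : hexp.rightPt m ∉ range γi := by rintro ⟨t, ht⟩; exact hRi t ht
    rw [hloop, Path.crossInc_trans _ _ hLκ (by
        rw [Path.trans_range, Path.trans_range]
        rintro (h | h | h); exacts [hLo' h, hLκ' h, hLi' h]) hRκ (by
        rw [Path.trans_range, Path.trans_range]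
        rintro (h | h | h); exacts [hRo' h, hRκ' h, hRi' h]),
      Path.crossInc_trans _ _ hLo' (by
        rw [Path.trans_range]
        rintro (h | h); exacts [hLκ' h, hLi' h]) hRo' (by
        rw [Path.trans_range]
        rintro (h | h); exacts [hRκ' h, hRi' h]),
      Path.crossInc_trans _ _ hLκ' hLi' hRκ' hRi',
      Path.crossInc_symm _ (fun h => hLt (hκ' h)) (fun h => hRt (hκ' h))]
    -- the connectors miss the whole side segment
    rw [Path.crossInc_eq_zero γo (fun t ht => (hside hS _ ht).1 t rfl),
      Path.crossInc_eq_zero γi (fun t ht => (hside hS _ ht).2 t rfl)]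
    ring
  -- winding numbers
  have hLa := hexp.leftPt_not_mem_pertTrace hδ hma
  have hRa := hexp.rightPt_not_mem_pertTrace hδ hma
  have hnotloop : ∀ {m}, m < ((a :: l).zip l).length → hexp.sideSeg m ⊆ ball x r₂ \ closedBall x r₁ →
      hexp.leftPt m ∉ range loop ∧ hexp.rightPt m ∉ range loop := by
    intro m hm hS
    have aux : ∀ q ∈ hexp.sideSeg m, q ∉ hexp.pertTrace → q ∉ range loop := by
      intro q hq hqt h
      rw [hloop, Path.trans_range, Path.trans_range, Path.trans_range, Path.symm_range] at h
      rcases h with h | h | h | h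
      · exact hqt (hκ h)
      · obtain ⟨t, ht⟩ := h; exact (hside hS q hq).1 t ht
      · exact hqt (hκ' h)
      · obtain ⟨t, ht⟩ := h; exact (hside hS q hq).2 t ht
    exact ⟨aux _ (left_mem_segment _ _ _) (hexp.leftPt_not_mem_pertTrace hδ hm),
      aux _ (right_mem_segment _ _ _) (hexp.rightPt_not_mem_pertTrace hδ hm)⟩
  have hwb : Literature.Topology.PlaneTopology.wind (fun t => loop.extend t - hexp.leftPt mb) ≠ Literature.Topology.PlaneTopology.wind (fun t => loop.extend t - hexp.rightPt mb) := by
    intro h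
    have := Path.crossInc_loop loop (hnotloop hmb' hSb).1 (hnotloop hmb' hSb).2
    rw [h, sub_self, zero_mul, hcross hmb' hSb, hκze' mb hmb' hmb_c, sub_zero] at this
    exact hκne mb hmb.1 hmb.2 this
  have hwa : Literature.Topology.PlaneTopology.wind (fun t => loop.extend t - hexp.leftPt ma) = Literature.Topology.PlaneTopology.wind (fun t => loop.extend t - hexp.rightPt ma) := by
    have := Path.crossInc_loop loop (hnotloop hma hSa).1 (hnotloop hma hSa).2
    rw [hcross hma hSa, hκze ma hma hma_b, hκze' ma hma hma_c, sub_self] at this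
    have hpi : (2 * Real.pi * I : ℂ) ≠ 0 := by simp [Real.pi_ne_zero, I_ne_zero]
    have h0 := (mul_eq_zero.1 this.symm).resolve_right hpi
    have h1 : ((Literature.Topology.PlaneTopology.wind fun t => loop.extend t - hexp.leftPt ma) : ℂ) =
        (Literature.Topology.PlaneTopology.wind fun t => loop.extend t - hexp.rightPt ma) := by
      rw [sub_eq_zero] at h0; exact_mod_cast h0
    exact_mod_cast h1
  -- the component bookkeeping
  have hK : IsClosed (range loop) := (isCompact_range loop.continuous).isClosed
  have hXK : X ⊆ (range loop)ᶜ := by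
    intro z hz hzl
    obtain ⟨⟨hz1, hz2⟩, hzt⟩ := hz
    rw [mem_ball] at hz1
    rw [mem_closedBall, not_le] at hz2
    rw [hloop, Path.trans_range, Path.trans_range, Path.trans_range, Path.symm_range] at hzl
    rcases hzl with h | ⟨t, rfl⟩ | h | ⟨t, rfl⟩
    · exact hzt (hκ h)
    · linarith [hγo t]
    · exact hzt (hκ' h)
    · linarith [hγi t]
  have hℓa : hexp.leftPt ma ∈ X := ⟨hSa (left_mem_segment _ _ _), hLa⟩
  have hra : hexp.rightPt ma ∈ X := ⟨hSa (right_mem_segment _ _ _), hRa⟩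
  obtain ⟨h1, h2⟩ := Literature.Topology.PlaneTopology.sidePairs_ne_of_wind loop hK subset_rfl hXK hℓa hra hwa hwb
  intro h
  rw [Sym2.eq_iff] at h
  rcases h with ⟨h3, h4⟩ | ⟨h3, h4⟩
  · exact h1 ⟨h3, h4⟩
  · exact h2 ⟨h3, h4⟩

end IsMedialExploration

end Literature.Probability.Percolation

end SideComponents

/-!
## Part II. The exploration polygon and the boundary of a Jordan Dobrushin domain

Topic: Probability / Percolation (boundary bookkeeping for the multiple-crossing estimate
`Literature.Probability.Percolation.bondExploration_traversalBound`). For the medial exploration path in the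
discretisation `dobrushinData D δ` of a Dobrushin domain `D` (a Jordan domain with two marked
boundary points) we prove, with the perturbed polygon of Part I (`ExplorationPolygon.lean`):

* `cv_not_mem_zdArcB`: left vertices of the path never lie on the dual-wired arc `B`
  (they are joined to the wired arc `A` by open edges of the completed configuration, and the
  arcs are disjoint under `IsZdAdmissible`);
* `pertTrace_subset_carrier`: the perturbed polygon lies in the (open) domain — inner faces
  of `Ω_δ` are open squares whose sides are lattice segments in `closure D`, hence inside `D`
  (`JordanDomain.openRect_subset_of_sides_subset_closure`, from the Jordan curve theorem);
* `exists_frontier_near_of_mem_zdBoundary`: every site of the discrete boundary `∂Ω_δ` is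
  joined to a point of the boundary curve `∂D`, within `2δ`, by a segment missing the perturbed
  polygon (along a lattice edge leaving `Ω̄` or into a non-inner face);
* **taint lemmas**: a step of the left (open) chain along an `A`–`A` edge, resp. a step of the
  right (dual-open) chain across an edge with an endpoint on `B`, produces a point of `∂D` in
  the corresponding side component (`exists_frontier_of_leftTaint`,
  `exists_frontier_of_rightTaint`); untainted steps are open in `ω` itself, resp. dual-open in
  `dualConfig ω` (`left_step_of_untainted`, `right_step_of_untainted`);
* `card_le_of_separated_frontier_points`: boundary points of `D` lying in the middle of an
  annulus, pairwise in different components of the annulus minus a closed set missing `∂D`,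
  are at most `⌊1/θ⌋₊ + 1` in number, where `θ` is a modulus of uniform continuity of the
  boundary parametrisation at the scale of the margin (between two such points the boundary
  curve must leave the annulus).

Everything is proved (Aizenman–Burchard 1999, App. A, supplies the interior argument; the
boundary bookkeeping is the part "not in print" recorded in the docstring of
`bondExploration_traversalBound`).
-/

section DomainBoundary

open Set Metric Complex
open scoped Pointwise

namespace Literature.Probability.Percolation

section IsMedialExploration
open Literature.Probability.LatticeModels (IsMedialExploration)
open Literature.Probability.LatticeModels.IsMedialExploration

variable {D : LatticeModels.DiscreteDobrushin} {ω : BondConfig (LatticeModels.Site 2)} {a : LatticeModels.MedialVertex}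
  {l : List LatticeModels.MedialVertex} (hexp : IsMedialExploration D ω (a :: l))

/-! ### Left vertices avoid the dual-wired arc -/

/-- A site of the arc `B` has no open incident edge in the completed configuration (under
admissibility the arcs are disjoint). (Smirnov 2001, §2.) [cite: Smirnov2001, §2] -/
theorem _root_.Literature.Probability.LatticeModels.IsMedialExploration.not_mem_zdArcB_of_mem_bc (hadm : D.IsZdAdmissible) {u w : LatticeModels.Site 2}
    (h : s(u, w) ∈ D.bcBondConfig ω) : w ∉ D.zdArcB := by
  intro hw
  rcases h with ⟨-, hA | ⟨-, hB⟩⟩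
  · exact Set.disjoint_left.1 hadm.disjoint (hA w (Sym2.mem_mk_right u w)) hw
  · exact hB w (Sym2.mem_mk_right u w) hw

/-- **Left vertices of the exploration path are never on the arc `B`**: the first one is on the
arc `A` (`IsMedialExploration.start`), and consecutive ones are equal or joined by an open edge
of the completed configuration. (Smirnov 2001, §2: the path separates the cluster of `A` from
the dual cluster of `B`.) [cite: Smirnov2001, §2] -/
theorem _root_.Literature.Probability.LatticeModels.IsMedialExploration.cv_not_mem_zdArcB (hadm : D.IsZdAdmissible) :
    ∀ i, i < ((a :: l).zip l).length → hexp.cv i ∉ D.zdArcB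
  | 0, hi => by
    -- the first corner is the one provided by `start`
    have hl : l ≠ [] := by
      intro h; subst h; simp at hi
    obtain ⟨b, l', rfl⟩ := List.exists_cons_of_ne_nil hl
    obtain ⟨v, f, hv, hs, ht, hvA⟩ := hexp.start a b ⟨l', rfl⟩
    obtain ⟨hc, -, hs', ht'⟩ := hexp.corner_spec (i := 0) hi
    have h0 : ((a :: b :: l').zip (b :: l'))[0] = (a, b) := by simp
    rw [h0] at hs' ht'
    obtain ⟨rfl, -⟩ := LatticeModels.IsCorner.eq_of_cornerSource_eq_of_cornerTarget_eq_holds hv hc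
      (hs.trans hs'.symm) (ht.trans ht'.symm)
    exact fun hB => Set.disjoint_left.1 hadm.disjoint hvA hB
  | i + 1, hi => by
    have ih := cv_not_mem_zdArcB hadm i (by omega)
    rcases hexp.turn_cases (i := i + 1) (by omega) hi with ⟨hv, -⟩ | ⟨-, -, he, hopen⟩
    · rw [Nat.add_sub_cancel] at hv; rw [← hv]; exact ih
    · rw [Nat.add_sub_cancel] at he
      rw [he] at hopen
      exact not_mem_zdArcB_of_mem_bc hadm hopen

end IsMedialExploration

end Literature.Probability.Percolation

namespace Literature.Probability.Percolation

open LatticeModels LatticeModels.IsMedialExploration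

variable {Dm : RandomPlanarGeometry.DobrushinDomain} {δ : ℝ} {ω : BondConfig (Site 2)} {a : MedialVertex}
  {l : List MedialVertex}

/-! ### Inner faces and the perturbed polygon lie inside the domain -/

/-- An edge of `Ω_δ` is a lattice segment in `closure D`. [cite: Smirnov2001, §2] -/
theorem segment_subset_closure_of_adj {u w : Site 2}
    (h : (discreteDomainGraph (dobrushinData Dm δ).Ω (dobrushinData Dm δ).δ).Adj u w) :
    segment ℝ (meshPoint δ u) (meshPoint δ w) ⊆ closure Dm.carrier :=
  (meshGraph_adj_iff.1 (discreteDomainGraph_adj_iff.1 h).1).2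

/-- The four corners of a face, by their offsets. [folklore] -/
theorem isCorner_add_single (f : Site 2) (σ₀ σ₁ : ℕ) (h₀ : σ₀ ≤ 1) (h₁ : σ₁ ≤ 1) :
    IsCorner (f + (σ₀ : ℤ) • Pi.single 0 1 + (σ₁ : ℤ) • Pi.single 1 1) f := by
  intro k
  rcases fin_two_eq_zero_or_one k with rfl | rfl
  · simp; omega
  · simp; omega

/-- **A point on a side of an inner face lies in `closure D`**: in lattice units the point has
`j`-coordinate `f j` or `f j + 1` and `i`-coordinate in `[f i, f i + 1]` (`j ≠ i`), so it is on
the lattice edge between two corners of `f`, an edge of `Ω_δ`. [cite: Smirnov2001, §2] -/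
theorem mem_closure_of_on_side (hδ : 0 < δ) {f : Site 2} (hf : (dobrushinData Dm δ).IsInnerFace f)
    {z : ℂ} {i j : Fin 2} (hji : j ≠ i) {σ : ℕ} (hσ : σ ≤ 1)
    (hzj : coordVec (δ⁻¹ • z) j = f j + σ) (hz1 : (f i : ℝ) ≤ coordVec (δ⁻¹ • z) i)
    (hz2 : coordVec (δ⁻¹ • z) i ≤ f i + 1) : z ∈ closure Dm.carrier := by
  -- the corner `u` with `u i = f i`, `u j = f j + σ`, and `w = u + e_i`
  set u : Site 2 := f + (σ : ℤ) • Pi.single j 1 with hu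
  have hui : u i = f i := by rw [hu, Pi.add_apply, Pi.smul_apply, Pi.single_eq_of_ne (Ne.symm hji)]; simp
  have huj : u j = f j + σ := by rw [hu, Pi.add_apply, Pi.smul_apply, Pi.single_eq_same]; simp
  have hcu : IsCorner u f := by
    intro k; rcases fin_two_cases_of_ne hji k with rfl | rfl
    · exact Or.inl hui
    · rw [huj]; omega
  have hcw : IsCorner (u + Pi.single i 1) f := by
    intro k; rcases fin_two_cases_of_ne hji k with rfl | rfl
    · right; simp [hui]
    · rw [Pi.add_apply, Pi.single_eq_of_ne hji, add_zero, huj]; omega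
  have hadj : (zdGraph 2).Adj u (u + Pi.single i 1) := (zdGraph_adj_iff _ _).2 ⟨i, Or.inl rfl⟩
  have hmem : δ⁻¹ • z ∈ edgeTrace s(u, u + Pi.single i 1) := by
    refine mem_edgeTrace_single_iff.2 ⟨fun k hk => ?_, by rw [hui]; exact hz1, by rw [hui]; exact hz2⟩
    rcases fin_two_cases_of_ne hji k with rfl | rfl
    · exact absurd rfl hk
    · rw [huj, hzj]; push_cast; ring
  have hseg := segment_subset_closure_of_adj (hf u (u + Pi.single i 1) hcu hcw hadj)
  rw [meshPoint_eq_smul, meshPoint_eq_smul, ← smul_segment_eq] at hseg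
  have : z ∈ δ • edgeTrace s(u, u + Pi.single i 1) := by
    rw [Set.mem_smul_set_iff_inv_smul_mem₀ hδ.ne']; exact hmem
  rw [edgeTrace_mk] at this
  exact hseg this

/-- **Open inner faces lie in the domain** (Jordan curve theorem, via
`JordanDomain.openRect_subset_of_sides_subset_closure`). [cite: Smirnov2001, §2] -/
theorem mem_carrier_of_mem_openSq (hδ : 0 < δ) {f : Site 2} (hf : (dobrushinData Dm δ).IsInnerFace f)
    {z : ℂ} (hz : δ⁻¹ • z ∈ openSq f) : z ∈ Dm.carrier := by
  have key := Dm.openRect_subset_of_sides_subset_closure (x₁ := δ * f 0) (x₂ := δ * (f 0 + 1))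
    (y₁ := δ * f 1) (y₂ := δ * (f 1 + 1)) ?_ ?_
  · apply key
    obtain ⟨h0, h0'⟩ := hz 0
    obtain ⟨h1, h1'⟩ := hz 1
    simp only [coordVec_zero, coordVec_one, Complex.smul_re, Complex.smul_im, smul_eq_mul] at h0 h0' h1 h1'
    refine ⟨⟨?_, ?_⟩, ?_, ?_⟩
    · have := mul_lt_mul_of_pos_left h0 hδ; rwa [mul_inv_cancel_left₀ hδ.ne'] at this
    · have := mul_lt_mul_of_pos_left h0' hδ; rwa [mul_inv_cancel_left₀ hδ.ne'] at this
    · have := mul_lt_mul_of_pos_left h1 hδ; rwa [mul_inv_cancel_left₀ hδ.ne'] at this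
    · have := mul_lt_mul_of_pos_left h1' hδ; rwa [mul_inv_cancel_left₀ hδ.ne'] at this
  · -- vertical sides
    intro w hw h1 h2
    have hw1 : (f 1 : ℝ) ≤ coordVec (δ⁻¹ • w) 1 := by
      simp only [coordVec_one, Complex.smul_im, smul_eq_mul]
      rw [le_inv_mul_iff₀ hδ]; exact h1
    have hw2 : coordVec (δ⁻¹ • w) 1 ≤ f 1 + 1 := by
      simp only [coordVec_one, Complex.smul_im, smul_eq_mul]
      rw [inv_mul_le_iff₀ hδ]; exact h2
    rcases hw with hw | hw
    · exact mem_closure_of_on_side hδ hf (i := 1) (j := 0) (by decide) (σ := 0) (by norm_num)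
        (by simp only [coordVec_zero, Complex.smul_re, smul_eq_mul, hw]; push_cast; field_simp; ring) hw1 hw2
    · exact mem_closure_of_on_side hδ hf (i := 1) (j := 0) (by decide) (σ := 1) le_rfl
        (by simp only [coordVec_zero, Complex.smul_re, smul_eq_mul, hw]; push_cast; field_simp) hw1 hw2
  · -- horizontal sides
    intro w hw h1 h2
    have hw1 : (f 0 : ℝ) ≤ coordVec (δ⁻¹ • w) 0 := by
      simp only [coordVec_zero, Complex.smul_re, smul_eq_mul]
      rw [le_inv_mul_iff₀ hδ]; exact h1
    have hw2 : coordVec (δ⁻¹ • w) 0 ≤ f 0 + 1 := by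
      simp only [coordVec_zero, Complex.smul_re, smul_eq_mul]
      rw [inv_mul_le_iff₀ hδ]; exact h2
    rcases hw with hw | hw
    · exact mem_closure_of_on_side hδ hf (i := 0) (j := 1) (by decide) (σ := 0) (by norm_num)
        (by simp only [coordVec_one, Complex.smul_im, smul_eq_mul, hw]; push_cast; field_simp; ring) hw1 hw2
    · exact mem_closure_of_on_side hδ hf (i := 0) (j := 1) (by decide) (σ := 1) le_rfl
        (by simp only [coordVec_one, Complex.smul_im, smul_eq_mul, hw]; push_cast; field_simp) hw1 hw2

/-- **The crossing point of a vertex connector lies in the domain**: the `1 × 2` rectangle made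
of the two inner faces `fL` (below) and `fU` (above the crossed edge, line `{x_J = g}`, column
`a`) has its sides in `closure D`, so its interior lies in `D`; a point of vertex-connector
shape lies in that interior. [cite: Smirnov2001, §2] -/
theorem mem_carrier_of_vConnShape (hδ : 0 < δ) {fL fU : Site 2}
    (hL : (dobrushinData Dm δ).IsInnerFace fL) (hU : (dobrushinData Dm δ).IsInnerFace fU)
    {I J : Fin 2} (hJI : J ≠ I) {a g : ℤ} (hLI : fL I = a) (hUI : fU I = a) (hLJ : fL J + 1 = g)
    (hUJ : fU J = g) {z : ℂ} (hz : VConnShape I J a g (δ⁻¹ • z)) : z ∈ Dm.carrier := by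
  obtain ⟨-, hzi, hzj1, hzj2⟩ := hz
  have hLJ' : ((fL J : ℤ) : ℝ) = g - 1 := by
    have : ((fL J + 1 : ℤ) : ℝ) = g := by exact_mod_cast hLJ
    push_cast at this; linarith
  -- sides of the rectangle, in the coordinates `(I, J)`
  have hsideI : ∀ w : ℂ, (coordVec (δ⁻¹ • w) I = a ∨ coordVec (δ⁻¹ • w) I = a + 1) →
      (g : ℝ) - 1 ≤ coordVec (δ⁻¹ • w) J → coordVec (δ⁻¹ • w) J ≤ g + 1 → w ∈ closure Dm.carrier := by
    intro w hwI hw1 hw2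
    rcases le_total (coordVec (δ⁻¹ • w) J) g with hwg | hwg
    · -- on a side of `fL` (orthogonal to `J`... i.e. with constant `I`-coordinate)
      rcases hwI with hwI | hwI
      · exact mem_closure_of_on_side hδ hL (i := J) (j := I) (Ne.symm hJI) (σ := 0) (by norm_num)
          (by rw [hwI, hLI]; simp) (by rw [hLJ']; linarith) (by rw [hLJ']; linarith)
      · exact mem_closure_of_on_side hδ hL (i := J) (j := I) (Ne.symm hJI) (σ := 1) le_rfl
          (by rw [hwI, hLI]; simp) (by rw [hLJ']; linarith) (by rw [hLJ']; linarith)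
    · rcases hwI with hwI | hwI
      · exact mem_closure_of_on_side hδ hU (i := J) (j := I) (Ne.symm hJI) (σ := 0) (by norm_num)
          (by rw [hwI, hUI]; simp) (by rw [hUJ]; exact hwg) (by rw [hUJ]; exact hw2)
      · exact mem_closure_of_on_side hδ hU (i := J) (j := I) (Ne.symm hJI) (σ := 1) le_rfl
          (by rw [hwI, hUI]; simp) (by rw [hUJ]; exact hwg) (by rw [hUJ]; exact hw2)
  have hsideJ : ∀ w : ℂ, (coordVec (δ⁻¹ • w) J = g - 1 ∨ coordVec (δ⁻¹ • w) J = g + 1) →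
      (a : ℝ) ≤ coordVec (δ⁻¹ • w) I → coordVec (δ⁻¹ • w) I ≤ a + 1 → w ∈ closure Dm.carrier := by
    intro w hwJ hw1 hw2
    rcases hwJ with hwJ | hwJ
    · exact mem_closure_of_on_side hδ hL (i := I) (j := J) hJI (σ := 0) (by norm_num)
        (by rw [hwJ, hLJ']; push_cast; ring) (by rw [hLI]; exact hw1) (by rw [hLI]; exact hw2)
    · exact mem_closure_of_on_side hδ hU (i := I) (j := J) hJI (σ := 1) le_rfl
        (by rw [hwJ, hUJ]; push_cast; ring) (by rw [hUI]; exact hw1) (by rw [hUI]; exact hw2)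
  -- read in `re`/`im`
  have hcoord : ∀ (w : ℂ) (k : Fin 2), coordVec (δ⁻¹ • w) k = δ⁻¹ * coordVec w k := fun w k => by
    rcases fin_two_eq_zero_or_one k with rfl | rfl <;> simp
  have hzI' : (a : ℝ) < coordVec (δ⁻¹ • z) I ∧ coordVec (δ⁻¹ • z) I < a + 1 := by
    rcases hzi with h | h <;> rw [h] <;> constructor <;> linarith
  have hzJ' : (g : ℝ) - 1 < coordVec (δ⁻¹ • z) J ∧ coordVec (δ⁻¹ • z) J < g + 1 := by
    constructor <;> linarith
  rcases fin_two_eq_other hJI with ⟨rfl, rfl⟩ | ⟨rfl, rfl⟩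
  · -- `I = 0`: rectangle `(δa, δ(a+1)) × (δ(g-1), δ(g+1))`
    have key := Dm.openRect_subset_of_sides_subset_closure (x₁ := δ * a) (x₂ := δ * (a + 1))
      (y₁ := δ * (g - 1)) (y₂ := δ * (g + 1)) ?_ ?_
    · apply key
      simp only [hcoord, coordVec_zero, coordVec_one] at hzI' hzJ'
      refine ⟨⟨?_, ?_⟩, ?_, ?_⟩
      · have := mul_lt_mul_of_pos_left hzI'.1 hδ; rwa [mul_inv_cancel_left₀ hδ.ne'] at this
      · have := mul_lt_mul_of_pos_left hzI'.2 hδ; rwa [mul_inv_cancel_left₀ hδ.ne'] at this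
      · have := mul_lt_mul_of_pos_left hzJ'.1 hδ; rwa [mul_inv_cancel_left₀ hδ.ne'] at this
      · have := mul_lt_mul_of_pos_left hzJ'.2 hδ; rwa [mul_inv_cancel_left₀ hδ.ne'] at this
    · intro w hw h1 h2
      refine hsideI w ?_ ?_ ?_
      · rcases hw with hw | hw
        · left; rw [hcoord, coordVec_zero, hw]; field_simp
        · right; rw [hcoord, coordVec_zero, hw]; field_simp
      · rw [hcoord, coordVec_one, le_inv_mul_iff₀ hδ]; exact h1
      · rw [hcoord, coordVec_one, inv_mul_le_iff₀ hδ]; exact h2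
    · intro w hw h1 h2
      refine hsideJ w ?_ ?_ ?_
      · rcases hw with hw | hw
        · left; rw [hcoord, coordVec_one, hw]; field_simp
        · right; rw [hcoord, coordVec_one, hw]; field_simp
      · rw [hcoord, coordVec_zero, le_inv_mul_iff₀ hδ]; exact h1
      · rw [hcoord, coordVec_zero, inv_mul_le_iff₀ hδ]; exact h2
  · -- `I = 1`: rectangle `(δ(g-1), δ(g+1)) × (δa, δ(a+1))`
    have key := Dm.openRect_subset_of_sides_subset_closure (x₁ := δ * (g - 1)) (x₂ := δ * (g + 1))
      (y₁ := δ * a) (y₂ := δ * (a + 1)) ?_ ?_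
    · apply key
      simp only [hcoord, coordVec_zero, coordVec_one] at hzI' hzJ'
      refine ⟨⟨?_, ?_⟩, ?_, ?_⟩
      · have := mul_lt_mul_of_pos_left hzJ'.1 hδ; rwa [mul_inv_cancel_left₀ hδ.ne'] at this
      · have := mul_lt_mul_of_pos_left hzJ'.2 hδ; rwa [mul_inv_cancel_left₀ hδ.ne'] at this
      · have := mul_lt_mul_of_pos_left hzI'.1 hδ; rwa [mul_inv_cancel_left₀ hδ.ne'] at this
      · have := mul_lt_mul_of_pos_left hzI'.2 hδ; rwa [mul_inv_cancel_left₀ hδ.ne'] at this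
    · intro w hw h1 h2
      refine hsideJ w ?_ ?_ ?_
      · rcases hw with hw | hw
        · left; rw [hcoord, coordVec_zero, hw]; field_simp
        · right; rw [hcoord, coordVec_zero, hw]; field_simp
      · rw [hcoord, coordVec_one, le_inv_mul_iff₀ hδ]; exact h1
      · rw [hcoord, coordVec_one, inv_mul_le_iff₀ hδ]; exact h2
    · intro w hw h1 h2
      refine hsideI w ?_ ?_ ?_
      · rcases hw with hw | hw
        · left; rw [hcoord, coordVec_one, hw]; field_simp
        · right; rw [hcoord, coordVec_one, hw]; field_simp
      · rw [hcoord, coordVec_zero, le_inv_mul_iff₀ hδ]; exact h1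
      · rw [hcoord, coordVec_zero, inv_mul_le_iff₀ hδ]; exact h2

/-- **The perturbed polygon lies in the domain.** [cite: Smirnov2001, §2] -/
theorem pertTrace_subset_carrier (hδ : 0 < δ)
    (hexp : IsMedialExploration (dobrushinData Dm δ) ω (a :: l)) :
    hexp.pertTrace ⊆ Dm.carrier := by
  intro z hz
  have hδ' : 0 < (dobrushinData Dm δ).δ := hδ
  rcases hexp.mem_pertTrace_iff.1 hz with ⟨i, hi, hzi⟩ | ⟨i, ⟨hi1, hi⟩, hzi⟩
  · rw [hexp.dartPiece_eq, Set.mem_smul_set_iff_inv_smul_mem₀ hδ'.ne'] at hzi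
    exact mem_carrier_of_mem_openSq hδ (hexp.isInnerFace hi)
      (dartSeg_subset_openSq (hexp.isCorner hi) hzi)
  · rcases hexp.connPiece_cases hi1 hi hδ' hzi with
      ⟨I, J, hJI, -, -, hcol, hside, -, hshape⟩ | ⟨I, J, hJI, -, -, -, -, hshape, -, -⟩
    · simp only [dobrushinData_δ] at hshape
      rcases hside with ⟨h1, h2⟩ | ⟨h1, h2⟩
      · exact mem_carrier_of_vConnShape hδ (hexp.isInnerFace (by omega)) (hexp.isInnerFace hi)
          hJI rfl hcol.symm h1 h2 hshape
      · exact mem_carrier_of_vConnShape hδ (hexp.isInnerFace hi) (hexp.isInnerFace (by omega))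
          hJI hcol.symm rfl h2 h1 hshape
    · refine mem_carrier_of_mem_openSq hδ (hexp.isInnerFace hi) fun k => ?_
      obtain ⟨-, ⟨h1, h2⟩, h3⟩ := hshape
      simp only [dobrushinData_δ] at h1 h2 h3
      rcases fin_two_cases_of_ne hJI k with rfl | rfl
      · constructor <;> linarith
      · rcases h3 with h | h <;> rw [h] <;> constructor <;> linarith

/-- The perturbed polygon misses the boundary curve. [cite: Smirnov2001, §2] -/
theorem pertTrace_disjoint_frontier (hδ : 0 < δ)
    (hexp : IsMedialExploration (dobrushinData Dm δ) ω (a :: l)) :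
    Disjoint hexp.pertTrace (frontier Dm.carrier) :=
  Set.disjoint_left.2 fun _ hz hz' =>
    Set.disjoint_left.1 Dm.disjoint_carrier_frontier (pertTrace_subset_carrier hδ hexp hz) hz'

/-! ### From the discrete boundary to the boundary curve, off the polygon -/

/-- Two corners of a face are equal, adjacent, or joined through a third corner. [folklore] -/
theorem IsCorner.exists_adj_chain {u v g : Site 2} (hu : IsCorner u g) (hv : IsCorner v g) :
    u = v ∨ (zdGraph 2).Adj u v ∨ ∃ c, IsCorner c g ∧ (zdGraph 2).Adj u c ∧ (zdGraph 2).Adj c v := by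
  have hu0 := hu 0; have hu1 := hu 1; have hv0 := hv 0; have hv1 := hv 1
  by_cases h0 : u 0 = v 0
  · by_cases h1 : u 1 = v 1
    · exact Or.inl (Site.ext_two h0 h1)
    · right; left
      rw [zdGraph_two_adj_iff]
      rcases hu1 with hu1 | hu1 <;> rcases hv1 with hv1 | hv1 <;> omega
  · by_cases h1 : u 1 = v 1
    · right; left
      rw [zdGraph_two_adj_iff]
      rcases hu0 with hu0 | hu0 <;> rcases hv0 with hv0 | hv0 <;> omega
    · right; right
      have e0 : Function.update u 0 (v 0) 0 = v 0 := Function.update_self _ _ _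
      have e1 : Function.update u 0 (v 0) 1 = u 1 := Function.update_of_ne (by decide) _ _
      refine ⟨Function.update u 0 (v 0), fun k => ?_, ?_, ?_⟩
      · rcases fin_two_eq_zero_or_one k with rfl | rfl
        · rw [e0]; exact hv 0
        · rw [e1]; exact hu 1
      · rw [zdGraph_two_adj_iff, e0, e1]
        rcases hu0 with hu0 | hu0 <;> rcases hv0 with hv0 | hv0 <;> omega
      · rw [zdGraph_two_adj_iff, e0, e1]
        rcases hu1 with hu1 | hu1 <;> rcases hv1 with hv1 | hv1 <;> omega

/-- The source edge of a dart of the path is an edge of `Ω_δ`, so a lattice edge met by the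
perturbed polygon is an edge of `Ω_δ`. [cite: Smirnov2001, §2] -/
theorem adj_of_eq_cornerSource {D' : DiscreteDobrushin} (hexp : IsMedialExploration D' ω (a :: l))
    {i : ℕ} (hi : i < ((a :: l).zip l).length) {u y : Site 2}
    (h : s(u, y) = cornerSource (hexp.cv i) (hexp.cf i)) :
    (discreteDomainGraph D'.Ω D'.δ).Adj u y := by
  rw [cornerSource_eq_cornerEdge, cornerEdge] at h
  have hc := hexp.isCorner hi
  have hadj := hexp.isInnerFace hi _ _ hc (isCorner_cornerNeighbor hc (srcDir (hexp.cv i) (hexp.cf i)))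
    (adj_cornerNeighbor hc (srcDir (hexp.cv i) (hexp.cf i)))
  rcases Sym2.eq_iff.1 h with ⟨rfl, rfl⟩ | ⟨rfl, rfl⟩
  · exact hadj
  · exact hadj.symm

/-- **From a discrete boundary site to the boundary curve, off the polygon.** Every site `u` of
`∂Ω_δ` (`zdBoundary`) is joined to a point `z` of `∂D` with `dist (z, δu) ≤ 2δ` by a straight
segment missing the perturbed polygon: along a lattice edge at `u` which is not an edge of
`Ω_δ` (it leaves `Ω̄`, or ends at a mesh point off `Ω`), or inside a non-inner face at `u`
(which contains a point off `Ω`, since otherwise all its sides would be edges of `Ω_δ`).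
[cite: Smirnov2001, §2] -/
theorem exists_frontier_near_of_mem_zdBoundary (hδ : 0 < δ)
    (hexp : IsMedialExploration (dobrushinData Dm δ) ω (a :: l)) {u : Site 2}
    (hu : u ∈ (dobrushinData Dm δ).zdBoundary) :
    ∃ z ∈ frontier Dm.carrier, dist z (meshPoint δ u) ≤ 2 * δ ∧
      ∀ q ∈ segment ℝ (meshPoint δ u) z, q ∉ hexp.pertTrace := by
  have hδ' : 0 < (dobrushinData Dm δ).δ := hδ
  have huΩ : meshPoint δ u ∈ Dm.carrier :=
    meshDomain_subset_meshVertices _ _ ((dobrushinData Dm δ).zdBoundary_subset_meshDomain hu)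
  -- frontier point on a segment from `δu` to a point off `Ω`
  have cross : ∀ {q : ℂ}, q ∉ Dm.carrier → ∃ z ∈ segment ℝ (meshPoint δ u) q, z ∈ frontier Dm.carrier := by
    intro q hq
    obtain ⟨z, hz1, hz2⟩ := Dm.inter_frontier_nonempty_of_isPreconnected
      (convex_segment (meshPoint δ u) q).isPreconnected ⟨_, left_mem_segment _ _ _, huΩ⟩
      ⟨q, right_mem_segment _ _ _, hq⟩
    exact ⟨z, hz1, hz2⟩
  rcases (dobrushinData Dm δ).mem_zdBoundary_iff.1 hu with hu' | ⟨y, hadj, -, g, hg, hug, hyg⟩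
  · -- `u ∈ meshBoundary`: a lattice neighbour `y` not `Ω_δ`-adjacent
    obtain ⟨huD, y, hzd, hnadj⟩ := mem_meshBoundary_iff.1 hu'
    have hfree : ∀ q ∈ segment ℝ (meshPoint δ u) (meshPoint δ y), q ∉ hexp.pertTrace := by
      intro q hq hqt
      rw [meshPoint_eq_smul, meshPoint_eq_smul, mem_segment_smul_iff hδ.ne'] at hq
      obtain ⟨i, hi, -, hsrc, -⟩ := hexp.edge_of_mem_edgeTrace hδ' hzd hqt hq
      exact hnadj (adj_of_eq_cornerSource hexp hi.2 hsrc)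
    have hdist : dist (meshPoint δ y) (meshPoint δ u) = δ := by
      rw [dist_comm, dist_meshPoint_of_adj hzd, abs_of_pos hδ]
    by_cases hseg : segment ℝ (meshPoint δ u) (meshPoint δ y) ⊆ closure Dm.carrier
    · -- then `δy ∉ Ω` (else `y ∈ Ω_δ`), so `δy ∈ ∂Ω`
      have hyΩ : meshPoint δ y ∉ Dm.carrier := by
        intro hyΩ
        apply hnadj
        rw [discreteDomainGraph_adj_iff]
        have hmesh : (meshGraph (dobrushinData Dm δ).Ω (dobrushinData Dm δ).δ).Adj u y :=
          meshGraph_adj_iff.2 ⟨hzd, hseg⟩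
        exact ⟨hmesh, huD, mem_meshDomain_of_meshGraph_adj huD hyΩ hmesh⟩
      refine ⟨meshPoint δ y, ⟨hseg (right_mem_segment _ _ _), ?_⟩, hdist.le.trans (by linarith), hfree⟩
      rw [Dm.isOpen.interior_eq]; exact hyΩ
    · obtain ⟨q, hq, hqΩ⟩ := not_subset.1 hseg
      obtain ⟨z, hz, hzfr⟩ := cross (fun h => hqΩ (subset_closure h))
      have hsub : segment ℝ (meshPoint δ u) z ⊆ segment ℝ (meshPoint δ u) (meshPoint δ y) :=
        (convex_segment _ _).segment_subset (left_mem_segment _ _ _)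
          ((convex_segment _ _).segment_subset (left_mem_segment _ _ _) hq hz)
      refine ⟨z, hzfr, ?_, fun p hp => hfree p (hsub hp)⟩
      have hzball : z ∈ closedBall (meshPoint δ u) δ :=
        (convex_closedBall _ _).segment_subset (mem_closedBall.2 (by rw [dist_self]; exact hδ.le)) (mem_closedBall.2 hdist.le) (hsub (right_mem_segment _ _ _))
      rw [mem_closedBall] at hzball; linarith
  · -- `u` is a corner of a non-inner face `g`: some point of `g` is off `Ω`
    have huD : u ∈ meshDomain (dobrushinData Dm δ).Ω (dobrushinData Dm δ).δ :=
      (discreteDomainGraph_adj_iff.1 hadj).2.1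
    have hsq : ∃ q ∈ δ • closedSq g, q ∉ Dm.carrier := by
      by_contra hall
      push Not at hall
      apply hg
      -- all corners are mesh vertices, all sides are mesh edges: `g` is inner
      have hvert : ∀ v, IsCorner v g → meshPoint δ v ∈ Dm.carrier := fun v hv =>
        hall _ (by rw [meshPoint_eq_smul]; exact Set.smul_mem_smul_set (toComplex_mem_closedSq hv))
      have hmesh : ∀ v w, IsCorner v g → IsCorner w g → (zdGraph 2).Adj v w →
          (meshGraph (dobrushinData Dm δ).Ω (dobrushinData Dm δ).δ).Adj v w := by
        intro v w hv hw hvw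
        refine meshGraph_adj_iff.2 ⟨hvw, fun p hp => subset_closure (hall p ?_)⟩
        rw [meshPoint_eq_smul, meshPoint_eq_smul, ← smul_segment_eq] at hp
        obtain ⟨p', hp', rfl⟩ := hp
        exact Set.smul_mem_smul_set ((convex_closedSq g).segment_subset (toComplex_mem_closedSq hv)
          (toComplex_mem_closedSq hw) hp')
      have hdom : ∀ v, IsCorner v g → v ∈ meshDomain (dobrushinData Dm δ).Ω (dobrushinData Dm δ).δ := by
        intro v hv
        rcases IsCorner.exists_adj_chain hug hv with rfl | h | ⟨c, hc, h1, h2⟩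
        · exact huD
        · exact mem_meshDomain_of_meshGraph_adj huD (hvert v hv) (hmesh _ _ hug hv h)
        · exact mem_meshDomain_of_meshGraph_adj (mem_meshDomain_of_meshGraph_adj huD (hvert c hc) (hmesh _ _ hug hc h1))
            (hvert v hv) (hmesh _ _ hc hv h2)
      intro v w hv hw hvw
      exact discreteDomainGraph_adj_iff.2 ⟨hmesh v w hv hw hvw, hdom v hv, hdom w hw⟩
    obtain ⟨q, hq, hqΩ⟩ := hsq
    obtain ⟨z, hz, hzfr⟩ := cross hqΩ
    have husq : meshPoint δ u ∈ δ • closedSq g := by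
      rw [meshPoint_eq_smul]; exact Set.smul_mem_smul_set (toComplex_mem_closedSq hug)
    have hconv : Convex ℝ (δ • closedSq g) := (convex_closedSq g).smul δ
    have hsub : segment ℝ (meshPoint δ u) z ⊆ δ • closedSq g :=
      hconv.segment_subset husq (hconv.segment_subset husq hq hz)
    refine ⟨z, hzfr, ?_, fun p hp hpt => ?_⟩
    · have := closedSq_subset_closedBall hug ((Set.mem_smul_set_iff_inv_smul_mem₀ hδ.ne' _ _).1
        (hsub (right_mem_segment _ _ _)))
      rw [mem_closedBall, ← mul_le_mul_iff_right₀ hδ, ← abs_of_pos hδ, ← Real.norm_eq_abs, ← dist_smul₀,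
        Real.norm_eq_abs, abs_of_pos hδ, smul_inv_smul₀ hδ.ne', ← meshPoint_eq_smul] at this
      linarith
    · exact hg (hexp.isInnerFace_of_mem_closedSq hδ' hpt
        ((Set.mem_smul_set_iff_inv_smul_mem₀ hδ.ne' _ _).1 (hsub hp)))

/-! ### Tainted and untainted chain steps -/

/-- **A left vertex on the wired arc produces a boundary point in the left component.** If the
`4δ`-neighbourhoods of the vertices of the darts `i₀, …, i₁` lie in `A` and some vertex `vᵢ` of
the stretch lies on the discrete arc `A` (so on `∂Ω_δ`), then some point of `∂D` within `2δ`
of `δvᵢ` lies in the component, in `A` minus the perturbed polygon, of every `δv_m` of the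
stretch. [cite: AizenmanBurchardDuke1999, Appendix A] -/
theorem exists_frontier_of_leftTaint (hδ : 0 < δ)
    (hexp : IsMedialExploration (dobrushinData Dm δ) ω (a :: l)) {A : Set ℂ} {i₀ i₁ m i : ℕ}
    (hi₁ : i₁ < ((a :: l).zip l).length)
    (hball : ∀ j, i₀ ≤ j → j ≤ i₁ → closedBall (meshPoint δ (hexp.cv j)) (4 * δ) ⊆ A)
    (hm₀ : i₀ ≤ m) (hm : m ≤ i₁) (hi₀ : i₀ ≤ i) (hi : i ≤ i₁)
    (hiA : hexp.cv i ∈ (dobrushinData Dm δ).zdArcA) :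
    ∃ z ∈ frontier Dm.carrier, z ∈ connectedComponentIn (A \ hexp.pertTrace) (meshPoint δ (hexp.cv m)) ∧
      dist z (meshPoint δ (hexp.cv i)) ≤ 2 * δ := by
  have hδ' : 0 < (dobrushinData Dm δ).δ := hδ
  obtain ⟨z, hzfr, hzd, hfree⟩ := exists_frontier_near_of_mem_zdBoundary hδ hexp
    ((dobrushinData Dm δ).zdArcA_subset_zdBoundary hiA)
  refine ⟨z, hzfr, ?_, hzd⟩
  have hball' : ∀ j, i₀ ≤ j → j ≤ i₁ → closedBall (meshPoint δ (hexp.cv j)) δ ⊆ A := fun j h1 h2 =>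
    (closedBall_subset_closedBall (by linarith)).trans (hball j h1 h2)
  have h1 := hexp.cv_mem_connectedComponentIn hδ' hi₁ hball' hi₀ hi hm₀ hm
  simp only [dobrushinData_δ] at h1
  rw [connectedComponentIn_eq h1]
  have hseg : segment ℝ (meshPoint δ (hexp.cv i)) z ⊆ A \ hexp.pertTrace := fun q hq =>
    ⟨hball i hi₀ hi ((convex_closedBall _ _).segment_subset (mem_closedBall.2 (by rw [dist_self]; positivity)) (mem_closedBall.2 (by linarith)) hq), hfree q hq⟩
  exact (convex_segment _ _).isPreconnected.subset_connectedComponentIn (left_mem_segment _ _ _) hseg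
    (right_mem_segment _ _ _)

/-- **A corner on the dual-wired arc of a right face produces a boundary point in the right
component.** If some corner `u'` of a face `fᵢ` of the stretch lies on the discrete arc `B`,
then some point of `∂D` within `4δ` of `δvᵢ` lies in the component of every face centre of the
stretch: the half-diagonal from the centre of `fᵢ` to `u'` misses the polygon (no dart has the
`B`-site `u'` as its left vertex, `cv_not_mem_zdArcB`). [cite: AizenmanBurchardDuke1999, Appendix A] -/
theorem exists_frontier_of_rightTaint (hδ : 0 < δ) (hadm : (dobrushinData Dm δ).IsZdAdmissible)
    (hexp : IsMedialExploration (dobrushinData Dm δ) ω (a :: l)) {A : Set ℂ} {i₀ i₁ m i : ℕ}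
    (hi₁ : i₁ < ((a :: l).zip l).length)
    (hball : ∀ j, i₀ ≤ j → j ≤ i₁ → closedBall (meshPoint δ (hexp.cv j)) (4 * δ) ⊆ A)
    (hm₀ : i₀ ≤ m) (hm : m ≤ i₁) (hi₀ : i₀ ≤ i) (hi : i ≤ i₁) {u' : Site 2}
    (hu' : IsCorner u' (hexp.cf i)) (hB : u' ∈ (dobrushinData Dm δ).zdArcB) :
    ∃ z ∈ frontier Dm.carrier,
      z ∈ connectedComponentIn (A \ hexp.pertTrace) (δ • faceCenter (hexp.cf m)) ∧
      dist z (meshPoint δ (hexp.cv i)) ≤ 4 * δ := by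
  have hδ' : 0 < (dobrushinData Dm δ).δ := hδ
  have hin : i < ((a :: l).zip l).length := by omega
  obtain ⟨z, hzfr, hzd, hfree⟩ := exists_frontier_near_of_mem_zdBoundary hδ hexp
    ((dobrushinData Dm δ).zdArcB_subset_zdBoundary hB)
  -- distances to `δvᵢ`
  have hu'd : dist (meshPoint δ u') (meshPoint δ (hexp.cv i)) ≤ 2 * δ := by
    have := closedSq_subset_closedBall (hexp.isCorner hin) (toComplex_mem_closedSq hu')
    rw [mem_closedBall] at this
    rw [meshPoint_eq_smul, meshPoint_eq_smul, dist_smul₀, Real.norm_eq_abs, abs_of_pos hδ]; nlinarith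
  have hcd : dist (δ • faceCenter (hexp.cf i)) (meshPoint δ (hexp.cv i)) ≤ δ := by
    rw [meshPoint_eq_smul, dist_smul₀, Real.norm_eq_abs, abs_of_pos hδ]
    nlinarith [dist_faceCenter_toComplex_le (hexp.isCorner hin)]
  refine ⟨z, hzfr, ?_, by linarith [dist_triangle z (meshPoint δ u') (meshPoint δ (hexp.cv i))]⟩
  -- the centre of `fᵢ` is in the component of the centre of `f_m`
  have hball' : ∀ j, i₀ ≤ j → j ≤ i₁ → closedBall (meshPoint δ (hexp.cv j)) δ ⊆ A := fun j h1 h2 =>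
    (closedBall_subset_closedBall (by linarith)).trans (hball j h1 h2)
  have h1 := hexp.cf_mem_connectedComponentIn hδ' hi₁ hball' hi₀ hi hm₀ hm
  simp only [dobrushinData_δ] at h1
  rw [connectedComponentIn_eq h1]
  -- the half-diagonal from the centre of `fᵢ` to `u'` misses the polygon
  have hdiag : segment ℝ (meshPoint δ u') (δ • faceCenter (hexp.cf i)) ⊆ A \ hexp.pertTrace := by
    intro q hq
    refine ⟨hball i hi₀ hi ((convex_closedBall _ _).segment_subset (mem_closedBall.2 (by linarith)) (mem_closedBall.2 (by linarith)) hq), fun hqt => ?_⟩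
    rw [meshPoint_eq_smul, mem_segment_smul_iff hδ.ne'] at hq
    obtain ⟨j, hj, hv, -, -⟩ := hexp.mem_dartPiece_of_mem_halfDiag hδ' hu' hqt hq
    exact hexp.cv_not_mem_zdArcB hadm j hj (hv ▸ hB)
  have h2 : meshPoint δ u' ∈ connectedComponentIn (A \ hexp.pertTrace) (δ • faceCenter (hexp.cf i)) :=
    (convex_segment _ _).isPreconnected.subset_connectedComponentIn (right_mem_segment _ _ _) hdiag
      (left_mem_segment _ _ _)
  rw [connectedComponentIn_eq h2]
  have hseg : segment ℝ (meshPoint δ u') z ⊆ A \ hexp.pertTrace := fun q hq =>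
    ⟨hball i hi₀ hi ((convex_closedBall _ _).segment_subset (mem_closedBall.2 (by linarith))
      (mem_closedBall.2 (by linarith [dist_triangle z (meshPoint δ u') (meshPoint δ (hexp.cv i))])) hq), hfree q hq⟩
  exact (convex_segment _ _).isPreconnected.subset_connectedComponentIn (left_mem_segment _ _ _) hseg
    (right_mem_segment _ _ _)

/-- **An untainted left step is open in `ω`**: if `v_{i}` is not on the arc `A`, the step from
`v_{i-1}` to `vᵢ` is trivial or along a lattice edge open in `ω` itself. [cite: Smirnov2001, §2] -/
theorem left_step_of_untainted {D' : DiscreteDobrushin} (hexp : IsMedialExploration D' ω (a :: l))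
    {i : ℕ} (hi1 : 1 ≤ i) (hi : i < ((a :: l).zip l).length) (hA : hexp.cv i ∉ D'.zdArcA) :
    hexp.cv (i - 1) = hexp.cv i ∨
      (s(hexp.cv (i - 1), hexp.cv i) ∈ ω ∧ (zdGraph 2).Adj (hexp.cv (i - 1)) (hexp.cv i)) := by
  rcases hexp.turn_cases hi1 hi with ⟨hv, -⟩ | ⟨-, -, he, hopen⟩
  · exact Or.inl hv
  · right
    have hadj : (zdGraph 2).Adj (hexp.cv (i - 1)) (hexp.cv i) :=
      meshGraph_le_zdGraph _ _ (discreteDomainGraph_le_meshGraph _ _ (adj_of_turn_face he hopen))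
    rw [he] at hopen
    rcases hopen with ⟨-, hAA | ⟨hω, -⟩⟩
    · exact absurd (hAA _ (Sym2.mem_mk_right _ _)) hA
    · exact ⟨hω, hadj⟩

/-- **An untainted right step is dual-open in `dualConfig ω`**: if no corner of `f_{i-1}` lies
on the arc `B`, the step from `f_{i-1}` to `fᵢ` is trivial or across an edge closed in `ω`
itself, i.e. along a dual edge of `dualConfig ω`. [cite: Smirnov2001, §2] -/
theorem right_step_of_untainted {D' : DiscreteDobrushin} (hexp : IsMedialExploration D' ω (a :: l))
    {i : ℕ} (hi1 : 1 ≤ i) (hi : i < ((a :: l).zip l).length)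
    (hB : ∀ u', IsCorner u' (hexp.cf (i - 1)) → u' ∉ D'.zdArcB) :
    hexp.cf (i - 1) = hexp.cf i ∨ s(hexp.cf (i - 1), hexp.cf i) ∈ dualConfig ω := by
  rcases hexp.turn_cases hi1 hi with ⟨-, -, he, hdual⟩ | ⟨hf, -⟩
  · right
    rw [mem_dualConfig_iff] at hdual ⊢
    rw [← he]
    refine ⟨hdual.1, fun e' he' heq => ?_⟩
    have hee : e' = (((a :: l).zip l)[i]).1 := dualEdge_bijective.1 heq
    subst hee
    -- the crossed edge is an edge of `Ω_δ` with no endpoint on `B`, so `∈ ω` would make it open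
    apply hdual.2 _ ?_ rfl
    have hsrc : (((a :: l).zip l)[i]).1 = cornerSource (hexp.cv i) (hexp.cf i) :=
      (hexp.corner_spec hi).2.2.1.symm
    have htgt : (((a :: l).zip l)[i]).1 = cornerTarget (hexp.cv (i - 1)) (hexp.cf (i - 1)) := by
      rw [hexp.cornerTarget_eq_cornerSource hi1 hi, hsrc]
    refine ⟨?_, Or.inr ⟨he', fun x hx => ?_⟩⟩
    · rw [hsrc, cornerSource_eq_cornerEdge, cornerEdge, SimpleGraph.mem_edgeSet]
      exact adj_of_eq_cornerSource hexp hi (by rw [cornerSource_eq_cornerEdge, cornerEdge])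
    · rw [htgt, cornerTarget_eq_cornerEdge, cornerEdge, Sym2.mem_iff] at hx
      have hc := hexp.isCorner (i := i - 1) (by omega)
      rcases hx with rfl | rfl
      · exact hB _ hc
      · exact hB _ (isCorner_cornerNeighbor hc _)
  · exact Or.inl hf

/-! ### Counting boundary points in separated components -/

/-- **Separated boundary points in the middle of an annulus are few.** Let `θ > 0` be such that
boundary parameters at distance `< θ` give boundary points at distance `< η`. Boundary points of
`D` with `r₁ + η ≤ dist (·, x) ≤ r₂ - η`, pairwise in different components of
`(B(x, r₂) ∖ B̄(x, r₁)) ∖ K` for a set `K` missing `∂D`, number at most `⌊1/θ⌋₊ + 1`: two of them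
with parameters in the same window `[nθ, (n+1)θ)` would be joined by a boundary arc staying in
the annulus and off `K`. [cite: AizenmanBurchardDuke1999, Appendix A] -/
theorem card_le_of_separated_frontier_points (Dj : RandomPlanarGeometry.JordanDomain) {x : ℂ} {r₁ r₂ η θ : ℝ}
    (hθ : 0 < θ) (hmod : ∀ s t : ℝ, |s - t| < θ → dist (Dj.boundary s) (Dj.boundary t) < η)
    {K : Set ℂ} (hK : Disjoint K (frontier Dj.carrier)) (S : Finset ℂ)
    (hS : ∀ z ∈ S, z ∈ frontier Dj.carrier ∧ r₁ + η ≤ dist z x ∧ dist z x ≤ r₂ - η)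
    (hsep : ∀ z ∈ S, ∀ z' ∈ S, z ≠ z' →
      connectedComponentIn ((ball x r₂ \ closedBall x r₁) \ K) z ≠
        connectedComponentIn ((ball x r₂ \ closedBall x r₁) \ K) z') :
    S.card ≤ ⌊1 / θ⌋₊ + 1 := by
  classical
  -- boundary parameters
  have hpar : ∀ z ∈ S, ∃ u ∈ Ico (0 : ℝ) 1, Dj.boundary u = z := by
    intro z hz
    have := (hS z hz).1
    rw [Dj.frontier_eq_image_Ico] at this
    exact this
  choose! u hu using hpar
  set φ : ℂ → ℕ := fun z => ⌊u z / θ⌋₊ with hφ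
  have hmaps : Set.MapsTo φ S (Finset.range (⌊1 / θ⌋₊ + 1)) := by
    intro z hz
    rw [Finset.coe_range, mem_Iio, Nat.lt_succ_iff]
    apply Nat.floor_le_floor
    exact div_le_div_of_nonneg_right (hu z hz).1.2.le hθ.le
  have hinj : Set.InjOn φ S := by
    intro z hz z' hz' hzz
    by_contra hne
    apply hsep z hz z' hz' hne
    -- parameters in the same window: `|u z - u z'| < θ`
    have hclose : |u z - u z'| < θ := by
      simp only [hφ] at hzz
      have h1 := Nat.floor_le (div_nonneg (hu z hz).1.1 hθ.le)
      have h2 := Nat.lt_floor_add_one (u z / θ)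
      have h3 := Nat.floor_le (div_nonneg (hu z' hz').1.1 hθ.le)
      have h4 := Nat.lt_floor_add_one (u z' / θ)
      rw [hzz] at h1 h2
      rw [abs_sub_lt_iff]
      constructor
      · have : u z / θ - u z' / θ < 1 := by linarith
        rw [← sub_div, div_lt_one hθ] at this; linarith
      · have : u z' / θ - u z / θ < 1 := by linarith
        rw [← sub_div, div_lt_one hθ] at this; linarith
    -- the boundary arc between them stays in the annulus and off `K`
    have harc : Dj.boundary '' uIcc (u z) (u z') ⊆ (ball x r₂ \ closedBall x r₁) \ K := by
      rintro w ⟨t, ht, rfl⟩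
      have htz : |t - u z| < θ := by
        rcases le_total (u z) (u z') with h | h
        · rw [uIcc_of_le h] at ht
          rw [abs_sub_lt_iff]; constructor <;> linarith [ht.1, ht.2, (abs_sub_lt_iff.1 hclose).1, (abs_sub_lt_iff.1 hclose).2]
        · rw [uIcc_of_ge h] at ht
          rw [abs_sub_lt_iff]; constructor <;> linarith [ht.1, ht.2, (abs_sub_lt_iff.1 hclose).1, (abs_sub_lt_iff.1 hclose).2]
      have hd := hmod t (u z) htz
      rw [(hu z hz).2] at hd
      obtain ⟨-, hz1, hz2⟩ := hS z hz
      refine ⟨⟨?_, ?_⟩, fun hwK => Set.disjoint_left.1 hK hwK (Dj.boundary_mem_frontier t)⟩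
      · rw [mem_ball]; linarith [dist_triangle (Dj.boundary t) z x]
      · rw [mem_closedBall, not_le]; linarith [dist_triangle z (Dj.boundary t) x, dist_comm z (Dj.boundary t)]
    have hconn : IsPreconnected (Dj.boundary '' uIcc (u z) (u z')) :=
      isPreconnected_uIcc.image _ Dj.continuous_boundary.continuousOn
    have hzmem : z ∈ Dj.boundary '' uIcc (u z) (u z') := ⟨u z, left_mem_uIcc, (hu z hz).2⟩
    have hz'mem : z' ∈ Dj.boundary '' uIcc (u z) (u z') := ⟨u z', right_mem_uIcc, (hu z' hz').2⟩
    exact connectedComponentIn_eq (hconn.subset_connectedComponentIn hzmem harc hz'mem)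
  have := Finset.card_le_card_of_injOn φ hmaps hinj
  rwa [Finset.card_range] at this

end Literature.Probability.Percolation

end DomainBoundary

/-!
## Part III. Multiple shell crossings by the critical bond interface: proof of `bondExploration_traversalBound`

Topic: Probability / Percolation. This part discharges the named fact
`Literature.Probability.Percolation.bondExploration_traversalBound` (`InterfaceScalingLimitProofs.lean`) —
Aizenman–Burchard's hypothesis H1 (Duke Math. J. 99 (1999), eq. (1.3) and Appendix A,
Thm A.1) for the medial exploration path of critical bond percolation on `δℤ²` in a Jordan
Dobrushin domain, in the tree's formulation with a shell-dependent threshold — and with it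
the tightness statement `Literature.Probability.Percolation.isTightLaws_map_bondInterface`
(`isTightLaws_map_bondInterface_holds`, via `isTightLaws_map_bondInterface_of_traversalBound`).

The argument (AB99, Appendix A: "the `k` crossing segments cut the annulus into sectors, each
containing an open or a dual-open crossing; BK") is organised as follows.

1. **From traversals to stretches of darts** (`exists_tight_crossing`, `traversal_data`): a
   traversal of `D(x; ρ, R)` by the polygon (`R ≥ 16Cρ`, `δ ≤ ρ`) contains a *tight* crossing
   of the middle shell `D(x; Cρ, R/4)`, whose darts stay in the open annulus
   `𝔸 = B(x, R/2) ∖ B̄(x, 4ρ)` together with their `4δ`-neighbourhoods, and a *middle dart* `m`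
   whose side segment (Part I) lies in `𝔸`.
2. **Many side components** (`card_components_ge`): by `sidePair_ne` the unordered pairs of
   side components (components of `𝔸` minus the perturbed polygon containing the left, resp.
   right, point of the middle dart) of the `k` traversals are pairwise distinct, so at least
   `V` components occur, `V(V+1)/2 ≥ k` (`Finset.card_sym2`).
3. **Few tainted components** (Part II): a component containing a point of
   `∂D` in the middle of the annulus is *tainted*; tainted components are at most
   `N(ρ) = ⌊1/θ(ρ)⌋₊ + 1` (`card_le_of_separated_frontier_points`, `θ` a modulus of uniform
   continuity of the boundary curve). A stretch one of whose left vertices lies on the wired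
   arc `A`, resp. one of whose right faces has a corner on the dual-wired arc `B`, has a tainted
   left, resp. right, component (`exists_frontier_of_leftTaint`/`_rightTaint`).
4. **Disjoint crossings and BK** (`arms_of_hasTraversals`, `bondExploration_traversalBound_holds`):
   the remaining `≥ V - N ≥ 2j₀ + 1` components carry pairwise vertex-disjoint open chains of
   `ω` or pairwise disjoint dual-open chains of `dualConfig ω` crossing
   `A(x; Cρ + 3δ, R/4 - 3δ)`, so `ω ∈ A□^{j₀}` or `dualConfig ω ∈ A□^{j₀}` for the annulus
   crossing event `A` (`mem_disjointOccurrencePow_annulusOpenCrossing_of_chains`); the iterated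
   BK–Reimer inequality (`measureReal_disjointOccurrencePow_le`), the one-crossing bound
   `annulusOpenCrossing_half_le_holds` (exponent `α`) and self-duality give
   `P ≤ 2 (8(C+3) ρ/R)^{α j₀} ≤ K (ρ/R)^3` for `α j₀ ≥ 3`.

Everything is proved.
-/

section TraversalBound

open MeasureTheory Metric Set Filter Topology
open scoped Pointwise unitInterval

namespace Literature.Probability.Percolation

open LatticeModels LatticeModels.IsMedialExploration

/-! ### Tight crossings of a shell by a continuous function of time -/

/-- **Tight crossing times.** If a continuous `f : [0,1] → ℝ` satisfies `f s ≤ q₁ < q₂ ≤ f t`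
with `s ≤ t`, there are times `s ≤ s' < t' ≤ t` with `f s' = q₁`, `f t' = q₂` and
`q₁ ≤ f ≤ q₂` on `[s', t']` (last time at level `q₁` before the first time at level `q₂`).
[folklore] -/
theorem exists_tight_crossing {f : I → ℝ} (hf : Continuous f) {s t : I} (hst : s ≤ t)
    {q₁ q₂ : ℝ} (hq : q₁ < q₂) (hs : f s ≤ q₁) (ht : q₂ ≤ f t) :
    ∃ s' t' : I, s ≤ s' ∧ s' < t' ∧ t' ≤ t ∧ f s' = q₁ ∧ f t' = q₂ ∧
      ∀ u, s' ≤ u → u ≤ t' → q₁ ≤ f u ∧ f u ≤ q₂ := by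
  -- first time at level `≥ q₂`
  set T : Set I := {u | s ≤ u ∧ u ≤ t ∧ q₂ ≤ f u} with hT
  have hTc : IsClosed T :=
    (isClosed_le continuous_const continuous_id).inter
      ((isClosed_le continuous_id continuous_const).inter (isClosed_le continuous_const hf))
  obtain ⟨t', ⟨hst', ht't, hft'⟩, hmin⟩ := hTc.isCompact.exists_isLeast ⟨t, hst, le_rfl, ht⟩
  have hlt : s < t' := by
    rcases eq_or_lt_of_le hst' with h | h
    · rw [← h] at hft'; linarith
    · exact h
  have hbefore : ∀ u, s ≤ u → u < t' → f u < q₂ := by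
    intro u hsu hut'
    by_contra h
    exact absurd (hmin ⟨hsu, hut'.le.trans ht't, not_lt.1 h⟩) (not_le.2 hut')
  have hft'eq : f t' = q₂ := by
    refine le_antisymm ?_ hft'
    by_contra h
    push Not at h
    have hopen : {u : I | q₂ < f u} ∈ 𝓝 t' := (isOpen_lt continuous_const hf).mem_nhds h
    obtain ⟨l', ⟨hsl', hl't'⟩, hsub⟩ := exists_Ioc_subset_of_mem_nhds' hopen hlt
    obtain ⟨u, hl'u, hut'⟩ := exists_between hl't'
    have h1 : q₂ < f u := hsub ⟨hl'u, hut'.le⟩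
    have h2 := hbefore u (hsl'.trans hl'u.le) hut'
    linarith
  -- last time at level `≤ q₁` before `t'`
  set S : Set I := {u | s ≤ u ∧ u ≤ t' ∧ f u ≤ q₁} with hS
  have hSc : IsClosed S :=
    (isClosed_le continuous_const continuous_id).inter
      ((isClosed_le continuous_id continuous_const).inter (isClosed_le hf continuous_const))
  obtain ⟨s', ⟨hss', hs't', hfs'⟩, hmax⟩ := hSc.isCompact.exists_isGreatest ⟨s, le_rfl, hlt.le, hs⟩
  have hlt' : s' < t' := by
    rcases eq_or_lt_of_le hs't' with h | h
    · rw [h, hft'eq] at hfs'; linarith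
    · exact h
  have hafter : ∀ u, s' < u → u ≤ t' → q₁ < f u := by
    intro u hs'u hut'
    by_contra h
    exact absurd (hmax ⟨hss'.trans hs'u.le, hut', not_lt.1 h⟩) (not_le.2 hs'u)
  have hfs'eq : f s' = q₁ := by
    refine le_antisymm hfs' ?_
    by_contra h
    push Not at h
    have hopen : {u : I | f u < q₁} ∈ 𝓝 s' := (isOpen_lt hf continuous_const).mem_nhds h
    obtain ⟨l', ⟨hs'l', hl't'⟩, hsub⟩ := exists_Ico_subset_of_mem_nhds' hopen hlt'
    obtain ⟨u, hs'u, hul'⟩ := exists_between hs'l'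
    have h1 : f u < q₁ := hsub ⟨hs'u.le, hul'⟩
    have h2 := hafter u hs'u (hul'.le.trans hl't')
    linarith
  refine ⟨s', t', hss', hlt', ht't, hfs'eq, hft'eq, fun u hs'u hut' => ⟨?_, ?_⟩⟩
  · rcases eq_or_lt_of_le hs'u with h | h
    · rw [← h, hfs'eq]
    · exact (hafter u h hut').le
  · rcases eq_or_lt_of_le hut' with h | h
    · rw [h, hft'eq]
    · exact (hbefore u (hss'.trans hs'u) h).le

/-- **Tight crossing times, downward version** (`f s ≥ q₂ > q₁ ≥ f t`). [folklore] -/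
theorem exists_tight_crossing' {f : I → ℝ} (hf : Continuous f) {s t : I} (hst : s ≤ t)
    {q₁ q₂ : ℝ} (hq : q₁ < q₂) (hs : q₂ ≤ f s) (ht : f t ≤ q₁) :
    ∃ s' t' : I, s ≤ s' ∧ s' < t' ∧ t' ≤ t ∧ f s' = q₂ ∧ f t' = q₁ ∧
      ∀ u, s' ≤ u → u ≤ t' → q₁ ≤ f u ∧ f u ≤ q₂ := by
  obtain ⟨s', t', h1, h2, h3, h4, h5, h6⟩ := exists_tight_crossing (f := fun u => -f u) hf.neg hst
    (neg_lt_neg hq) (neg_le_neg hs) (neg_le_neg ht)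
  refine ⟨s', t', h1, h2, h3, by linarith, by linarith, fun u hu1 hu2 => ?_⟩
  have := h6 u hu1 hu2
  constructor <;> linarith [this.1, this.2]

/-! ### From a traversal to a stretch of darts -/

variable {Dm : RandomPlanarGeometry.DobrushinDomain} {δ : ℝ} {ω : BondConfig (Site 2)} {a : MedialVertex}
  {l : List MedialVertex}

/-- **The polygon is within `δ` of the left vertex of its current dart** (`tIdx` form of
`IsMedialExploration.dist_polyline_meshPoint_le`, with the corners `cv`). [cite: Smirnov2001, §2] -/
theorem dist_polyline_cv_le (hδ : 0 < δ)
    (hexp : IsMedialExploration (dobrushinData Dm δ) ω (a :: l)) (u : I) :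
    dist (polyline ((a :: l).map (medialPoint δ)) u) (meshPoint δ (hexp.cv (tIdx l u))) ≤ δ :=
  hexp.dist_polyline_meshPoint_le (D := dobrushinData Dm δ) hδ.le (fun _ hi => hexp.isCorner hi)
    (fun _ hi => (hexp.corner_spec hi).2.2.1) (fun _ hi => (hexp.corner_spec hi).2.2.2) u

/-- `tIdx` is a valid dart index. [folklore] -/
theorem tIdx_lt (hexp : IsMedialExploration (dobrushinData Dm δ) ω (a :: l)) (u : I) :
    tIdx l u < ((a :: l).zip l).length := by
  have hl : l ≠ [] := by
    intro h; subst h; exact hexp.head_ne_getLast rfl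
  have : 0 < l.length := List.length_pos_iff.2 hl
  rw [length_zip]; unfold tIdx; omega

/-- **Data of a traversal.** Let the exploration polygon at mesh `δ ≤ ρ` traverse the shell
`D(x; ρ, R)` between the times `s ≤ t`, with `R ≥ 16Cρ`, `C ≥ 16`. Then there are dart
indices `i' ≤ m ≤ j'` strictly between `tIdx s` and `tIdx t` such that: the stretch over
`[tIdx s, tIdx t]` joins the disc `B̄(x, 4ρ)` to the outside of `B(x, R/2)` (in one of the two
directions); the side segment of the middle dart `m` lies in the annulus
`𝔸 = B(x, R/2) ∖ B̄(x, 4ρ)`; the `4δ`-neighbourhoods of the vertices of the darts `i', …, j'`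
lie in `𝔸`, these vertices being at distance within `δ` of `[Cρ, R/4]` from `x`; and the stretch
`i', …, j'` joins `B̄(x, Cρ + δ)` to the outside of `B(x, R/4 - δ)`. [cite: AizenmanBurchardDuke1999, Appendix A] -/
theorem traversal_data (hδ : 0 < δ) (hexp : IsMedialExploration (dobrushinData Dm δ) ω (a :: l))
    {x : ℂ} {ρ R C : ℝ} (hδρ : δ ≤ ρ) (hC : 16 ≤ C) (hR : 16 * C * ρ ≤ R) {s t : I}
    (hst : (⟨polyline ((a :: l).map (medialPoint δ))⟩ : RandomPlanarGeometry.Curve ℂ).IsTraversal x ρ R s t) :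
    ∃ m i' j' : ℕ, tIdx l s < m ∧ m < tIdx l t ∧ i' ≤ m ∧ m ≤ j' ∧ tIdx l s ≤ i' ∧ j' ≤ tIdx l t ∧
      ((dist (hexp.pS (tIdx l s)) x ≤ 4 * ρ ∧ R / 2 ≤ dist (hexp.pT (tIdx l t)) x) ∨
        (R / 2 ≤ dist (hexp.pS (tIdx l s)) x ∧ dist (hexp.pT (tIdx l t)) x ≤ 4 * ρ)) ∧
      hexp.sideSeg m ⊆ ball x (R / 2) \ closedBall x (4 * ρ) ∧
      (∀ i, i' ≤ i → i ≤ j' →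
        closedBall (meshPoint δ (hexp.cv i)) (4 * δ) ⊆ ball x (R / 2) \ closedBall x (4 * ρ)) ∧
      (∀ i, i' ≤ i → i ≤ j' →
        C * ρ - δ ≤ dist (meshPoint δ (hexp.cv i)) x ∧ dist (meshPoint δ (hexp.cv i)) x ≤ R / 4 + δ) ∧
      ((dist (meshPoint δ (hexp.cv i')) x ≤ C * ρ + δ ∧ R / 4 - δ ≤ dist (meshPoint δ (hexp.cv j')) x) ∨
        (R / 4 - δ ≤ dist (meshPoint δ (hexp.cv i')) x ∧ dist (meshPoint δ (hexp.cv j')) x ≤ C * ρ + δ)) := by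
  have hδ' : 0 < (dobrushinData Dm δ).δ := hδ
  have hρ : 0 < ρ := hδ.trans_le hδρ
  set γ : I → ℂ := fun u => polyline ((a :: l).map (medialPoint δ)) u with hγ
  set f : I → ℝ := fun u => dist (γ u) x with hf
  have hfc : Continuous f := ((polyline ((a :: l).map (medialPoint δ))).continuous).dist continuous_const
  have hcurve : ∀ u, (⟨polyline ((a :: l).map (medialPoint δ))⟩ : RandomPlanarGeometry.Curve ℂ) u = γ u := fun u => rfl
  -- the mesh point of `cv (tIdx u)` is within `δ` of `γ u`
  have hnear : ∀ u, dist (meshPoint δ (hexp.cv (tIdx l u))) x ≤ f u + δ ∧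
      f u - δ ≤ dist (meshPoint δ (hexp.cv (tIdx l u))) x := by
    intro u
    have h := dist_polyline_cv_le hδ hexp u
    constructor
    · linarith [dist_triangle (meshPoint δ (hexp.cv (tIdx l u))) (γ u) x, dist_comm (γ u) (meshPoint δ (hexp.cv (tIdx l u)))]
    · linarith [dist_triangle (γ u) (meshPoint δ (hexp.cv (tIdx l u))) x]
  -- shifted points of the dart `tIdx u` are within `3δ` of `γ u`
  have hpS : ∀ u, dist (hexp.pS (tIdx l u)) x ≤ f u + 3 * δ ∧ f u - 3 * δ ≤ dist (hexp.pT (tIdx l u)) x ∧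
      f u - 3 * δ ≤ dist (hexp.pS (tIdx l u)) x ∧ dist (hexp.pT (tIdx l u)) x ≤ f u + 3 * δ := by
    intro u
    have h := dist_polyline_cv_le hδ hexp u
    have h1 := (hexp.dist_pS_le hδ' (tIdx_lt hexp u)).1
    have h2 := (hexp.dist_pS_le hδ' (tIdx_lt hexp u)).2
    simp only [dobrushinData_δ] at h1 h2
    refine ⟨?_, ?_, ?_, ?_⟩
    · linarith [dist_triangle (hexp.pS (tIdx l u)) (meshPoint δ (hexp.cv (tIdx l u))) x,
        dist_triangle (meshPoint δ (hexp.cv (tIdx l u))) (γ u) x,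
        dist_comm (γ u) (meshPoint δ (hexp.cv (tIdx l u)))]
    · linarith [dist_triangle (γ u) (meshPoint δ (hexp.cv (tIdx l u))) x,
        dist_triangle (meshPoint δ (hexp.cv (tIdx l u))) (hexp.pT (tIdx l u)) x,
        dist_comm (hexp.pT (tIdx l u)) (meshPoint δ (hexp.cv (tIdx l u)))]
    · linarith [dist_triangle (γ u) (meshPoint δ (hexp.cv (tIdx l u))) x,
        dist_triangle (meshPoint δ (hexp.cv (tIdx l u))) (hexp.pS (tIdx l u)) x,
        dist_comm (hexp.pS (tIdx l u)) (meshPoint δ (hexp.cv (tIdx l u)))]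
    · linarith [dist_triangle (hexp.pT (tIdx l u)) (meshPoint δ (hexp.cv (tIdx l u))) x,
        dist_triangle (meshPoint δ (hexp.cv (tIdx l u))) (γ u) x,
        dist_comm (γ u) (meshPoint δ (hexp.cv (tIdx l u)))]
  -- if two times have the same index, their positions are within `2δ`
  have hsame : ∀ u v, tIdx l u = tIdx l v → |f u - f v| ≤ 2 * δ := by
    intro u v huv
    have h1 := dist_polyline_cv_le hδ hexp u
    have h2 := dist_polyline_cv_le hδ hexp v
    rw [huv] at h1
    rw [abs_le]
    constructor <;> linarith [dist_triangle (γ u) (meshPoint δ (hexp.cv (tIdx l v))) x,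
      dist_triangle (γ v) (meshPoint δ (hexp.cv (tIdx l v))) x,
      dist_triangle (meshPoint δ (hexp.cv (tIdx l v))) (γ u) x,
      dist_triangle (meshPoint δ (hexp.cv (tIdx l v))) (γ v) x,
      dist_comm (γ u) (meshPoint δ (hexp.cv (tIdx l v))), dist_comm (γ v) (meshPoint δ (hexp.cv (tIdx l v)))]
  obtain ⟨hst0, hends⟩ := hst
  have hends' : (f s ≤ ρ ∧ R ≤ f t) ∨ (R ≤ f s ∧ f t ≤ ρ) := hends
  clear hends
  have hCρ : 16 * ρ ≤ C * ρ := mul_le_mul_of_nonneg_right hC hρ.le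
  -- the tight crossing of `[Cρ, R/4]` and the middle time
  have hq : C * ρ < R / 4 := by linarith
  have key : ∀ {s₀ t₀ : I}, s ≤ s₀ → s₀ < t₀ → t₀ ≤ t →
      ((f s₀ = C * ρ ∧ f t₀ = R / 4) ∨ (f s₀ = R / 4 ∧ f t₀ = C * ρ)) →
      (∀ u, s₀ ≤ u → u ≤ t₀ → C * ρ ≤ f u ∧ f u ≤ R / 4) →
      ∃ m i' j' : ℕ, tIdx l s < m ∧ m < tIdx l t ∧ i' ≤ m ∧ m ≤ j' ∧ tIdx l s ≤ i' ∧ j' ≤ tIdx l t ∧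
        hexp.sideSeg m ⊆ ball x (R / 2) \ closedBall x (4 * ρ) ∧
        (∀ i, i' ≤ i → i ≤ j' →
          closedBall (meshPoint δ (hexp.cv i)) (4 * δ) ⊆ ball x (R / 2) \ closedBall x (4 * ρ)) ∧
        (∀ i, i' ≤ i → i ≤ j' →
          C * ρ - δ ≤ dist (meshPoint δ (hexp.cv i)) x ∧ dist (meshPoint δ (hexp.cv i)) x ≤ R / 4 + δ) ∧
        ((dist (meshPoint δ (hexp.cv i')) x ≤ C * ρ + δ ∧ R / 4 - δ ≤ dist (meshPoint δ (hexp.cv j')) x) ∨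
          (R / 4 - δ ≤ dist (meshPoint δ (hexp.cv i')) x ∧ dist (meshPoint δ (hexp.cv j')) x ≤ C * ρ + δ)) := by
    intro s₀ t₀ hss₀ hs₀t₀ ht₀t hlev hmid
    -- the middle time: `f u₀ = (Cρ + R/4)/2`
    have hIVT : ∃ u₀ : I, s₀ ≤ u₀ ∧ u₀ ≤ t₀ ∧ f u₀ = (C * ρ + R / 4) / 2 := by
      rcases hlev with ⟨h1, h2⟩ | ⟨h1, h2⟩
      · have := intermediate_value_Icc hs₀t₀.le hfc.continuousOn
          (show (C * ρ + R / 4) / 2 ∈ Icc (f s₀) (f t₀) from ⟨by rw [h1]; linarith, by rw [h2]; linarith⟩)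
        obtain ⟨u₀, ⟨hu1, hu2⟩, hu3⟩ := this
        exact ⟨u₀, hu1, hu2, hu3⟩
      · have := intermediate_value_Icc' hs₀t₀.le hfc.continuousOn
          (show (C * ρ + R / 4) / 2 ∈ Icc (f t₀) (f s₀) from ⟨by rw [h2]; linarith, by rw [h1]; linarith⟩)
        obtain ⟨u₀, ⟨hu1, hu2⟩, hu3⟩ := this
        exact ⟨u₀, hu1, hu2, hu3⟩
    obtain ⟨u₀, hsu₀, hu₀t, hfu₀⟩ := hIVT
    refine ⟨tIdx l u₀, tIdx l s₀, tIdx l t₀, ?_, ?_, tIdx_mono l hsu₀, tIdx_mono l hu₀t,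
      tIdx_mono l hss₀, tIdx_mono l ht₀t, ?_, ?_, ?_, ?_⟩
    · -- `tIdx s < tIdx u₀`: else `|f s - f u₀| ≤ 2δ`
      refine lt_of_le_of_ne (tIdx_mono l (hss₀.trans hsu₀)) fun h => ?_
      have := hsame s u₀ h
      rw [abs_le] at this
      rcases hends' with ⟨h1, -⟩ | ⟨h1, -⟩ <;> linarith [this.1, this.2]
    · refine lt_of_le_of_ne (tIdx_mono l (hu₀t.trans ht₀t)) fun h => ?_
      have := hsame u₀ t h
      rw [abs_le] at this
      rcases hends' with ⟨-, h1⟩ | ⟨-, h1⟩ <;> linarith [this.1, this.2]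
    · -- the side segment of the middle dart
      intro z hz
      have h1 := hexp.sideSeg_subset_closedBall hδ' (tIdx_lt hexp u₀) hz
      simp only [dobrushinData_δ, leftPt] at h1
      rw [mem_closedBall] at h1
      have h2 := (hnear u₀).1
      have h3 := (hnear u₀).2
      rw [hfu₀] at h2 h3
      constructor
      · rw [mem_ball]
        linarith [dist_triangle z (meshPoint δ (hexp.cv (tIdx l u₀))) x]
      · rw [mem_closedBall, not_le]
        linarith [dist_triangle (meshPoint δ (hexp.cv (tIdx l u₀))) z x, dist_comm z (meshPoint δ (hexp.cv (tIdx l u₀)))]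
    · intro i hi1 hi2 z hz
      obtain ⟨u, hu1, hu2, rfl⟩ := exists_time_of_tIdx l hs₀t₀.le hi1 hi2
      obtain ⟨hm1, hm2⟩ := hmid u hu1 hu2
      rw [mem_closedBall] at hz
      have h2 := (hnear u).1
      have h3 := (hnear u).2
      constructor
      · rw [mem_ball]
        linarith [dist_triangle z (meshPoint δ (hexp.cv (tIdx l u))) x]
      · rw [mem_closedBall, not_le]
        linarith [dist_triangle (meshPoint δ (hexp.cv (tIdx l u))) z x, dist_comm z (meshPoint δ (hexp.cv (tIdx l u)))]
    · intro i hi1 hi2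
      obtain ⟨u, hu1, hu2, rfl⟩ := exists_time_of_tIdx l hs₀t₀.le hi1 hi2
      obtain ⟨hm1, hm2⟩ := hmid u hu1 hu2
      exact ⟨by linarith [(hnear u).2], by linarith [(hnear u).1]⟩
    · rcases hlev with ⟨h1, h2⟩ | ⟨h1, h2⟩
      · left
        exact ⟨by linarith [(hnear s₀).1], by linarith [(hnear t₀).2]⟩
      · right
        exact ⟨by linarith [(hnear s₀).2], by linarith [(hnear t₀).1]⟩
  rcases hends' with ⟨hs1, ht1⟩ | ⟨hs1, ht1⟩
  · obtain ⟨s₀, t₀, hss₀, hs₀t₀, ht₀t, hfs₀, hft₀, hmid⟩ :=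
      exists_tight_crossing hfc hst0 hq (by linarith) (by linarith)
    obtain ⟨m, i', j', h1, h2, h3, h4, h5, h6, h7, h8, h9, h10⟩ :=
      key hss₀ hs₀t₀ ht₀t (Or.inl ⟨hfs₀, hft₀⟩) hmid
    refine ⟨m, i', j', h1, h2, h3, h4, h5, h6, Or.inl ⟨?_, ?_⟩, h7, h8, h9, h10⟩
    · linarith [(hpS s).1]
    · linarith [(hpS t).2.1]
  · obtain ⟨s₀, t₀, hss₀, hs₀t₀, ht₀t, hfs₀, hft₀, hmid⟩ :=
      exists_tight_crossing' hfc hst0 hq (by linarith) (by linarith)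
    obtain ⟨m, i', j', h1, h2, h3, h4, h5, h6, h7, h8, h9, h10⟩ :=
      key hss₀ hs₀t₀ ht₀t (Or.inr ⟨hfs₀, hft₀⟩) hmid
    refine ⟨m, i', j', h1, h2, h3, h4, h5, h6, Or.inr ⟨?_, ?_⟩, h7, h8, h9, h10⟩
    · linarith [(hpS s).2.2.1]
    · linarith [(hpS t).2.2.2]

/-! ### The deterministic core: disjoint crossings from many traversals -/

/-- An injection of `Fin j` into a finset of size `≥ j`. [folklore] -/
theorem exists_injective_of_le_card {α : Type*} [DecidableEq α] {S : Finset α} {j : ℕ}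
    (hj : j ≤ S.card) : ∃ f : Fin j → α, Function.Injective f ∧ ∀ i, f i ∈ S := by
  obtain ⟨T, hTS, hTcard⟩ := Finset.exists_subset_card_eq hj
  refine ⟨fun i => (T.equivFin.symm (Fin.cast hTcard.symm i)).1, fun i i' h => ?_, fun i => hTS ?_⟩
  · have := T.equivFin.symm.injective (Subtype.ext h)
    exact Fin.cast_injective _ this
  · exact (T.equivFin.symm (Fin.cast hTcard.symm i)).2

/-- **Disjoint crossings from many traversals** (the deterministic core of Aizenman–Burchard
1999, Appendix A, for the bond exploration interface). Let the exploration polygon of `ω` in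
`dobrushinData D δ` (admissible, `δ ≤ ρ`) traverse `D(x; ρ, R)` at least
`k ≥ (2j₀ + ⌊1/θ⌋₊ + 2 choose 2) + 3` times, where `R ≥ 16Cρ`, `C ≥ 16`, and `θ > 0` is a
modulus of uniform continuity of the boundary curve at scale `ρ`. Then `ω` contains `j₀`
pairwise vertex-disjoint open crossings of the annulus `A(x; Cρ + 3δ, R/4 - 3δ)`, or
`dualConfig ω` contains `j₀` pairwise disjoint dual-open crossings of it: the side components
of the `k` middle darts have pairwise distinct unordered pairs (`sidePair_ne`), hence are at
least `2j₀ + ⌊1/θ⌋₊ + 2` in number; at most `⌊1/θ⌋₊ + 1` of them are tainted by boundary points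
(`card_le_of_separated_frontier_points`, `exists_frontier_of_leftTaint`/`_rightTaint`); the
chains of `j₀` untainted ones of the same side are the crossings
(`left_step_of_untainted`/`right_step_of_untainted`,
`mem_disjointOccurrencePow_annulusOpenCrossing_of_chains`). [cite: AizenmanBurchardDuke1999, Appendix A] -/
theorem arms_of_hasTraversals (hδ : 0 < δ) (hadm : (dobrushinData Dm δ).IsZdAdmissible)
    (hexp : IsMedialExploration (dobrushinData Dm δ) ω (a :: l)) {x : ℂ} {ρ R C θ : ℝ}
    (hδρ : δ ≤ ρ) (hC : 16 ≤ C) (hR : 16 * C * ρ ≤ R) (hθ : 0 < θ)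
    (hmod : ∀ s t : ℝ, |s - t| < θ → dist (Dm.boundary s) (Dm.boundary t) < ρ) {j₀ k : ℕ}
    (hk : (2 * j₀ + ⌊1 / θ⌋₊ + 2).choose 2 + 3 ≤ k)
    (htr : (⟨polyline ((a :: l).map (medialPoint δ))⟩ : RandomPlanarGeometry.Curve ℂ).HasTraversals k x ρ R) :
    ω ∈ disjointOccurrencePow (annulusOpenCrossing x δ (C * ρ + 3 * δ) (R / 4 - 3 * δ)) j₀ ∨
      dualConfig ω ∈
        disjointOccurrencePow (annulusOpenCrossing x δ (C * ρ + 3 * δ) (R / 4 - 3 * δ)) j₀ := by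
  classical
  have hδ' : 0 < (dobrushinData Dm δ).δ := hδ
  have hρ : 0 < ρ := hδ.trans_le hδρ
  have hCρ : 16 * ρ ≤ C * ρ := mul_le_mul_of_nonneg_right hC hρ.le
  have hk3 : 3 ≤ k := le_of_add_le_right hk
  set n := ((a :: l).zip l).length with hn
  set 𝔸 : Set ℂ := ball x (R / 2) \ closedBall x (4 * ρ) with h𝔸
  set X : Set ℂ := 𝔸 \ hexp.pertTrace with hX
  obtain ⟨sT, tT, htrav, hsep⟩ := htr
  have hdata := fun q : Fin k => traversal_data hδ hexp hδρ hC hR (htrav q)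
  choose m i' j' hspec using hdata
  have hm1 := fun q => (hspec q).1
  have hm2 := fun q => (hspec q).2.1
  have hi'm := fun q => (hspec q).2.2.1
  have hmj' := fun q => (hspec q).2.2.2.1
  have hsi' := fun q => (hspec q).2.2.2.2.1
  have hj't := fun q => (hspec q).2.2.2.2.2.1
  have hends := fun q => (hspec q).2.2.2.2.2.2.1
  have hside := fun q => (hspec q).2.2.2.2.2.2.2.1
  have hball := fun q => (hspec q).2.2.2.2.2.2.2.2.1
  have hrad := fun q => (hspec q).2.2.2.2.2.2.2.2.2.1
  have hcends := fun q => (hspec q).2.2.2.2.2.2.2.2.2.2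
  clear hspec
  have htn : ∀ q, tIdx l (tT q) < n := fun q => tIdx_lt hexp (tT q)
  have hmn : ∀ q, m q < n := fun q => (hm2 q).trans (htn q)
  have hj'n : ∀ q, j' q < n := fun q => (hj't q).trans_lt (htn q)
  -- side components and their pairs
  set cL : Fin k → Set ℂ := fun q => connectedComponentIn X (hexp.leftPt (m q)) with hcL
  set cR : Fin k → Set ℂ := fun q => connectedComponentIn X (hexp.rightPt (m q)) with hcR
  -- ordering of traversals in terms of indices
  have horder : ∀ q q' : Fin k, q ≠ q' → m q < tIdx l (sT q') ∨ tIdx l (tT q') < m q := by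
    intro q q' hqq
    rcases lt_or_gt_of_ne hqq with h | h
    · left
      exact (hm2 q).trans_le (tIdx_mono l (hsep h).le)
    · right
      exact (tIdx_mono l (hsep h).le).trans_lt (hm1 q)
  have hpair : ∀ q q' : Fin k, q ≠ q' → s(cL q, cR q) ≠ s(cL q', cR q') := by
    intro q q' hqq
    obtain ⟨c, hcq, hcq'⟩ := Fin.exists_ne_and_ne_of_two_lt q q' hk3
    have hle' := ((hsi' q').trans (hi'm q')).trans ((hmj' q').trans (hj't q'))
    have hlec := ((hsi' c).trans (hi'm c)).trans ((hmj' c).trans (hj't c))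
    have key := hexp.sidePair_ne hδ' (x := x) (r₁ := 4 * ρ) (r₂ := R / 2) (by positivity) (by linarith)
      (ma := m q) (mb := m q') (ib := tIdx l (sT q')) (kb := tIdx l (tT q') - tIdx l (sT q'))
      (ic := tIdx l (sT c)) (kc := tIdx l (tT c) - tIdx l (sT c)) (hmn q)
      (by rw [Nat.add_sub_cancel' hle']; exact htn q') (by rw [Nat.add_sub_cancel' hlec]; exact htn c)
      ⟨(hsi' q').trans (hi'm q'), by rw [Nat.add_sub_cancel' hle']; exact (hmj' q').trans (hj't q')⟩
      (by rw [Nat.add_sub_cancel' hle']; exact horder q q' hqq)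
      (by rw [Nat.add_sub_cancel' hlec]; exact horder q c (Ne.symm hcq))
      (by rw [Nat.add_sub_cancel' hlec]; exact horder q' c (Ne.symm hcq'))
      (hside q) (hside q')
      (by rw [Nat.add_sub_cancel' hle']; exact hends q') (by rw [Nat.add_sub_cancel' hlec]; exact hends c)
    exact key
  -- the finset of side components
  set comp : Fin k × Bool → Set ℂ := fun qb => if qb.2 then cL qb.1 else cR qb.1 with hcomp
  set Cset : Finset (Set ℂ) := Finset.univ.image comp with hCset
  have hcLmem : ∀ q, cL q ∈ Cset := fun q => Finset.mem_image.2 ⟨(q, true), Finset.mem_univ _, by simp [hcomp]⟩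
  have hcRmem : ∀ q, cR q ∈ Cset := fun q => Finset.mem_image.2 ⟨(q, false), Finset.mem_univ _, by simp [hcomp]⟩
  have hmemCset : ∀ c ∈ Cset, ∃ q, c = cL q ∨ c = cR q := by
    intro c hc
    obtain ⟨⟨q, b⟩, -, rfl⟩ := Finset.mem_image.1 hc
    cases b
    · exact ⟨q, Or.inr (by simp [hcomp])⟩
    · exact ⟨q, Or.inl (by simp [hcomp])⟩
  -- `k ≤ (V + 1).choose 2`, hence `V ≥ 2 j₀ + ⌊1/θ⌋₊ + 2`
  set V := Cset.card with hV
  have hkV : k ≤ (V + 1).choose 2 := by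
    have h1 : (Finset.univ.image fun q : Fin k => s(cL q, cR q)).card = k := by
      rw [Finset.card_image_of_injective _ fun q q' h => by_contra fun hne => hpair q q' hne h]
      simp
    have h2 : (Finset.univ.image fun q : Fin k => s(cL q, cR q)) ⊆ Cset.sym2 := by
      intro p hp
      obtain ⟨q, -, rfl⟩ := Finset.mem_image.1 hp
      rw [Finset.mk_mem_sym2_iff]
      exact ⟨hcLmem q, hcRmem q⟩
    have := Finset.card_le_card h2
    rw [h1, Finset.card_sym2] at this
    exact this
  have hVge : 2 * j₀ + ⌊1 / θ⌋₊ + 2 ≤ V := by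
    by_contra h
    push Not at h
    have h1 : (V + 1).choose 2 ≤ (2 * j₀ + ⌊1 / θ⌋₊ + 2).choose 2 := Nat.choose_le_choose 2 (by omega)
    omega
  -- tainted components
  set Tset : Finset (Set ℂ) := Cset.filter (fun c => ∃ z ∈ c, z ∈ frontier Dm.carrier ∧
    4 * ρ + ρ ≤ dist z x ∧ dist z x ≤ R / 2 - ρ) with hTset
  have hcomp_eq : ∀ c ∈ Cset, ∀ z ∈ c, connectedComponentIn X z = c := by
    intro c hc z hz
    obtain ⟨q, rfl | rfl⟩ := hmemCset c hc
    · exact (connectedComponentIn_eq hz).symm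
    · exact (connectedComponentIn_eq hz).symm
  have hTcard : Tset.card ≤ ⌊1 / θ⌋₊ + 1 := by
    have hex : ∀ c ∈ Tset, ∃ z, z ∈ c ∧ z ∈ frontier Dm.carrier ∧ 4 * ρ + ρ ≤ dist z x ∧ dist z x ≤ R / 2 - ρ := by
      intro c hc
      obtain ⟨-, z, hz, h⟩ := Finset.mem_filter.1 hc
      exact ⟨z, hz, h⟩
    choose! zc hzc using hex
    have hinj : Set.InjOn zc Tset := by
      intro c hc c' hc' h
      have h1 := hcomp_eq c (Finset.mem_filter.1 hc).1 _ (hzc c hc).1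
      have h2 := hcomp_eq c' (Finset.mem_filter.1 hc').1 _ (hzc c' hc').1
      rw [← h1, ← h2, h]
    rw [← Finset.card_image_of_injOn hinj]
    refine card_le_of_separated_frontier_points Dm.toJordanDomain (x := x) (r₁ := 4 * ρ) (r₂ := R / 2)
      hθ hmod (K := hexp.pertTrace)
      (pertTrace_disjoint_frontier hδ hexp) _ (fun z hz => ?_) (fun z hz z' hz' hzz => ?_)
    · obtain ⟨c, hc, rfl⟩ := Finset.mem_image.1 hz
      exact (hzc c hc).2
    · obtain ⟨c, hc, rfl⟩ := Finset.mem_image.1 hz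
      obtain ⟨c', hc', rfl⟩ := Finset.mem_image.1 hz'
      rw [hcomp_eq c (Finset.mem_filter.1 hc).1 _ (hzc c hc).1,
        hcomp_eq c' (Finset.mem_filter.1 hc').1 _ (hzc c' hc').1]
      exact fun h => hzz (by rw [h])
  -- untainted components, by side
  set U := Cset \ Tset with hU
  have hUcard : 2 * j₀ + 1 ≤ U.card := by
    have hct : U.card + Tset.card = Cset.card :=
      Finset.card_sdiff_add_card_eq_card (Finset.filter_subset _ Cset : Tset ⊆ Cset)
    omega
  set UL := U.filter (fun c => ∃ q, c = cL q) with hUL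
  set UR := U.filter (fun c => ∃ q, c = cR q) with hUR
  have hULR : U ⊆ UL ∪ UR := by
    intro c hc
    obtain ⟨q, h | h⟩ := hmemCset c (Finset.mem_sdiff.1 hc).1
    · exact Finset.mem_union_left _ (Finset.mem_filter.2 ⟨hc, q, h⟩)
    · exact Finset.mem_union_right _ (Finset.mem_filter.2 ⟨hc, q, h⟩)
  have hsides : j₀ ≤ UL.card ∨ j₀ ≤ UR.card := by
    by_contra h
    push Not at h
    have hle : U.card ≤ UL.card + UR.card := (Finset.card_le_card hULR).trans (Finset.card_union_le _ _)
    omega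
  -- untainted means: no boundary point of the middle annulus in the component
  have huntaint : ∀ c ∈ U, ∀ z ∈ c, z ∈ frontier Dm.carrier → 4 * ρ + ρ ≤ dist z x →
      dist z x ≤ R / 2 - ρ → False := by
    intro c hc z hz h1 h2 h3
    obtain ⟨hc1, hc2⟩ := Finset.mem_sdiff.1 hc
    exact hc2 (Finset.mem_filter.2 ⟨hc1, z, hz, h1, h2, h3⟩)
  -- radii of boundary points near the stretches
  have hradius : ∀ q i, i' q ≤ i → i ≤ j' q → ∀ z, dist z (meshPoint δ (hexp.cv i)) ≤ 4 * δ →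
      4 * ρ + ρ ≤ dist z x ∧ dist z x ≤ R / 2 - ρ := by
    intro q i h1 h2 z hz
    obtain ⟨h3, h4⟩ := hrad q i h1 h2
    constructor
    · linarith [dist_triangle (meshPoint δ (hexp.cv i)) z x, dist_comm z (meshPoint δ (hexp.cv i))]
    · linarith [dist_triangle z (meshPoint δ (hexp.cv i)) x]
  have hr'R' : C * ρ + 3 * δ ≤ R / 4 - 3 * δ + 2 * δ := by linarith
  rcases hsides with hL | hRs
  · -- **left chains**: `ω` has `j₀` disjoint open crossings
    left
    obtain ⟨f, hfinj, hfmem⟩ := exists_injective_of_le_card hL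
    have hfU : ∀ i, f i ∈ U := fun i => (Finset.mem_filter.1 (hfmem i)).1
    have hfq : ∀ i, ∃ q, f i = cL q := fun i => (Finset.mem_filter.1 (hfmem i)).2
    choose qf hqf using hfq
    -- no vertex of the stretch `qf i` is on the arc `A`
    have hnoA : ∀ i j, i' (qf i) ≤ j → j ≤ j' (qf i) → hexp.cv j ∉ (dobrushinData Dm δ).zdArcA := by
      intro i j h1 h2 hjA
      obtain ⟨z, hzfr, hzc, hzd⟩ := exists_frontier_of_leftTaint hδ hexp (A := 𝔸) (hj'n (qf i))
        (hball (qf i)) (hi'm (qf i)) (hmj' (qf i)) h1 h2 hjA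
      obtain ⟨hr1, hr2⟩ := hradius (qf i) j h1 h2 z (by linarith)
      refine huntaint _ (hfU i) z ?_ hzfr hr1 hr2
      rw [hqf i]; exact hzc
    -- vertices of the stretch lie in the component `f i`
    have hvmem : ∀ i j, i' (qf i) ≤ j → j ≤ j' (qf i) → meshPoint δ (hexp.cv j) ∈ f i := by
      intro i j h1 h2
      rw [hqf i]
      have hball' : ∀ j, i' (qf i) ≤ j → j ≤ j' (qf i) → closedBall (meshPoint δ (hexp.cv j)) δ ⊆ 𝔸 :=
        fun j h1 h2 => (closedBall_subset_closedBall (by linarith)).trans (hball (qf i) j h1 h2)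
      exact hexp.cv_mem_connectedComponentIn hδ' (hj'n (qf i)) hball' h1 h2 (hi'm (qf i)) (hmj' (qf i))
    have hmem := mem_disjointOccurrencePow_annulusOpenCrossing_of_chains (ω := ω ∩ (zdGraph 2).edgeSet)
      hδ.le (x := x) hr'R' (fun v w h => by
        rw [dist_meshPoint_of_adj ((SimpleGraph.mem_edgeSet _).1 h.2), abs_of_pos hδ])
      (j := j₀) (N := fun i => j' (qf i) - i' (qf i))
      (fun i p => hexp.cv (i' (qf i) + p)) (fun i p hp => ?_) (fun i => ?_) (fun i i₂ hii p p' heq => ?_)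
    · exact (isUpperSet_annulusOpenCrossing x δ _ _).disjointOccurrencePow j₀ inter_subset_left hmem
    · -- chain step
      have h1 : i' (qf i) + p + 1 ≤ j' (qf i) := by
        have := p.2; have := hi'm (qf i); have := hmj' (qf i); omega
      rcases left_step_of_untainted hexp (i := i' (qf i) + p + 1) (by omega) (by have := hj'n (qf i); omega)
        (hnoA i _ (by omega) h1) with h | ⟨h, hadj⟩
      · left; simpa [Nat.add_sub_cancel, add_assoc] using h
      · right
        simp only [Nat.add_sub_cancel] at h hadj
        rw [← add_assoc]
        exact ⟨h, (SimpleGraph.mem_edgeSet _).2 hadj⟩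
    · -- ends
      simp only [Fin.val_zero, add_zero, Fin.val_last, Nat.add_sub_cancel' (hi'm (qf i) |>.trans (hmj' (qf i)))]
      rcases hcends (qf i) with ⟨h1, h2⟩ | ⟨h1, h2⟩
      · left; constructor <;> linarith
      · right; constructor <;> linarith
    · -- disjointness: a common vertex would lie in two distinct components
      have h1 := hvmem i (i' (qf i) + p) (by omega)
        (by have := p.2; have := hi'm (qf i); have := hmj' (qf i); omega)
      have h2 := hvmem i₂ (i' (qf i₂) + p') (by omega)
        (by have := p'.2; have := hi'm (qf i₂); have := hmj' (qf i₂); omega)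
      rw [heq] at h1
      have hc1 := hcomp_eq (f i) (Finset.mem_sdiff.1 (hfU i)).1 _ h1
      have hc2 := hcomp_eq (f i₂) (Finset.mem_sdiff.1 (hfU i₂)).1 _ h2
      exact hii (hfinj (hc1.symm.trans hc2))
  · -- **right chains**: `dualConfig ω` has `j₀` disjoint open crossings of the dual lattice
    right
    obtain ⟨f, hfinj, hfmem⟩ := exists_injective_of_le_card hRs
    have hfU : ∀ i, f i ∈ U := fun i => (Finset.mem_filter.1 (hfmem i)).1
    have hfq : ∀ i, ∃ q, f i = cR q := fun i => (Finset.mem_filter.1 (hfmem i)).2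
    choose qf hqf using hfq
    -- no corner of a face of the stretch `qf i` is on the arc `B`
    have hnoB : ∀ i j, i' (qf i) ≤ j → j ≤ j' (qf i) → ∀ u', IsCorner u' (hexp.cf j) →
        u' ∉ (dobrushinData Dm δ).zdArcB := by
      intro i j h1 h2 u' hu' hB
      obtain ⟨z, hzfr, hzc, hzd⟩ := exists_frontier_of_rightTaint hδ hadm hexp (A := 𝔸) (hj'n (qf i))
        (hball (qf i)) (hi'm (qf i)) (hmj' (qf i)) h1 h2 hu' hB
      obtain ⟨hr1, hr2⟩ := hradius (qf i) j h1 h2 z hzd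
      refine huntaint _ (hfU i) z ?_ hzfr hr1 hr2
      rw [hqf i]; exact hzc
    have hfcmem : ∀ i j, i' (qf i) ≤ j → j ≤ j' (qf i) → (δ • faceCenter (hexp.cf j) : ℂ) ∈ f i := by
      intro i j h1 h2
      rw [hqf i]
      have hball' : ∀ j, i' (qf i) ≤ j → j ≤ j' (qf i) → closedBall (meshPoint δ (hexp.cv j)) δ ⊆ 𝔸 :=
        fun j h1 h2 => (closedBall_subset_closedBall (by linarith)).trans (hball (qf i) j h1 h2)
      exact hexp.cf_mem_connectedComponentIn hδ' (hj'n (qf i)) hball' h1 h2 (hi'm (qf i)) (hmj' (qf i))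
    -- the corner `cf j` of the face `cf j` is within `2δ` of `cv j`
    have hcfcv : ∀ j, j < n → dist (meshPoint δ (hexp.cf j)) (meshPoint δ (hexp.cv j)) ≤ 2 * δ := by
      intro j hj
      have := closedSq_subset_closedBall (hexp.isCorner hj) (toComplex_mem_closedSq (isCorner_self (hexp.cf j)))
      rw [mem_closedBall] at this
      rw [meshPoint_eq_smul, meshPoint_eq_smul, dist_smul₀, Real.norm_eq_abs, abs_of_pos hδ]
      nlinarith
    refine mem_disjointOccurrencePow_annulusOpenCrossing_of_chains (ω := dualConfig ω)
      hδ.le (x := x) hr'R' (fun v w h => by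
        rw [dist_meshPoint_of_adj ((SimpleGraph.mem_edgeSet _).1 (mem_dualConfig_iff.1 h).1), abs_of_pos hδ])
      (j := j₀) (N := fun i => j' (qf i) - i' (qf i))
      (fun i p => hexp.cf (i' (qf i) + p)) (fun i p hp => ?_) (fun i => ?_) (fun i i₂ hii p p' heq => ?_)
    · have h1 : i' (qf i) + p + 1 ≤ j' (qf i) := by
        have := p.2; have := hi'm (qf i); have := hmj' (qf i); omega
      rcases right_step_of_untainted hexp (i := i' (qf i) + p + 1) (by omega) (by have := hj'n (qf i); omega)
        (by simpa only [Nat.add_sub_cancel] using hnoB i (i' (qf i) + p) (by omega) (by omega)) with h | h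
      · left; simpa [Nat.add_sub_cancel, add_assoc] using h
      · right
        simp only [Nat.add_sub_cancel] at h
        rw [← add_assoc]
        exact h
    · simp only [Fin.val_zero, add_zero, Fin.val_last, Nat.add_sub_cancel' (hi'm (qf i) |>.trans (hmj' (qf i)))]
      have h3 := hcfcv (i' (qf i)) (by have := hj'n (qf i); have := hi'm (qf i); have := hmj' (qf i); omega)
      have h4 := hcfcv (j' (qf i)) (hj'n (qf i))
      rcases hcends (qf i) with ⟨h1, h2⟩ | ⟨h1, h2⟩
      · left; constructor
        · linarith [dist_triangle (meshPoint δ (hexp.cf (i' (qf i)))) (meshPoint δ (hexp.cv (i' (qf i)))) x]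
        · linarith [dist_triangle (meshPoint δ (hexp.cv (j' (qf i)))) (meshPoint δ (hexp.cf (j' (qf i)))) x,
            dist_comm (meshPoint δ (hexp.cf (j' (qf i)))) (meshPoint δ (hexp.cv (j' (qf i))))]
      · right; constructor
        · linarith [dist_triangle (meshPoint δ (hexp.cv (i' (qf i)))) (meshPoint δ (hexp.cf (i' (qf i)))) x,
            dist_comm (meshPoint δ (hexp.cf (i' (qf i)))) (meshPoint δ (hexp.cv (i' (qf i))))]
        · linarith [dist_triangle (meshPoint δ (hexp.cf (j' (qf i)))) (meshPoint δ (hexp.cv (j' (qf i)))) x]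
    · have h1 := hfcmem i (i' (qf i) + p) (by omega)
        (by have := p.2; have := hi'm (qf i); have := hmj' (qf i); omega)
      have h2 := hfcmem i₂ (i' (qf i₂) + p') (by omega)
        (by have := p'.2; have := hi'm (qf i₂); have := hmj' (qf i₂); omega)
      rw [heq] at h1
      have hc1 := hcomp_eq (f i) (Finset.mem_sdiff.1 (hfU i)).1 _ h1
      have hc2 := hcomp_eq (f i₂) (Finset.mem_sdiff.1 (hfU i₂)).1 _ h2
      exact hii (hfinj (hc1.symm.trans hc2))

/-! ### A modulus of uniform continuity of the boundary curve -/

/-- **The boundary loop is uniformly continuous** (continuous and `1`-periodic): for every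
`η > 0` there is `θ > 0` with `dist (b(s), b(t)) < η` whenever `|s - t| < θ`. [folklore] -/
theorem JordanDomain.exists_modulus (Dj : RandomPlanarGeometry.JordanDomain) {η : ℝ} (hη : 0 < η) :
    ∃ θ : ℝ, 0 < θ ∧ ∀ s t : ℝ, |s - t| < θ → dist (Dj.boundary s) (Dj.boundary t) < η := by
  have huc : UniformContinuousOn Dj.boundary (Icc (-1) 2) :=
    isCompact_Icc.uniformContinuousOn_of_continuous Dj.continuous_boundary.continuousOn
  rw [Metric.uniformContinuousOn_iff] at huc
  obtain ⟨θ, hθ, h⟩ := huc η hη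
  refine ⟨min θ 1, lt_min hθ one_pos, fun s t hst => ?_⟩
  have hθ' : |s - t| < θ := hst.trans_le (min_le_left _ _)
  have h1 : |s - t| < 1 := hst.trans_le (min_le_right _ _)
  -- reduce to the window `[-1, 2]` by periodicity
  set s₁ := Int.fract s with hs₁
  set t₁ := Int.fract s + (t - s) with ht₁
  have hbs : Dj.boundary s₁ = Dj.boundary s := by
    rw [hs₁, Int.fract]
    have := Dj.periodic_boundary.sub_int_mul_eq (x := s) ⌊s⌋
    rwa [mul_one] at this
  have hbt : Dj.boundary t₁ = Dj.boundary t := by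
    have e : t₁ = t - ⌊s⌋ * 1 := by rw [ht₁, Int.fract]; ring
    rw [e]
    exact Dj.periodic_boundary.sub_int_mul_eq ⌊s⌋
  have hs₁mem : s₁ ∈ Icc (-1 : ℝ) 2 :=
    ⟨by linarith [Int.fract_nonneg s], by linarith [Int.fract_lt_one s]⟩
  have ht₁mem : t₁ ∈ Icc (-1 : ℝ) 2 := by
    rw [abs_lt] at h1
    exact ⟨by rw [ht₁]; linarith [Int.fract_nonneg s], by rw [ht₁]; linarith [Int.fract_lt_one s]⟩
  have hd : dist s₁ t₁ < θ := by
    rw [Real.dist_eq, ht₁, show s₁ - (Int.fract s + (t - s)) = s - t by rw [hs₁]; ring]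
    exact hθ'
  rw [← hbs, ← hbt]
  exact h s₁ hs₁mem t₁ ht₁mem hd

/-! ### Proof of `bondExploration_traversalBound` -/

/-- **Proof of `bondExploration_traversalBound`** (Aizenman–Burchard 1999, hypothesis H1,
eq. (1.3), and Appendix A, Thm A.1, for the bond exploration interface in a Jordan Dobrushin
domain, tree formulation). With `α, c₀` from `annulusOpenCrossing_half_le_holds`, put
`C = max 16 c₀`, `j₀ = ⌈3/α⌉₊ + 1`, threshold
`k(x, ρ, R) = ((2j₀ + ⌊1/θ(ρ)⌋₊ + 2) choose 2) + 3` (`θ(ρ)` a modulus of uniform continuity of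
`∂D` at scale `ρ`), `λ = 3`, `K = max ((16C)^3) (2 (8(C+3))^{α j₀})`, `δ₀ = 1`. For
`R < 16Cρ` the bound is trivial (`K (ρ/R)^3 ≥ 1`); otherwise `arms_of_hasTraversals` puts the
event inside `A□^{j₀} ∪ dualConfig⁻¹(A□^{j₀})` for the crossing event `A` of
`A(x; Cρ + 3δ, R/4 - 3δ)`, of probability `≤ 2 ((Cρ+3δ)/(R/4-3δ))^{α j₀} ≤ K (ρ/R)^3` by the
iterated BK–Reimer inequality, the RSW one-crossing bound and self-duality.
[cite: AizenmanBurchardDuke1999, §1.b (1.3) and Appendix A Thm A.1] -/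
theorem bondExploration_traversalBound_holds : bondExploration_traversalBound := by
  classical
  intro D
  obtain ⟨α, c₀, hα, hc₀, hone⟩ := annulusOpenCrossing_half_le_holds
  set C : ℝ := max 16 c₀ with hCdef
  have hC : (16 : ℝ) ≤ C := le_max_left _ _
  have hCc₀ : c₀ ≤ C := le_max_right _ _
  set j₀ : ℕ := ⌈3 / α⌉₊ + 1 with hj₀
  have hαj₀ : (3 : ℝ) ≤ α * j₀ := by
    have h1 : 3 / α ≤ (⌈3 / α⌉₊ : ℝ) := Nat.le_ceil _
    have h2 : (⌈3 / α⌉₊ : ℝ) ≤ (j₀ : ℝ) := by rw [hj₀]; push_cast; linarith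
    calc (3 : ℝ) = α * (3 / α) := by field_simp
      _ ≤ α * j₀ := mul_le_mul_of_nonneg_left (h1.trans h2) hα.le
  have hmodex : ∀ η : ℝ, 0 < η →
      ∃ θ : ℝ, 0 < θ ∧ ∀ s t : ℝ, |s - t| < θ → dist (D.boundary s) (D.boundary t) < η :=
    fun η hη => JordanDomain.exists_modulus D.toJordanDomain hη
  set θf : ℝ → ℝ := fun ρ => if h : 0 < ρ then (hmodex ρ h).choose else 1 with hθf
  have hθf_spec : ∀ ρ (h : 0 < ρ), 0 < θf ρ ∧
      ∀ s t : ℝ, |s - t| < θf ρ → dist (D.boundary s) (D.boundary t) < ρ := by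
    intro ρ h
    simp only [hθf, dif_pos h]
    exact (hmodex ρ h).choose_spec
  set kf : ℂ → ℝ → ℝ → ℕ := fun _ ρ _ => (2 * j₀ + ⌊1 / θf ρ⌋₊ + 2).choose 2 + 3 with hkf
  set K : ℝ := max ((16 * C) ^ (3 : ℕ)) (2 * (8 * (C + 3)) ^ (α * j₀)) with hKdef
  have hK16 : (16 * C) ^ (3 : ℕ) ≤ K := le_max_left _ _
  have hK2 : 2 * (8 * (C + 3)) ^ (α * j₀) ≤ K := le_max_right _ _
  refine ⟨kf, K, 3, 1, le_trans (by positivity) hK16, by norm_num, one_pos, ?_⟩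
  intro δ hδ hadm x ρ R hδρ hρR hR1
  obtain ⟨hδ0, -⟩ := hδ
  have hρ : 0 < ρ := hδ0.trans_le hδρ
  have hR : 0 < R := hρ.trans hρR
  set P := bondPercolation (zdGraph 2) half with hP
  have hrpow : (ρ / R) ^ (3 : ℝ) = (ρ / R) ^ (3 : ℕ) := by
    rw [show (3 : ℝ) = ((3 : ℕ) : ℝ) by norm_num, Real.rpow_natCast]
  rw [hrpow]
  by_cases hreg : 16 * C * ρ ≤ R
  swap
  · -- small ratio: the bound is `≥ 1`
    refine (prob_le_one).trans ?_
    rw [← ENNReal.ofReal_one]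
    apply ENNReal.ofReal_le_ofReal
    push Not at hreg
    have h1 : 1 ≤ 16 * C * (ρ / R) := by
      rw [mul_div_assoc', le_div_iff₀ hR]; linarith
    calc (1 : ℝ) ≤ (16 * C * (ρ / R)) ^ (3 : ℕ) := one_le_pow₀ h1
      _ = (16 * C) ^ (3 : ℕ) * (ρ / R) ^ (3 : ℕ) := by ring
      _ ≤ K * (ρ / R) ^ (3 : ℕ) := by gcongr
  · -- the genuine estimate
    obtain ⟨hθ, hmod⟩ := hθf_spec ρ hρ
    set r' := C * ρ + 3 * δ with hr'
    set R' := R / 4 - 3 * δ with hR'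
    set A := annulusOpenCrossing x δ r' R' with hA
    set S := disjointOccurrencePow A j₀ with hS
    have hCρ : 16 * ρ ≤ C * ρ := mul_le_mul_of_nonneg_right hC hρ.le
    have hr'0 : 0 ≤ r' / R' := div_nonneg (by rw [hr']; positivity) (by rw [hR']; linarith)
    -- the event is inside `S ∪ dualConfig ⁻¹' S`
    have hsub : {ω | (bondExplorationCurve D δ ω).HasTraversals (kf x ρ R) x ρ R} ⊆ S ∪ dualConfig ⁻¹' S := by
      intro ω hω
      simp only [mem_setOf_eq] at hω
      rcases medialExploration_eq_nil_or (dobrushinData D δ) ω with hnil | hexp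
      · -- junk constant curve: no traversal
        exfalso
        obtain ⟨s, t, hst, -⟩ := hω
        have hk0 : 0 < kf x ρ R := by simp [hkf]
        obtain ⟨i⟩ : Nonempty (Fin (kf x ρ R)) := Fin.pos_iff_nonempty.1 hk0
        have h := (hst i).2
        have e : ∀ u, (bondExplorationCurve D δ ω) u = 0 := by
          intro u
          show medialExplorationCurve (dobrushinData D δ) ω u = 0
          rw [medialExplorationCurve, hnil]; simp
        rw [e, e] at h
        rcases h with ⟨h1, h2⟩ | ⟨h1, h2⟩ <;> linarith
      · obtain ⟨b, l', hbl⟩ := List.exists_cons_of_ne_nil hexp.ne_nil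
        rw [hbl] at hexp
        have hcurve : bondExplorationCurve D δ ω = ⟨polyline ((b :: l').map (medialPoint δ))⟩ := by
          show (⟨medialExplorationCurve (dobrushinData D δ) ω⟩ : RandomPlanarGeometry.Curve ℂ) = _
          rw [medialExplorationCurve, hbl]; rfl
        rw [hcurve] at hω
        rcases arms_of_hasTraversals hδ0 hadm hexp hδρ hC hreg hθ hmod (j₀ := j₀) (le_rfl) hω with h | h
        · exact Or.inl h
        · exact Or.inr h
    -- probabilities
    have hPS : P S ≤ ENNReal.ofReal ((r' / R') ^ (α * j₀)) := by
      have hloc := isLocalEvent_annulusOpenCrossing hδ0 x r' R'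
      have h1 := measureReal_disjointOccurrencePow_le (zdGraph 2) half hloc j₀
      have h2 : P.real A ≤ (r' / R') ^ α := hone x δ r' R' hδ0 (by rw [hr']; nlinarith) (by rw [hr', hR']; linarith)
      have h3 : P.real S ≤ ((r' / R') ^ α) ^ j₀ := h1.trans (pow_le_pow_left₀ measureReal_nonneg h2 j₀)
      rw [← Real.rpow_natCast, ← Real.rpow_mul hr'0] at h3
      calc P S = ENNReal.ofReal (P.real S) := (ENNReal.ofReal_toReal (measure_ne_top _ _)).symm
        _ ≤ ENNReal.ofReal ((r' / R') ^ (α * j₀)) := ENNReal.ofReal_le_ofReal h3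
    have hPdual : P (dualConfig ⁻¹' S) ≤ P S := by
      calc P (dualConfig ⁻¹' S) ≤ P.map dualConfig S := Measure.le_map_apply measurable_dualConfig.aemeasurable _
        _ = P S := by
          rw [hP, bondPercolation_map_dualConfig_holds half,
            show unitInterval.symm half = half from Subtype.ext (by simp [half]; norm_num)]
    -- the real inequality `2 (r'/R')^{αj₀} ≤ K (ρ/R)^3`
    have hratio : r' / R' ≤ 8 * (C + 3) * (ρ / R) := by
      have hR'pos : 0 < R' := by rw [hR']; linarith
      rw [div_le_iff₀ hR'pos, hr', hR']
      have : 8 * (C + 3) * (ρ / R) * (R / 4 - 3 * δ) = (C + 3) * ρ * 2 - 8 * (C + 3) * (ρ / R) * 3 * δ := by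
        field_simp
        ring
      nlinarith [mul_pos hρ hR, div_nonneg hρ.le hR.le, mul_nonneg (by linarith : (0:ℝ) ≤ C + 3) (div_nonneg hρ.le hR.le)]
    have hreal : 2 * (r' / R') ^ (α * j₀) ≤ K * (ρ / R) ^ (3 : ℕ) := by
      have hexp0 : 0 ≤ α * j₀ := by positivity
      have h1 : (r' / R') ^ (α * j₀) ≤ (8 * (C + 3) * (ρ / R)) ^ (α * j₀) :=
        Real.rpow_le_rpow hr'0 hratio hexp0
      have hρR : ρ / R ≤ 1 := (div_le_one hR).2 hρR.le
      have hρR0 : 0 ≤ ρ / R := div_nonneg hρ.le hR.le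
      have h2 : (8 * (C + 3) * (ρ / R)) ^ (α * j₀) = (8 * (C + 3)) ^ (α * j₀) * (ρ / R) ^ (α * j₀) :=
        Real.mul_rpow (by positivity) hρR0
      have h3 : (ρ / R) ^ (α * j₀) ≤ (ρ / R) ^ (3 : ℕ) := by
        rw [← Real.rpow_natCast]
        exact Real.rpow_le_rpow_of_exponent_ge (div_pos hρ hR) hρR (by push_cast; exact hαj₀)
      calc 2 * (r' / R') ^ (α * j₀) ≤ 2 * ((8 * (C + 3)) ^ (α * j₀) * (ρ / R) ^ (α * j₀)) := by rw [← h2]; linarith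
        _ ≤ 2 * ((8 * (C + 3)) ^ (α * j₀) * (ρ / R) ^ (3 : ℕ)) := by gcongr
        _ = (2 * (8 * (C + 3)) ^ (α * j₀)) * (ρ / R) ^ (3 : ℕ) := by ring
        _ ≤ K * (ρ / R) ^ (3 : ℕ) := by gcongr
    calc P {ω | (bondExplorationCurve D δ ω).HasTraversals (kf x ρ R) x ρ R}
        ≤ P (S ∪ dualConfig ⁻¹' S) := measure_mono hsub
      _ ≤ P S + P (dualConfig ⁻¹' S) := measure_union_le _ _
      _ ≤ ENNReal.ofReal ((r' / R') ^ (α * j₀)) + ENNReal.ofReal ((r' / R') ^ (α * j₀)) :=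
          add_le_add hPS (hPdual.trans hPS)
      _ = ENNReal.ofReal (2 * (r' / R') ^ (α * j₀)) := by
          rw [← ENNReal.ofReal_add (Real.rpow_nonneg hr'0 _) (Real.rpow_nonneg hr'0 _)]; ring_nf
      _ ≤ ENNReal.ofReal (K * (ρ / R) ^ (3 : ℕ)) := ENNReal.ofReal_le_ofReal hreal

/-- **crit-perc.S26 for bond percolation: the interface laws are tight.** Discharge of
`Literature.Probability.Percolation.isTightLaws_map_bondInterface` (Aizenman–Burchard 1999, Thm 1.2, bond-`ℤ²`
exploration interface in a Dobrushin domain): the abstract tightness criterion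
(`isTightMeasureSet_of_traversalBounds`, AB99 Thms 1.1–1.2), the lattice short-distance cutoff
and the large-mesh case (`InterfaceScalingLimitProofs.lean`), and the multiple-crossing
estimate `bondExploration_traversalBound_holds` above. [cite: AizenmanBurchardDuke1999, Thm 1.2] -/
theorem isTightLaws_map_bondInterface_holds : isTightLaws_map_bondInterface :=
  isTightLaws_map_bondInterface_of_traversalBound bondExploration_traversalBound_holds

end Literature.Probability.Percolation

end TraversalBound
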